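import Mathlib.GroupTheory.SpecificGroups.Alternating
import Mathlib.GroupTheory.Transfer
import Mathlib.GroupTheory.GroupAction.Primitive
import Mathlib.GroupTheory.Perm.Cycle.Type
import Mathlib.LinearAlgebra.Matrix.GeneralLinearGroup.Basic
import Literature.NumberTheory.GaloisRepresentations.ExtendedAdequateSubgroup
import Literature.NumberTheory.GaloisRepresentations.ResidualGaloisRep
import Literature.RepresentationTheory.Semisimple.BurnsideMatrixSpan
import HarnessLib

/-!
# Adequacy of linear groups of degree `p` (Guralnick–Herzig–Tiep 2017, Theorem 1.7)

Topic `NumberTheory/GaloisRepresentations`, next to `ExtendedAdequateSubgroup.lean` (the extended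
notion of adequacy `Subgroup.IsExtendedAdequate`, GHT 2017 §1 = Thorne 2017 Def. 2.20) and
`ResidualGaloisRep.lean` (`IsAbsIrreducible` for `σ : G →* GL_n(k)`).  One NAMED FACT, no
`sorry`, no new definition; plus (proved) the reduction of the fact to algebraically closed
coefficient fields, step 0 of the printed proof, and (proved) the IMPRIMITIVE CASE of the theorem,
GHT Proposition 6.6, over any field of characteristic `p` (see "Towards the proof" below).

Source: R. M. Guralnick, F. Herzig, P. H. Tiep, *Adequate subgroups and indecomposable modules*,
J. Eur. Math. Soc. 19 (2017) 1231–1291, doi:10.4171/jems/692 = arXiv:1405.0043, **Theorem 1.7**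
(p. 4; restated and proved as Theorem 6.15, p. 24), as printed:

> Theorem 1.7. Let `k` be a field of characteristic `p` and `G` a finite group. Let `V` be an
> absolutely irreducible faithful `kG`-module with `dim V = p`. Then precisely one of the following
> holds: (a) `(G, V)` is adequate; (b) `G` contains a normal abelian subgroup of index `p`;
> (c) `p = 3` and the image of `G` in `PGL(V)` is `PSL₂(9)`.

("adequate" in the extended sense of their §1, p. 3: `H¹(G,k) = 0`, `H¹(G,(V* ⊗ V)/k) = 0`,
`End(V)` spanned by the semisimple `ρ(g)` — the tree's `Subgroup.IsExtendedAdequate`.)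

## What is recorded, and how it is typed

* `V = kᵖ` with `G` acting through a FAITHFUL `σ : G →* GL_p(k)` (`Function.Injective σ`), so
  that `(G, V)` is the subgroup `σ(G) = σ.range ≤ GL_p(k)` with its tautological module; absolute
  irreducibility is the tree's `IsAbsIrreducible σ` (irreducible after every extension of scalars
  `k →+* k'`); `k` of characteristic `p` is `[Fact p.Prime] [CharP k p]`; `G` finite is
  `[Finite G]`.
* (a) is `Subgroup.IsExtendedAdequate σ.range` (its "semisimple" = of order prime to `p`, which
  for the finite group `σ(G)` is GHT's meaning, see the Design notes of
  `ExtendedAdequateSubgroup.lean`).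
* (b) is an abelian normal subgroup `A ⊴ G` with `A.index = p` (commutativity written elementwise).
* (c): `PGL(V) = GL(V)/Z(GL(V))` (the centre of `GL_p(k)` is the group of scalars), the image of
  `G` there is `(σ.range).map (QuotientGroup.mk' (center (GL_p k)))`, and "is `PSL₂(9)`" is
  recorded as an abstract group isomorphism with the alternating group `A₆` — `PSL₂(9) ≅ A₆`,
  which is how GHT themselves name this group in the proof of Thm 6.15 (p. 24:
  "`H = PSL₂(9) ≅ 𝔄₆`"); Mathlib's `alternatingGroup (Fin 6)` is used so that no projective
  special linear group has to be built.
* ONLY THE DISJUNCTION "(a) or (b) or (c)" is recorded — the part of "precisely one" that is used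
  to DEDUCE adequacy by excluding (b) and (c) (e.g. `G = S₄` on the branch-point module `𝔽₃⁴/Δ`,
  `p = 3 = dim V`: `S₄` has no normal subgroup of index `3` and its image in `PGL₃` has order
  `24 ≠ 360`, the case wanted by work item wi-37170 for Thorne's minimal lifting theorem).  The
  mutual exclusivity of (a), (b), (c) is part of the printed theorem and is NOT asserted here.
* Universe-polymorphic in `k : Type u` and `G : Type v` (as Mathlib's `UnivLE`); a user writes
  `(h : ght2017_adequate_or_index_p_or_psl29)` and the levels are inferred at the application.

## Towards the proof: what is proved here, and what is not

The printed proof is Theorem 6.15 (`k = k̄`, `V` irreducible) plus the standing reduction of §1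
(p. 4): "the dimension of cohomology groups and the dimension of the span of the semisimple
elements … does not change under extension of scalars".  PROVED below (section `Descent` and the
last section): the descent of all three clauses of extended adequacy along an arbitrary field
embedding `f : k →+* k'` (`Subgroup.IsExtendedAdequate.of_map`: (i) by composing with `f`,
(iii) by the trace-orthogonal of the semisimple span, (ii) by an entrywise `k`-linear retraction of
`f`, which commutes with conjugation by `k`-rational matrices), the invariance of the projective
image `G → PGL_p` under extension of scalars (`nonempty_mulEquiv_projectiveImage_map`), and hence
the reduction `ght2017_adequate_or_index_p_or_psl29_of_isAlgClosed`: the named fact follows from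
its algebraically-closed, irreducible case — Theorem 6.15 as printed.  PROVED further (sections
`CocycleGeneralities` … `Lines` at the end of the file): the IMPRIMITIVE branch of Theorem 6.15,
**GHT Proposition 6.6**, for a finite irreducible `H ≤ GL_p(k)` permuting the `p` lines of a basis
through `θ : H → S_p` with non-central kernel `A` — adequate iff `[H : A] ≠ p`
(`Subgroup.isExtendedAdequate_of_monomial`, `Subgroup.isExtendedAdequate_of_lines`,
`Subgroup.not_isExtendedAdequate_of_monomial_of_index_eq`), over ANY field of characteristic `p`
and without the classification; the printed appeal to the Green correspondence (Lemma 6.2) and to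
Schur multipliers (Lemma 6.3) for `H¹` is replaced by an elementary restriction–averaging and
cyclic-norm argument (see the section docstring there).  This case covers, e.g., `S₄` on `𝔽₃⁴/Δ`
(`p = 3`, `A = V₄`, `[H : A] = 6`), and that instance — THE CASE `G = S₄`, `p = 3` OF THEOREM 1.7,
the one the tree uses — is PROVED UNCONDITIONALLY at the very end of the file
(`isExtendedAdequate_range_of_perm_fin4`, `isExtendedAdequate_range_of_isAbsIrreducible_perm_fin4`,
`isExtendedAdequate_range_of_perm_card_four`: for `k` of characteristic `3` and ANY
`σ : S₄ →* GL₃(k)` whose matrices span `M₃(k)`, i.e. absolutely irreducible, `σ(S₄)` is adequate in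
the extended sense; the line structure is supplied by the eigenbasis of the Klein four-group,
`Sym4.exists_normalForm`, and faithfulness is automatic, `Sym4.span_ne_top_of_map_k₁_eq_one`), so
that users of the named fact in this instance (`G ≅ S₄`, e.g. `Sym(Roots f)` of a quartic) can
replace the hypothesis `(h : ght2017_adequate_or_index_p_or_psl29)` by these theorems.  NOT in the
tree: the PRIMITIVE branch of Theorem 6.15, whose
proof runs through the classification of the finite irreducible subgroups of `GL_p(k̄)` (GHT
Prop. 6.5, via Zieschang's theorem on transitive groups of prime degree and Aschbacher's theorem,
and GHT Thm. 2.2, a case analysis over the finite simple groups with the tables of [JLPW], [HM2]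
and the Modular Atlas), the `Ext¹` computations of [AJL], [Mc], [KL] and machine computations
(Props. 6.7–6.14, Cor. 9.4–9.5) — none of which Mathlib has.  The fact therefore remains a cited
named hypothesis; `ght2017_adequate_or_index_p_or_psl29_of_primitive` (last section) records the
sharpened reduction: the fact follows from the algebraically closed case restricted to the `τ`
whose image admits NO line-permutation structure with non-central kernel (the primitive groups of
Prop. 6.5 (ii) and the centrally-imprimitive sub-case of its proof).  FOR `p = 2` THIS REMAINING
CASE IS PROVED, classification-free, in the sibling file `AdequacyDegreeTwo.lean`
(`DegreeTwoAdequacy.isExtendedAdequate_range_or_exists_lines`; `ght2017_adequate_or_index_two` =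
Theorem 1.7 for `p = 2` over any field of characteristic `2`; and
`ght2017_adequate_or_index_p_or_psl29_of_primitive_odd`: the classification-dependent hypothesis is
needed for ODD `p` only).  For ODD `p` the STRUCTURAL half of Prop. 6.5 (ii) — primitive (all
line-permutation structures have central kernel) ⇒ almost quasisimple, with a layer `L ≤ τ(G)`
normalised by `τ(G)`, irreducible, perfect, contained in `SL_p` and SIMPLE as an abstract group —
is PROVED classification-free (elementary Clifford theory in prime degree) in the sibling file
`PrimeDegreePrimitiveQuasisimple.lean` (`Subgroup.exists_quasisimple_normal_of_primitive`,
`Subgroup.exists_simple_normal_of_primitive`, `not_exists_comm_normal_index_of_primitive`: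
alternative (b) cannot occur there; `Subgroup.dvd_card_of_isIrreducible`: `p ∣ |L|` by averaging
and Schur; `Subgroup.exists_simple_socle_of_primitive`: `L` is the socle modulo scalars and
`τ(G)/Z ↪ Aut(L)`), whose `ght2017_adequate_or_index_p_or_psl29_of_socle_odd` records the
residual hypothesis, word for word the input of GHT Thm. 2.2 (`L` simple of order divisible by
`p` with a faithful irreducible `p`-dimensional module) with alternative (c) phrased inside `GL_p`
(`p = 3`, `L ≅ A₆`, `τ(G) ≤ L · Z`): what is missing is exactly GHT Thm. 2.2 (which finite simple
groups `L` occur: the classification) with Props. 6.7–6.14 and Cor. 9.4–9.5 (their `Ext¹`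
tables); GHT Remark 6.1 (adequacy ascends from a subgroup of index prime to `p`) is PROVED in
`AdequateOfCoprimeIndex.lean` (`Subgroup.IsExtendedAdequate.of_le_of_not_dvd_relIndex`); and the
mechanism of GHT Lemmas 6.2–6.3 (clause (ii) whenever the Sylow `p`-subgroup has order `p` and acts
freely, absent a normal `p`-complement) is PROVED in `H1VanishingCyclicSylow.lean`
(`Subgroup.cocycles₁_le_coboundaries₁_of_cyclicBasis`); GHT Lemma 6.2 itself — a Sylow
`p`-subgroup of order `p` acts freely ("`V` is projective"), in degree `p` and in every degree
divisible by `p` — is PROVED, classification-free (relative trace + Schur + a splitting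
endomorphism), in `PrimeDegreeCyclicSylowFree.lean`
(`PrimeDegreeClifford.exists_cyclicBasis_of_not_sq_dvd`,
`PrimeDegreeClifford.mulVec_eq_zero_iff_exists_of_not_sq_dvd`), so that FOR `p ∥ |G|` clauses (i)
and (ii) of (a), or else (b), hold unconditionally over any field
(`addMonoidHom_eq_zero_and_cocycles₁_le_or_index_p_of_not_sq_dvd`) and the residual for `p ∥ |G|`
is weak adequacy alone (`ght2017_adequate_or_index_p_or_psl29_of_socle_odd_sq`).  FOR `p = 3`
AND IMAGES INSIDE AN ORTHOGONAL SIMILITUDE GROUP `GO₃(B)` (`σ(g)ᵀ B σ(g) = μ_g B`, `B` symmetric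
non-degenerate; e.g. symmetric squares of `2`-dimensional representations) weak adequacy of
every primitive image —
hence, for `9 ∤ |G|`, Theorem 1.7 in the form (a) ∨ (b) over any field of characteristic `3` —
is PROVED classification-free (geometry of conics through the axes of the `3`-regular rotations)
in `AdequacyOrthogonalDegreeThree.lean`
(`OrthogonalDegreeThree.semisimpleSpan_eq_top_of_orthogonal`,
`isExtendedAdequate_or_index_three_of_similitude_of_not_dvd`).  That
alternative (c) cannot be dropped —
`Ω₃(9) ≅ A₆ < GL₃(𝔽₉)` is absolutely irreducible, without abelian normal subgroup of index `3`,
and NOT adequate (an explicit non-trivial class in `H¹(H, ad/Z)`; GHT Cor. 9.4 (b)) — is PROVED,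
by explicit matrices, in `AdequacyDegreeThreeException.lean`
(`OmegaThreeNine.not_forall_adequate_or_comm_normal_index`).  Also
PROVED (section `Exclusivity`): the part "(b) excludes (a)" of the printed
"precisely one of the following holds" (GHT Prop. 6.6, first paragraph of its proof: when
`|G/A| = p` all `p'`-elements of `G` lie in the abelian group `A`, so they cannot span `End(V)`),
`not_isExtendedAdequate_of_comm_normal_index`.

## References

* [GuralnickHerzigTiep2017] Guralnick–Herzig–Tiep, JEMS 19 (2017), Thm 1.7, Thm 6.15, §1 p. 3,
  Prop. 6.5 (i), Prop. 6.6, Lemmas 6.2–6.3.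
* [Thorne2017TwoAdic] J. Thorne, Math. Z. 285 (2017), Def. 2.20 (the same notion of adequacy).
-/

namespace Literature.NumberTheory.GaloisRepresentations

universe u v

/-- **Guralnick–Herzig–Tiep 2017, Theorem 1.7 (adequacy in degree `p`; disjunction form).**
Let `k` be a field of characteristic `p`, `G` a finite group and `σ : G →* GL_p(k)` faithful with
`kᵖ` absolutely irreducible.  Then `σ(G) ≤ GL_p(k)` is adequate in the extended sense
(`Subgroup.IsExtendedAdequate`), OR `G` has an abelian normal subgroup of index `p`, OR `p = 3`
and the image of `G` in `PGL_p(k) = GL_p(k)/Z` is isomorphic to `PSL₂(9) ≅ A₆`.  (Printed: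
"precisely one of the following holds"; only the disjunction is recorded, see the module
docstring.)
[cite: GuralnickHerzigTiep2017, Theorem 1.7 (= Theorem 6.15), §1 p. 3 (def. of adequate)] -/
def ght2017_adequate_or_index_p_or_psl29 : Prop :=
  ∀ (p : ℕ) [Fact p.Prime] (k : Type u) [Field k] [CharP k p] (G : Type v) [Group G] [Finite G]
    (σ : G →* GL (Fin p) k), Function.Injective σ → IsAbsIrreducible σ →
    Subgroup.IsExtendedAdequate σ.range ∨
      (∃ A : Subgroup G, A.Normal ∧ (∀ x ∈ A, ∀ y ∈ A, x * y = y * x) ∧ A.index = p) ∨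
      (p = 3 ∧ Nonempty (↥(σ.range.map (QuotientGroup.mk' (Subgroup.center (GL (Fin p) k)))) ≃*
        ↥(alternatingGroup (Fin 6))))


/-! ## Step 0 of the printed proof: extension of scalars (GHT 2017, §1, arXiv p. 4)

"Also, note that the dimension of cohomology groups and the dimension of the span of the
semisimple elements in `G` in `End(V)` does not change under extension of scalars. Hence, most of
the time we will work over an algebraically closed field `k`" (GHT, §1, p. 4): Theorem 1.7 (any
field `k` of characteristic `p`) is Theorem 6.15 (`k = k̄`) plus this remark.  We prove the
DESCENT half of the remark, which is the direction the reduction uses: for a field embedding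
`f : k →+* k'` and `H ≤ GL_n(k)`, if `GL_n(f)(H) ≤ GL_n(k')` is adequate in the extended sense then
so is `H` (`Subgroup.IsExtendedAdequate.of_map`; clause (ii) by applying a `k`-linear retraction
`r : k' → k` of `f` entrywise — `r` commutes with conjugation by `k`-rational matrices), and then
the reduction of the named fact to algebraically closed coefficient fields
(`ght2017_adequate_or_index_p_or_psl29_of_isAlgClosed`).  The remaining input, Theorem 6.15
itself, rests on the classification of finite irreducible linear groups of prime degree
(GHT Prop. 6.5, Thm. 2.2 — the classification of finite simple groups) and is not available.
-/

section Descent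

open scoped MatrixGroups

universe w

variable {k : Type u} {k' : Type w} [Field k] [Field k'] (f : k →+* k') {n : ℕ}

/-- `GL_n(f)` is injective for a field embedding `f`. [folklore] -/
theorem glMap_injective_of_ringHom :
    Function.Injective (Matrix.GeneralLinearGroup.map (n := Fin n) f) := by
  intro a b h
  apply Units.ext
  exact Matrix.map_injective f.injective
    (congrArg (fun g : GL (Fin n) k' => (g : Matrix (Fin n) (Fin n) k')) h)

/-- The matrix of `GL_n(f) g` is `f` applied entrywise. [folklore] -/
theorem coe_glMap_ringHom (g : GL (Fin n) k) :
    ((Matrix.GeneralLinearGroup.map f g : GL (Fin n) k') : Matrix (Fin n) (Fin n) k') =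
      (g : Matrix (Fin n) (Fin n) k).map f := rfl

/-- The matrix of `(GL_n(f) g)⁻¹` is `f` applied entrywise to `g⁻¹`. [folklore] -/
theorem coe_glMap_ringHom_inv (g : GL (Fin n) k) :
    (((Matrix.GeneralLinearGroup.map f g)⁻¹ : GL (Fin n) k') : Matrix (Fin n) (Fin n) k') =
      ((g⁻¹ : GL (Fin n) k) : Matrix (Fin n) (Fin n) k).map f := by
  rw [← map_inv]; rfl

include f in
/-- A field embedding preserves the characteristic. [folklore] -/
theorem ringChar_eq_of_ringHom : ringChar k' = ringChar k := by
  haveI : CharP k' (ringChar k) := charP_of_injective_ringHom f.injective (ringChar k)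
  exact ringChar.eq k' (ringChar k)

/-- **Descent of clause (iii)** along a field embedding: if the semisimple elements of
`GL_n(f)(H)` span `M_n(k')` over `k'`, then the semisimple elements of `H` span `M_n(k)` over `k`
(a `k`-matrix trace-orthogonal to the latter span is, after `f`, trace-orthogonal to the former).
[cite: GuralnickHerzigTiep2017, §1 (arXiv p. 4), invariance of the span under extension of scalars] -/
theorem Subgroup.semisimpleSpan_eq_top_of_map (H : Subgroup (GL (Fin n) k))
    (h : Subgroup.semisimpleSpan (H.map (Matrix.GeneralLinearGroup.map f)) = ⊤) :
    Subgroup.semisimpleSpan H = ⊤ := by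
  by_contra hne
  obtain ⟨w, hw0, hw⟩ := Subgroup.exists_ne_zero_semisimpleSpan_orth H hne
  have key : ∀ N : Matrix (Fin n) (Fin n) k', (N * w.map f).trace = 0 := by
    intro N
    have hN : N ∈ Subgroup.semisimpleSpan (H.map (Matrix.GeneralLinearGroup.map f)) :=
      h ▸ Submodule.mem_top
    rw [Subgroup.semisimpleSpan] at hN
    refine Submodule.span_induction (p := fun N _ => (N * w.map f).trace = 0) ?_ ?_ ?_ ?_ hN
    · rintro _ ⟨h', hh', rfl⟩
      obtain ⟨g, hg, hg'⟩ := Subgroup.mem_map.1 h'.2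
      have hord : (orderOf g).Coprime (ringChar k) := by
        have h1 := hh'
        rw [← hg', orderOf_injective _ (glMap_injective_of_ringHom f),
          ringChar_eq_of_ringHom f] at h1
        exact h1
      have hmem : ((g : GL (Fin n) k) : Matrix (Fin n) (Fin n) k) ∈ Subgroup.semisimpleSpan H :=
        Subgroup.mem_semisimpleSpan_of_coprime H ⟨g, hg⟩ hord
      have h2 := hw _ hmem
      rw [← hg', coe_glMap_ringHom, ← Matrix.map_mul, ← AddMonoidHom.map_trace f, h2, map_zero]
    · rw [Matrix.zero_mul, Matrix.trace_zero]
    · intro x y _ _ hx hy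
      rw [Matrix.add_mul, Matrix.trace_add, hx, hy, add_zero]
    · intro c x _ hx
      rw [Matrix.smul_mul, Matrix.trace_smul, hx, smul_zero]
  apply hw0
  have hzero : w.map f = 0 :=
    Matrix.ext_iff_trace_mul_left.2 fun x => by rw [key, Matrix.mul_zero, Matrix.trace_zero]
  exact Matrix.map_injective f.injective (hzero.trans (Matrix.map_zero f (map_zero f)).symm)

/-- **Descent of clause (i)** along a field embedding: `Hom(GL_n(f)(H), k') = 0` implies
`Hom(H, k) = 0` (compose with `f` and the isomorphism `H ≅ GL_n(f)(H)`).
[cite: GuralnickHerzigTiep2017, §1 (arXiv p. 4), invariance of `dim H¹` under extension of scalars] -/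
theorem Subgroup.addMonoidHom_eq_zero_of_map (H : Subgroup (GL (Fin n) k))
    (h : ∀ g : Additive ↥(H.map (Matrix.GeneralLinearGroup.map f)) →+ k', g = 0)
    (g : Additive H →+ k) : g = 0 := by
  let e : H ≃* H.map (Matrix.GeneralLinearGroup.map f) :=
    H.equivMapOfInjective _ (glMap_injective_of_ringHom f)
  let g' : Additive ↥(H.map (Matrix.GeneralLinearGroup.map f)) →+ k' :=
    AddMonoidHom.mk' (fun y => f (g (Additive.ofMul (e.symm (Additive.toMul y))))) (by
      intro a b
      simp only [toMul_add, map_mul, ofMul_mul, map_add])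
  refine AddMonoidHom.ext fun x => ?_
  have hx : g' (Additive.ofMul (e (Additive.toMul x))) = 0 := by rw [h g']; rfl
  change f (g (Additive.ofMul (e.symm (Additive.toMul (Additive.ofMul (e (Additive.toMul x))))))) = 0
    at hx
  rw [toMul_ofMul, MulEquiv.symm_apply_apply, ofMul_toMul, map_eq_zero_iff f f.injective] at hx
  rw [hx, AddMonoidHom.zero_apply]

/-- The `f`-semilinear map `ad/Z → ad'/Z'` induced by `M ↦ f(M)` (scalars go to scalars), recorded
through its defining property on classes. [folklore] -/
theorem exists_adQuot_map :
    ∃ Ψ : (Matrix (Fin n) (Fin n) k ⧸ scalarMatrices (Fin n) k) →+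
        (Matrix (Fin n) (Fin n) k' ⧸ scalarMatrices (Fin n) k'),
      ∀ M, Ψ (Submodule.Quotient.mk M) = Submodule.Quotient.mk (M.map f) := by
  let L : Matrix (Fin n) (Fin n) k →ₛₗ[f] Matrix (Fin n) (Fin n) k' :=
    LinearMap.mapMatrix f.toSemilinearMap
  have hL : scalarMatrices (Fin n) k ≤ (scalarMatrices (Fin n) k').comap L := by
    intro M hM
    obtain ⟨c, rfl⟩ := (mem_scalarMatrices_iff M).1 hM
    rw [Submodule.mem_comap]
    change (c • (1 : Matrix (Fin n) (Fin n) k)).map f ∈ scalarMatrices (Fin n) k'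
    rw [Matrix.map_smul' f c _ (map_mul f), Matrix.map_one f (map_zero f) (map_one f)]
    exact smul_one_mem_scalarMatrices k' (f c)
  exact ⟨(Submodule.mapQ _ _ L hL).toAddMonoidHom, fun M => rfl⟩

/-- A `k`-linear retraction of the field embedding `f` (`k'` is a `k`-vector space through `f`):
an additive `r : k' → k` with `r (f x) = x` and `r (f x · y) = x · r y`. [folklore] -/
theorem exists_retraction_of_ringHom :
    ∃ r : k' →+ k, (∀ x, r (f x) = x) ∧ ∀ (x : k) (y : k'), r (f x * y) = x * r y := by
  letI : Algebra k k' := f.toAlgebra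
  have hker : LinearMap.ker (Algebra.linearMap k k') = ⊥ :=
    LinearMap.ker_eq_bot.2 (algebraMap k k').injective
  obtain ⟨r, hr⟩ := (Algebra.linearMap k k').exists_leftInverse_of_injective hker
  refine ⟨r.toAddMonoidHom, fun x => ?_, fun x y => ?_⟩
  · have hx := LinearMap.congr_fun hr x
    rwa [LinearMap.comp_apply, Algebra.linearMap_apply, LinearMap.id_apply] at hx
  · have hxy : f x * y = x • y := (Algebra.smul_def x y).symm
    rw [hxy, LinearMap.toAddMonoidHom_coe, map_smul, smul_eq_mul]

/-- Entrywise application of a `k`-linear retraction `r` of `f` commutes with two-sided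
multiplication by `k`-rational matrices. [folklore] -/
theorem map_retraction_mul_mul {r : k' →+ k} (hrl : ∀ (x : k) (y : k'), r (f x * y) = x * r y)
    (A B : Matrix (Fin n) (Fin n) k) (N : Matrix (Fin n) (Fin n) k') :
    (A.map f * N * B.map f).map r = A * N.map r * B := by
  have hrr : ∀ (y : k') (x : k), r (y * f x) = r y * x := fun y x => by
    rw [mul_comm y, hrl, mul_comm]
  ext i j
  simp only [Matrix.map_apply, Matrix.mul_apply, map_sum, Finset.sum_mul]
  refine Finset.sum_congr rfl fun b _ => Finset.sum_congr rfl fun a _ => ?_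
  rw [hrr, hrl]

/-- The additive map `ad'/Z' → ad/Z` induced by a `k`-linear retraction `r` of `f` applied
entrywise (it maps scalars to scalars), recorded through its defining property on classes.
[folklore] -/
theorem exists_adQuot_retraction {r : k' →+ k}
    (hrl : ∀ (x : k) (y : k'), r (f x * y) = x * r y) :
    ∃ R : (Matrix (Fin n) (Fin n) k' ⧸ scalarMatrices (Fin n) k') →+
        (Matrix (Fin n) (Fin n) k ⧸ scalarMatrices (Fin n) k),
      ∀ N, R (Submodule.Quotient.mk N) = Submodule.Quotient.mk (N.map r) := by
  letI : Algebra k k' := f.toAlgebra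
  -- `r` is `k`-linear for the `k`-module structure on `k'` through `f`
  let rl : k' →ₗ[k] k :=
    { toFun := r
      map_add' := map_add r
      map_smul' := fun x y => by rw [Algebra.smul_def, RingHom.id_apply, smul_eq_mul]; exact hrl x y }
  let L : Matrix (Fin n) (Fin n) k' →ₗ[k] Matrix (Fin n) (Fin n) k ⧸ scalarMatrices (Fin n) k :=
    (scalarMatrices (Fin n) k).mkQ ∘ₗ LinearMap.mapMatrix rl
  have hL : (scalarMatrices (Fin n) k').restrictScalars k ≤ LinearMap.ker L := by
    intro N hN
    obtain ⟨c, rfl⟩ := (mem_scalarMatrices_iff N).1 hN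
    rw [LinearMap.mem_ker]
    change Submodule.Quotient.mk ((c • (1 : Matrix (Fin n) (Fin n) k')).map r) = 0
    rw [Submodule.Quotient.mk_eq_zero]
    have hmap : (c • (1 : Matrix (Fin n) (Fin n) k')).map r = r c • (1 : Matrix (Fin n) (Fin n) k) := by
      ext i j
      by_cases hij : i = j
      · subst hij; simp
      · simp [Matrix.one_apply_ne hij]
    rw [hmap]
    exact smul_one_mem_scalarMatrices k (r c)
  refine ⟨(((scalarMatrices (Fin n) k').restrictScalars k).liftQ L hL ∘ₗ
      (Submodule.Quotient.restrictScalarsEquiv k (scalarMatrices (Fin n) k')).symm.toLinearMap).toAddMonoidHom,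
    fun N => ?_⟩
  rfl

/-- **Descent of clause (ii)** along a field embedding: `H¹(GL_n(f)(H), ad'/Z') = 0` implies
`H¹(H, ad/Z) = 0`.  A `k`-cocycle `c : H → ad/Z` becomes, after `f`, a `k'`-cocycle on
`GL_n(f)(H) ≅ H`, hence a coboundary `g ↦ g·m' − m'`; applying entrywise a `k`-linear retraction
`r` of `f` (which commutes with conjugation by the `k`-rational matrices of `H`) gives
`c(g) = g·r(m') − r(m')`.
[cite: GuralnickHerzigTiep2017, §1 (arXiv p. 4), invariance of `dim H¹` under extension of scalars] -/
theorem Subgroup.cocycles₁_le_coboundaries₁_of_map (H : Subgroup (GL (Fin n) k))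
    (h : groupCohomology.cocycles₁
        (Rep.of (Subgroup.adModScalarRep (H.map (Matrix.GeneralLinearGroup.map f)))) ≤
      groupCohomology.coboundaries₁
        (Rep.of (Subgroup.adModScalarRep (H.map (Matrix.GeneralLinearGroup.map f))))) :
    groupCohomology.cocycles₁ (Rep.of (Subgroup.adModScalarRep H)) ≤
      groupCohomology.coboundaries₁ (Rep.of (Subgroup.adModScalarRep H)) := by
  rw [cocycles₁_le_coboundaries₁_iff_forall] at h ⊢
  intro c hc
  obtain ⟨Ψ, hΨ⟩ := exists_adQuot_map f (n := n)
  obtain ⟨r, hr, hrl⟩ := exists_retraction_of_ringHom f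
  obtain ⟨R, hR⟩ := exists_adQuot_retraction f (n := n) hrl
  set φ := Matrix.GeneralLinearGroup.map (n := Fin n) f with hφ
  let e : H ≃* H.map φ := H.equivMapOfInjective φ (glMap_injective_of_ringHom f)
  have he : ∀ g : H, ((e g : H.map φ) : GL (Fin n) k') = φ g := fun g =>
    Subgroup.coe_equivMapOfInjective_apply H φ _ g
  -- `R ∘ Ψ = id`
  have hRΨ : ∀ q, R (Ψ q) = q := by
    intro q
    induction q using Submodule.Quotient.induction_on with
    | H M =>
      rw [hΨ, hR, Matrix.map_map]
      congr 1
      ext i j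
      exact hr (M i j)
  -- `Ψ` is equivariant along `e`
  have hΨeq : ∀ (g : H) q, Ψ (Subgroup.adModScalarRep H g q) =
      Subgroup.adModScalarRep (H.map φ) (e g) (Ψ q) := by
    intro g q
    induction q using Submodule.Quotient.induction_on with
    | H M =>
      rw [Subgroup.adModScalarRep_apply_mk, hΨ, hΨ, Subgroup.adModScalarRep_apply_mk, he,
        coe_glMap_ringHom, coe_glMap_ringHom_inv, Matrix.map_mul, Matrix.map_mul]
  -- `R` is equivariant along `e`
  have hReq : ∀ (g : H) q', R (Subgroup.adModScalarRep (H.map φ) (e g) q') =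
      Subgroup.adModScalarRep H g (R q') := by
    intro g q'
    induction q' using Submodule.Quotient.induction_on with
    | H N =>
      rw [Subgroup.adModScalarRep_apply_mk, hR, hR, Subgroup.adModScalarRep_apply_mk, he,
        coe_glMap_ringHom, coe_glMap_ringHom_inv, map_retraction_mul_mul f hrl]
  -- transport the cocycle
  let c' : H.map φ → (Matrix (Fin n) (Fin n) k' ⧸ scalarMatrices (Fin n) k') :=
    fun h' => Ψ (c (e.symm h'))
  have hc' : ∀ g' h' : H.map φ, c' (g' * h') =
      (Rep.of (Subgroup.adModScalarRep (H.map φ))).ρ g' (c' h') + c' g' := by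
    intro g' h'
    change Ψ (c (e.symm (g' * h'))) = Subgroup.adModScalarRep (H.map φ) g' (Ψ (c (e.symm h'))) +
      Ψ (c (e.symm g'))
    rw [map_mul, hc, map_add]
    congr 1
    change Ψ (Subgroup.adModScalarRep H (e.symm g') (c (e.symm h'))) = _
    rw [hΨeq, MulEquiv.apply_symm_apply]
  obtain ⟨m', hm'⟩ := h c' hc'
  refine ⟨R m', fun g => ?_⟩
  have hg := hm' (e g)
  change Ψ (c (e.symm (e g))) = Subgroup.adModScalarRep (H.map φ) (e g) m' - m' at hg
  rw [MulEquiv.symm_apply_apply] at hg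
  change c g = Subgroup.adModScalarRep H g (R m') - R m'
  rw [← hRΨ (c g), hg, map_sub, hReq]

/-- **Descent of extended adequacy along a field embedding** (the half of GHT's remark "the
dimension of cohomology groups and the dimension of the span of the semisimple elements … does
not change under extension of scalars" that reduces Theorem 1.7 to `k = k̄`): for `f : k →+* k'`
and `H ≤ GL_n(k)`, if `GL_n(f)(H) ≤ GL_n(k')` is adequate in the extended sense then so is `H`.
[cite: GuralnickHerzigTiep2017, §1 (arXiv p. 4)] -/
theorem Subgroup.IsExtendedAdequate.of_map (H : Subgroup (GL (Fin n) k))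
    (h : Subgroup.IsExtendedAdequate (H.map (Matrix.GeneralLinearGroup.map f))) :
    Subgroup.IsExtendedAdequate H where
  addMonoidHom_eq_zero := Subgroup.addMonoidHom_eq_zero_of_map f H h.addMonoidHom_eq_zero
  cocycles₁_le_coboundaries₁ :=
    Subgroup.cocycles₁_le_coboundaries₁_of_map f H h.cocycles₁_le_coboundaries₁
  semisimpleSpan_eq_top := Subgroup.semisimpleSpan_eq_top_of_map f H h.semisimpleSpan_eq_top

end Descent

/-! ## The reduction of Theorem 1.7 to Theorem 6.15 (`k = k̄`) -/

/-- The image `ψ(G) Z / Z` of `G` in `PGL_m(L) = GL_m(L)/Z` is `G / ψ⁻¹(Z)` (first isomorphism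
theorem for `G → GL_m(L) → PGL_m(L)`). [folklore] -/
theorem nonempty_projectiveImage_mulEquiv_quotient {L : Type*} [Field L] {G : Type*} [Group G]
    {m : ℕ} (ψ : G →* GL (Fin m) L) :
    Nonempty (↥(ψ.range.map (QuotientGroup.mk' (Subgroup.center (GL (Fin m) L)))) ≃*
      G ⧸ (Subgroup.center (GL (Fin m) L)).comap ψ) := by
  refine ⟨(MulEquiv.subgroupCongr (MonoidHom.map_range _ _)).trans
    ((QuotientGroup.quotientKerEquivRange _).symm.trans (QuotientGroup.quotientMulEquivOfEq ?_))⟩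
  rw [← MonoidHom.comap_ker, QuotientGroup.ker_mk']

/-- The image of `G` in `PGL_m` is the same abstract group before and after an extension of
scalars: for `σ : G →* GL_m(k)` and a field embedding `ι : k →+* K`, both
`σ(G)Z/Z ≤ PGL_m(k)` and `(GL_m(ι) ∘ σ)(G) Z'/Z' ≤ PGL_m(K)` are `G / σ⁻¹(Z)` (a `k`-rational matrix
is central in `GL_m(K)` iff it is central in `GL_m(k)`). [folklore] -/
theorem nonempty_mulEquiv_projectiveImage_map {k : Type u} {K : Type*} [Field k] [Field K]
    (ι : k →+* K) {G : Type v} [Group G] {m : ℕ} (σ : G →* GL (Fin m) k) :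
    Nonempty (↥(σ.range.map (QuotientGroup.mk' (Subgroup.center (GL (Fin m) k)))) ≃*
      ↥(((Matrix.GeneralLinearGroup.map ι).comp σ).range.map
        (QuotientGroup.mk' (Subgroup.center (GL (Fin m) K))))) := by
  have hker : (Subgroup.center (GL (Fin m) k)).comap σ =
      (Subgroup.center (GL (Fin m) K)).comap ((Matrix.GeneralLinearGroup.map ι).comp σ) := by
    ext g
    simp only [Subgroup.mem_comap, MonoidHom.coe_comp, Function.comp_apply]
    constructor
    · intro hg
      exact Matrix.GeneralLinearGroup.map_center_le ι hg
    · intro hg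
      rw [Subgroup.mem_center_iff] at hg ⊢
      intro x
      apply glMap_injective_of_ringHom ι
      rw [map_mul, map_mul]
      exact hg (Matrix.GeneralLinearGroup.map ι x)
  obtain ⟨f₁⟩ := nonempty_projectiveImage_mulEquiv_quotient σ
  obtain ⟨f₂⟩ := nonempty_projectiveImage_mulEquiv_quotient
    ((Matrix.GeneralLinearGroup.map ι).comp σ)
  exact ⟨f₁.trans ((QuotientGroup.quotientMulEquivOfEq hker).trans f₂.symm)⟩

/-- **Reduction of Theorem 1.7 to algebraically closed coefficients** (GHT's standing reduction,
§1 p. 4: "most of the time we will work over an algebraically closed field `k`"; Theorem 1.7 is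
restated and proved as Theorem 6.15 with `k = k̄` and `V` irreducible): if the disjunction
(a) ∨ (b) ∨ (c) holds for every ALGEBRAICALLY CLOSED field `K` of characteristic `p` (in the
universe of `k`) and every faithful irreducible `τ : G →* GL_p(K)` — the printed Theorem 6.15 —
then the named fact `ght2017_adequate_or_index_p_or_psl29` holds.  (Apply the hypothesis to
`K = k̄` and `τ = GL_p(k ↪ k̄) ∘ σ`, faithful and — by absolute irreducibility — irreducible;
(a) descends by `Subgroup.IsExtendedAdequate.of_map`, (b) is a statement about `G` alone, and
(c) is invariant by `nonempty_mulEquiv_projectiveImage_map`.)  Theorem 6.15 itself (via GHT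
Prop. 6.5 / Thm. 2.2, the classification of finite irreducible linear groups of prime degree) is
NOT in the tree; this theorem records exactly what remains.
[cite: GuralnickHerzigTiep2017, Theorem 6.15; §1 (arXiv p. 4)] -/
theorem ght2017_adequate_or_index_p_or_psl29_of_isAlgClosed
    (halg : ∀ (p : ℕ) [Fact p.Prime] (K : Type u) [Field K] [IsAlgClosed K] [CharP K p]
      (G : Type v) [Group G] [Finite G] (τ : G →* GL (Fin p) K),
      Function.Injective τ → (glRepresentation τ).IsIrreducible →
      Subgroup.IsExtendedAdequate τ.range ∨
        (∃ A : Subgroup G, A.Normal ∧ (∀ x ∈ A, ∀ y ∈ A, x * y = y * x) ∧ A.index = p) ∨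
        (p = 3 ∧ Nonempty (↥(τ.range.map (QuotientGroup.mk' (Subgroup.center (GL (Fin p) K)))) ≃*
          ↥(alternatingGroup (Fin 6))))) :
    ght2017_adequate_or_index_p_or_psl29.{u, v} := by
  intro p _ k _ _ G _ _ σ hinj hirr
  let K := AlgebraicClosure k
  let ι : k →+* K := algebraMap k K
  haveI : CharP K p := charP_of_injective_ringHom ι.injective p
  let τ : G →* GL (Fin p) K := (Matrix.GeneralLinearGroup.map ι).comp σ
  have hτinj : Function.Injective τ := (glMap_injective_of_ringHom ι).comp hinj
  have hτirr : (glRepresentation τ).IsIrreducible := hirr K ι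
  rcases halg p K G τ hτinj hτirr with ha | hb | ⟨hp, ⟨e⟩⟩
  · refine Or.inl (Subgroup.IsExtendedAdequate.of_map ι σ.range ?_)
    rwa [MonoidHom.map_range]
  · exact Or.inr (Or.inl hb)
  · obtain ⟨e₀⟩ := nonempty_mulEquiv_projectiveImage_map ι σ
    exact Or.inr (Or.inr ⟨hp, ⟨e₀.trans e⟩⟩)

/-! ## Exclusivity of (a) and (b) (GHT 2017, Thm 1.7 "precisely one"; Prop. 6.6, first paragraph)

"If `|G/A| = p`, then `G = AP`, `A = O_{p'}(G)` contains all the `p'`-elements of `G` but does not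
act irreducibly on `W` (as `A` is a `p'`-group), whence `G` is not weakly adequate" (GHT, proof of
Prop. 6.6, arXiv p. 19).  We record this direction of the printed "precisely one of the following
holds": an abelian normal subgroup of index `p` excludes extended adequacy.  The argument used is
the elementary core of the quoted one: every element of `G` of order prime to `p` lies in `A`
(its image in `G/A ≅ ℤ/p` has order dividing both `p` and a number prime to `p`), `σ(A)` is
commutative, so every semisimple element of `σ(G)` commutes with all semisimple elements and is
therefore scalar once these span `M_p(k)` (`mem_scalarMatrices_of_forall_commute`) — but the
scalars do not span `M_p(k)` for `p ≥ 2`.  Neither irreducibility nor finiteness is needed here.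
-/

section Exclusivity

open scoped MatrixGroups

/-- In a group `G` with a normal subgroup `A` of prime index `p`, every element of order prime to
`p` lies in `A` (its image in `G ⧸ A`, a group of order `p`, has order dividing `p` and dividing
the order of the element). [folklore] -/
theorem mem_of_coprime_orderOf_of_index_eq {G : Type*} [Group G] {A : Subgroup G} [A.Normal]
    {p : ℕ} (hp : p.Prime) (hidx : A.index = p) {g : G} (hg : (orderOf g).Coprime p) : g ∈ A := by
  by_contra hgA
  have h1 : (g : G ⧸ A) ≠ 1 := fun h => hgA ((QuotientGroup.eq_one_iff g).1 h)
  have hdvd : orderOf (g : G ⧸ A) ∣ p := by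
    rw [← hidx, Subgroup.index_eq_card]
    exact orderOf_dvd_natCard _
  have hord : orderOf (g : G ⧸ A) = p := by
    rcases (Nat.dvd_prime hp).1 hdvd with h | h
    · exact absurd (orderOf_eq_one_iff.1 h) h1
    · exact h
  have hpg : p ∣ orderOf g := by
    have h := orderOf_map_dvd (QuotientGroup.mk' A) g
    rwa [QuotientGroup.mk'_apply, hord] at h
  have hpp : Nat.Coprime p p := Nat.Coprime.coprime_dvd_left hpg hg
  rw [Nat.Coprime, Nat.gcd_self] at hpp
  exact hp.one_lt.ne' hpp

/-- **Guralnick–Herzig–Tiep 2017, Theorem 1.7: alternative (b) excludes alternative (a)** (the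
printed "precisely one of the following holds", this direction being the first paragraph of the
proof of GHT Prop. 6.6: "If `|G/A| = p`, then `G = AP`, `A = O_{p'}(G)` contains all the
`p'`-elements of `G` … whence `G` is not weakly adequate").  For `k` of characteristic `p`,
`σ : G →* GL_p(k)` faithful and `A ⊴ G` abelian of index `p`, the subgroup `σ(G) ≤ GL_p(k)` is not
adequate in the extended sense: clause (iii) fails, since every element of `σ(G)` of order prime
to `p` lies in the commutative group `σ(A)`.  (Irreducibility and finiteness of `G` are not used.)
[cite: GuralnickHerzigTiep2017, Theorem 1.7 (exclusivity of (a) and (b)) and Proposition 6.6 (proof, first paragraph, arXiv p. 19)] -/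
theorem not_isExtendedAdequate_of_comm_normal_index (p : ℕ) [hp : Fact p.Prime] (k : Type u)
    [Field k] [CharP k p] (G : Type v) [Group G] (σ : G →* GL (Fin p) k)
    (hσ : Function.Injective σ) (A : Subgroup G) [A.Normal] (hA : ∀ x ∈ A, ∀ y ∈ A, x * y = y * x)
    (hidx : A.index = p) : ¬ Subgroup.IsExtendedAdequate σ.range := by
  intro h
  have hchar : ringChar k = p := ringChar.eq k p
  -- every semisimple (order prime to `p`) element of `σ(G)` is `σ a` with `a ∈ A`
  have hmem : ∀ x : σ.range, (orderOf (x : GL (Fin p) k)).Coprime (ringChar k) →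
      ∃ a ∈ A, σ a = (x : GL (Fin p) k) := by
    rintro ⟨_, g, rfl⟩ hx
    refine ⟨g, mem_of_coprime_orderOf_of_index_eq hp.out hidx ?_, rfl⟩
    change (orderOf (σ g)).Coprime (ringChar k) at hx
    rwa [hchar, orderOf_injective σ hσ g] at hx
  -- hence the semisimple elements commute pairwise, so by clause (iii) each of them is scalar
  have hscalar : ∀ x : σ.range, (orderOf (x : GL (Fin p) k)).Coprime (ringChar k) →
      ((x : GL (Fin p) k) : Matrix (Fin p) (Fin p) k) ∈ scalarMatrices (Fin p) k := by
    intro x hx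
    obtain ⟨a, ha, hax⟩ := hmem x hx
    refine mem_scalarMatrices_of_forall_commute h.semisimpleSpan_eq_top fun y hy => ?_
    obtain ⟨b, hb, hby⟩ := hmem y hy
    rw [← hax, ← hby]
    change ((σ b : GL (Fin p) k) : Matrix (Fin p) (Fin p) k) * ((σ a : GL (Fin p) k) : Matrix _ _ k) =
      ((σ a : GL (Fin p) k) : Matrix (Fin p) (Fin p) k) * ((σ b : GL (Fin p) k) : Matrix _ _ k)
    rw [← Units.val_mul, ← Units.val_mul, ← map_mul, ← map_mul, hA b hb a ha]
  -- so `M_p(k) = 𝓜 ≤ Z`: in particular the matrix unit `E₀₁` would be scalar, absurd (`p ≥ 2`)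
  have hle : Subgroup.semisimpleSpan σ.range ≤ scalarMatrices (Fin p) k := by
    rw [Subgroup.semisimpleSpan_def]
    refine Submodule.span_le.2 ?_
    rintro _ ⟨x, hx, rfl⟩
    exact hscalar x hx
  set i : Fin p := ⟨0, hp.out.pos⟩ with hi
  set j : Fin p := ⟨1, hp.out.one_lt⟩ with hj
  have hij : i ≠ j := Fin.ne_of_val_ne (by simp [hi, hj])
  obtain ⟨c, hc⟩ := (mem_scalarMatrices_iff _).1
    (hle (h.mem_semisimpleSpan (Matrix.single i j (1 : k))))
  have e := congrFun (congrFun hc i) j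
  rw [Matrix.smul_apply, Matrix.one_apply_ne hij, smul_zero, Matrix.single_apply_same] at e
  exact zero_ne_one e

end Exclusivity

/-! ## The imprimitive case: GHT Proposition 6.6, proved (any field of characteristic `p`)

Printed statement (GHT 2017, Prop. 6.5 (i) and Prop. 6.6, `k = k̄`): let `G < GL_p(k)` be finite
and irreducible, imprimitive on `W = kᵖ` — `G` permutes the `p` summands of a decomposition into
lines, `G < GL₁(k) ≀ S_p`, with `A := G ∩ GL₁(k)ᵖ` non-central in `G`.  "Then `(G, W)` is adequate
if and only if `|G/A| ≠ p`."

Typing: `H ≤ GL_p(k)` finite (`[Finite H]`), irreducible on `kᵖ`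
(`(glRepresentation H.subtype).IsIrreducible`), a basis `b` of `kᵖ` whose lines `k · b i` are
permuted by `H` through a homomorphism `θ : H →* Equiv.Perm (Fin p)`
(`h · b i = c · b (θ h i)`); `A = θ.ker`; "non-central" is `¬ θ.ker ≤ center H`; `|G/A|` is
`θ.ker.index`.  Conclusions: `Subgroup.isExtendedAdequate_of_monomial` (`index ≠ p`),
`Subgroup.isExtendedAdequate_of_lines` (the same with the hypotheses stated on the lines only: `H`
permutes the lines, some element is `b`-diagonal with two distinct eigenvalues, some element fixes
a line and moves another — no homomorphism to supply), and
`Subgroup.not_isExtendedAdequate_of_monomial_of_index_eq` (`index = p`).  The field `k` is ANY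
field of characteristic `p` (the hypotheses and, by GHT's remark of §1, the conclusion are
insensitive to extension of scalars; the proof below never needs `k = k̄`).

Architecture of the printed proof and what replaces each step here (`P ∈ Syl_p(G)`, `|P| = p`):
* "`|G/A| = p` ⇒ `A = O_{p'}(G)` contains all `p'`-elements but is not irreducible" —
  `Subgroup.semisimpleSpan_ne_top_of_monomial_of_index_eq` (semisimple elements lie in `A`, so the
  span is `b`-diagonal); cf. `not_isExtendedAdequate_of_comm_normal_index` above.
* "`G` has no normal `p`-complement (Lemma lem:perm)" — `false_of_normal_of_index_eq`: the orbits
  of a normal `p'`-subgroup are blocks of the action on the `p` lines, which is primitive (Mathlib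
  `MulAction.IsPreprimitive.of_prime_card`), so it fixes every line and lies in `A`.
* "(i) `H¹(G,k) = 0` by Lemma 6.3" — `addMonoidHom_eq_zero_of_monomial` (the image of an additive
  character is a `p`-group of order `≤ p`, `p² ∤ |G|`; a kernel of index `p` would be a normal
  `p`-complement).
* "(ii) `Ext¹_G(W,W) = 0` as `W` is projective (Lemma 6.2, Green correspondence) and `H²(G,k) = 0`
  (Lemma 6.3, Schur multipliers [Is])" — DEVIATION (Mathlib has neither): replaced by the elementary
  chain `H¹(G, ad/Z) ↪ H¹(N_G(P), ad/Z) ↪ (classes on P)` — restriction to a subgroup of index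
  invertible in `k` reflects coboundaries (`exists_eq_sub_of_subgroup`, coset averaging;
  `[G : N_G(P)] ≡ 1 mod p` by Sylow, `[N_G(P) : P]` prime to `p`), and on `P = ⟨y⟩` a cocycle is a
  coboundary (`exists_apply_eq_sub_of_normalizer`): the cyclic norm of a lift of `f(y)` is a scalar
  `λ`, an element `z ∈ N_G(P)` with `z y z⁻¹ = y^r`, `r ≢ 1` (it exists by Burnside's normal
  `p`-complement theorem, Mathlib `MonoidHom.ker_transferSylow_isComplement'` — printed: "`s > 1`")
  forces `r λ = λ`, and `H¹(⟨y⟩, End W) = 0` because `W` is free over `k⟨y⟩`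
  (`exists_eq_conj_sub_of_cyclicNorm_eq_zero`, a dimension count).
* "(iii) spanning: for `i ≠ j` a `p'`-element `x ∈ N \ AP` with `x W_i = W_j`; `B = ⟨A, x⟩` is a
  `p'`-group and Artin–Wedderburn gives `Hom(W_i, W_j)` in the image of `kB`" —
  `semisimpleSpan_eq_top_of_monomial`: the same `x` (`= y^a z`; it fixes a line, being an affine map
  `v ↦ r v + b` of `ℤ/p` with `r ≠ 1`, and point stabilisers have `p'`-order), with Artin–Wedderburn
  replaced by Dedekind's independence of the `p` distinct characters of `A` on the lines (Mathlib
  `linearIndependent_monoidHom`; distinctness = "`A` has `p` distinct eigenspaces", by primitivity),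
  which puts the `b`-diagonal projections in the span of `A`.

The helper lemmas live in the sub-namespace `MonomialAdequacy`; the results of the proposition
itself are declared in the topic namespace (`Subgroup.isExtendedAdequate_of_monomial`,
`Subgroup.isExtendedAdequate_of_lines`, `Subgroup.semisimpleSpan_ne_top_of_monomial_of_index_eq`,
`Subgroup.not_isExtendedAdequate_of_monomial_of_index_eq`).
-/

open scoped MatrixGroups Matrix Pointwise

namespace MonomialAdequacy

section CocycleGeneralities

variable {k : Type*} [Field k] {G : Type*} [Group G] {M : Type*} [AddCommGroup M] [Module k M]

/-- A `1`-cocycle vanishes at `1`. [folklore] -/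
theorem cocycle_apply_one (ρ : Representation k G M) (f : G → M)
    (hf : ∀ g h, f (g * h) = ρ g (f h) + f g) : f 1 = 0 := by
  have h := hf 1 1
  rw [mul_one, map_one, Module.End.one_apply] at h
  exact left_eq_add.1 h

/-- A `1`-cocycle at an inverse: `f g⁻¹ = - g⁻¹ • f g`. [folklore] -/
theorem cocycle_apply_inv (ρ : Representation k G M) (f : G → M)
    (hf : ∀ g h, f (g * h) = ρ g (f h) + f g) (g : G) : f g⁻¹ = -(ρ g⁻¹ (f g)) := by
  have h := hf g⁻¹ g
  rw [inv_mul_cancel, cocycle_apply_one ρ f hf] at h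
  exact eq_neg_of_add_eq_zero_right h.symm

/-- A `1`-cocycle on powers: `f (y ^ n) = ∑_{v < n} y ^ v • f y`. [folklore] -/
theorem cocycle_apply_pow (ρ : Representation k G M) (f : G → M)
    (hf : ∀ g h, f (g * h) = ρ g (f h) + f g) (y : G) (n : ℕ) :
    f (y ^ n) = ∑ v ∈ Finset.range n, ρ (y ^ v) (f y) := by
  induction n with
  | zero => rw [pow_zero, cocycle_apply_one ρ f hf, Finset.sum_range_zero]
  | succ n ih => rw [pow_succ, hf, ih, Finset.sum_range_succ, add_comm]

/-- If a `1`-cocycle is a coboundary on `y`, it is the same coboundary on every power of `y`.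
[folklore] -/
theorem cocycle_apply_pow_of_eq_sub (ρ : Representation k G M) (f : G → M)
    (hf : ∀ g h, f (g * h) = ρ g (f h) + f g) (y : G) (m : M) (hy : f y = ρ y m - m) (n : ℕ) :
    f (y ^ n) = ρ (y ^ n) m - m := by
  induction n with
  | zero => rw [pow_zero, cocycle_apply_one ρ f hf, map_one, Module.End.one_apply, sub_self]
  | succ n ih =>
    rw [pow_succ, hf, hy, ih, map_sub, ← Module.End.mul_apply, ← map_mul]
    abel

/-- **Restriction to a subgroup of index invertible in `k` reflects coboundaries** (the
`cor ∘ res = [G : K]` argument in degree one, by averaging over cosets): if a `1`-cocycle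
`f : G → M` is a coboundary on a subgroup `K` with `[G : K] ≠ 0` in `k`, then `f` is a coboundary.
[folklore] -/
theorem exists_eq_sub_of_subgroup (ρ : Representation k G M) (K : Subgroup G) [K.FiniteIndex]
    (hK : (K.index : k) ≠ 0) (f : G → M) (hf : ∀ g h, f (g * h) = ρ g (f h) + f g)
    (hfK : ∃ m : M, ∀ x ∈ K, f x = ρ x m - m) : ∃ m : M, ∀ g, f g = ρ g m - m := by
  classical
  obtain ⟨m₀, hm₀⟩ := hfK
  -- normalise `f` so that it vanishes on `K`
  set f' : G → M := fun g => f g - (ρ g m₀ - m₀) with hf'def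
  have hf' : ∀ g h, f' (g * h) = ρ g (f' h) + f' g := by
    intro g h
    simp only [hf'def, hf g h, map_mul, Module.End.mul_apply, map_sub]
    abel
  have hK0 : ∀ x ∈ K, f' x = 0 := fun x hx => by simp only [hf'def, hm₀ x hx, sub_self]
  -- `f'` is constant on left cosets of `K`
  have hcos : ∀ a b : G, (QuotientGroup.mk a : G ⧸ K) = QuotientGroup.mk b → f' a = f' b := by
    intro a b hab
    have hmem : a⁻¹ * b ∈ K := QuotientGroup.eq.1 hab
    have e : b = a * (a⁻¹ * b) := by group
    rw [e, hf' a, hK0 _ hmem, map_zero, zero_add]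
  haveI : Fintype (G ⧸ K) := Fintype.ofFinite _
  set S : M := ∑ q : G ⧸ K, f' q.out with hSdef
  have hS : ∀ g : G, ρ g S = S - (K.index : k) • f' g := by
    intro g
    have h1 : ∀ q : G ⧸ K, ρ g (f' q.out) = f' (g • q).out - f' g := by
      intro q
      have h2 := hf' g q.out
      have h3 : f' (g * q.out) = f' (g • q).out := by
        apply hcos
        rw [QuotientGroup.out_eq']
        change (QuotientGroup.mk (g • q.out) : G ⧸ K) = g • q
        rw [← MulAction.Quotient.smul_mk, QuotientGroup.out_eq']
      rw [← h3, h2, add_sub_cancel_right]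
    rw [hSdef, map_sum, Finset.sum_congr rfl fun q _ => h1 q, Finset.sum_sub_distrib,
      Finset.sum_const, Finset.card_univ, ← Nat.card_eq_fintype_card, ← Subgroup.index_eq_card,
      ← Nat.cast_smul_eq_nsmul k]
    congr 1
    exact Fintype.sum_equiv (MulAction.toPerm g) _ _ fun q => rfl
  refine ⟨m₀ - (K.index : k)⁻¹ • S, fun g => ?_⟩
  have hg : f g = f' g + (ρ g m₀ - m₀) := by simp only [hf'def, sub_add_cancel]
  have hf'g : f' g = (K.index : k)⁻¹ • (S - ρ g S) := by
    rw [hS, sub_sub_cancel, smul_smul, inv_mul_cancel₀ hK, one_smul]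
  rw [hg, hf'g, map_sub, map_smul, smul_sub]
  abel

/-- Restriction of a `1`-cocycle to a subgroup, as a cocycle of the subgroup. [folklore] -/
theorem cocycle_restrict (ρ : Representation k G M) (f : G → M)
    (hf : ∀ g h, f (g * h) = ρ g (f h) + f g) (L : Subgroup G) :
    ∀ g h : L, (fun x : L => f x) (g * h) = ρ.comp L.subtype g ((fun x : L => f x) h) +
      (fun x : L => f x) g := fun g h => hf g h

end CocycleGeneralities

section CyclicNorm

variable {p : ℕ} [Fact p.Prime] {k : Type u} [Field k]

omit [Fact p.Prime] in
/-- For an element of order `p`, powers only depend on the exponent modulo `p`. [folklore] -/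
theorem pow_eq_pow_of_modEq_of_orderOf_eq {G : Type*} [Group G] {Y : G} (hY : orderOf Y = p)
    {m n : ℕ} (h : m ≡ n [MOD p]) : Y ^ m = Y ^ n := by
  rw [pow_eq_pow_iff_modEq, hY]; exact h

/-- Reindexing a sum over `ZMod p` by `ℕ`-values as a sum over `range p`. [folklore] -/
theorem sum_zmod_val_eq_sum_range {M : Type*} [AddCommMonoid M] (F : ℕ → M) :
    ∑ v : ZMod p, F v.val = ∑ n ∈ Finset.range p, F n := by
  refine Finset.sum_nbij (fun v => v.val) (fun v _ => Finset.mem_range.2 (ZMod.val_lt v)) ?_ ?_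
    (fun v _ => rfl)
  · intro a _ b _ h
    exact ZMod.val_injective p h
  · intro n hn
    refine ⟨(n : ZMod p), Finset.mem_coe.2 (Finset.mem_univ _), ?_⟩
    exact ZMod.val_natCast_of_lt (Finset.mem_range.1 (Finset.mem_coe.1 hn))

/-- `v.val + n ≡ (v + n).val (mod p)` in `ZMod p`. [folklore] -/
theorem zmod_val_add_natCast_modEq (v : ZMod p) (n : ℕ) :
    v.val + n ≡ (v + (n : ZMod p)).val [MOD p] := by
  rw [ZMod.val_add, ZMod.val_natCast]
  exact ((Nat.ModEq.refl _).add (Nat.mod_modEq n p).symm).trans (Nat.mod_modEq _ p).symm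

/-- `s * v.val ≡ (s * v).val (mod p)` in `ZMod p`. [folklore] -/
theorem zmod_natCast_mul_val_modEq (s : ℕ) (v : ZMod p) :
    s * v.val ≡ ((s : ZMod p) * v).val [MOD p] := by
  rw [ZMod.val_mul, ZMod.val_natCast]
  exact ((Nat.mod_modEq s p).symm.mul_right _).trans (Nat.mod_modEq _ p).symm

/-- **The norm of the cyclic group `⟨Y⟩` kills scalars** in characteristic `p`:
`∑_{v mod p} Y^v (c • 1) Y^{-v} = p c • 1 = 0`. [folklore] -/
theorem cyclicNorm_smul_one [CharP k p] (Y : GL (Fin p) k) (c : k) :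
    ∑ v : ZMod p, glAdjointRepresentation (Fin p) k (Y ^ v.val)
      (c • (1 : Matrix (Fin p) (Fin p) k)) = 0 := by
  simp_rw [glAdjointRepresentation_apply_of_mem_scalarMatrices _ (smul_one_mem_scalarMatrices k c)]
  rw [Finset.sum_const, Finset.card_univ, ZMod.card, ← Nat.cast_smul_eq_nsmul k, CharP.cast_eq_zero,
    zero_smul]

/-- **The cyclic norm is invariant under the cyclic group**:
`∑_v Y^v (Y^n X Y^{-n}) Y^{-v} = ∑_v Y^v X Y^{-v}` (reindex `v ↦ v + n`). [folklore] -/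
theorem cyclicNorm_conj_pow (Y : GL (Fin p) k) (hY : orderOf Y = p) (n : ℕ)
    (X : Matrix (Fin p) (Fin p) k) :
    ∑ v : ZMod p, glAdjointRepresentation (Fin p) k (Y ^ v.val)
        (glAdjointRepresentation (Fin p) k (Y ^ n) X) =
      ∑ v : ZMod p, glAdjointRepresentation (Fin p) k (Y ^ v.val) X := by
  have h : ∀ v : ZMod p, glAdjointRepresentation (Fin p) k (Y ^ v.val)
      (glAdjointRepresentation (Fin p) k (Y ^ n) X) =
      glAdjointRepresentation (Fin p) k (Y ^ (v + (n : ZMod p)).val) X := by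
    intro v
    rw [← Module.End.mul_apply, ← map_mul, ← pow_add,
      pow_eq_pow_of_modEq_of_orderOf_eq hY (zmod_val_add_natCast_modEq v n)]
  rw [Finset.sum_congr rfl fun v _ => h v]
  exact Fintype.sum_equiv (Equiv.addRight (n : ZMod p)) _ _ fun v => rfl

/-- **The cyclic norm commutes with the normaliser**: if `Z⁻¹ Y Z = Y^s` with `p ∤ s` then
`∑_v Y^v (Z X Z⁻¹) Y^{-v} = Z (∑_v Y^v X Y^{-v}) Z⁻¹` (reindex `v ↦ s v`). [folklore] -/
theorem cyclicNorm_conj_of_inv_mul_conj (Y Z : GL (Fin p) k) (hY : orderOf Y = p) (s : ℕ)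
    (hs : Z⁻¹ * Y * Z = Y ^ s) (hs0 : ¬p ∣ s) (X : Matrix (Fin p) (Fin p) k) :
    ∑ v : ZMod p, glAdjointRepresentation (Fin p) k (Y ^ v.val)
        (glAdjointRepresentation (Fin p) k Z X) =
      glAdjointRepresentation (Fin p) k Z
        (∑ v : ZMod p, glAdjointRepresentation (Fin p) k (Y ^ v.val) X) := by
  have hconj : ∀ m : ℕ, Z⁻¹ * Y ^ m * Z = Y ^ (s * m) := by
    intro m
    induction m with
    | zero => rw [pow_zero, mul_one, inv_mul_cancel, Nat.mul_zero, pow_zero]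
    | succ m ih =>
      rw [pow_succ, Nat.mul_succ, pow_add, ← ih, ← hs]
      group
  have hs' : (s : ZMod p) ≠ 0 := by
    rw [Ne, ZMod.natCast_eq_zero_iff]
    exact hs0
  have h : ∀ v : ZMod p, glAdjointRepresentation (Fin p) k (Y ^ v.val)
      (glAdjointRepresentation (Fin p) k Z X) =
      glAdjointRepresentation (Fin p) k Z
        (glAdjointRepresentation (Fin p) k (Y ^ ((s : ZMod p) * v).val) X) := by
    intro v
    rw [← Module.End.mul_apply, ← map_mul, ← Module.End.mul_apply, ← map_mul,
      ← pow_eq_pow_of_modEq_of_orderOf_eq hY (zmod_natCast_mul_val_modEq s v), ← hconj]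
    congr 2
    group
  rw [Finset.sum_congr rfl fun v _ => h v, ← map_sum]
  congr 1
  exact Fintype.sum_equiv (Equiv.mulLeft₀ (s : ZMod p) hs') _ _ fun v => rfl

/-- A cyclic basis: if `Y e_v = e_{v+1}` then `Y^n e_v = e_{v+n}`. [folklore] -/
theorem pow_mulVec_cyclicBasis (Y : GL (Fin p) k) (e : Module.Basis (ZMod p) k (Fin p → k))
    (he : ∀ v, ((Y : GL (Fin p) k) : Matrix (Fin p) (Fin p) k) *ᵥ e v = e (v + 1)) (n : ℕ)
    (v : ZMod p) : ((Y ^ n : GL (Fin p) k) : Matrix (Fin p) (Fin p) k) *ᵥ e v = e (v + n) := by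
  induction n generalizing v with
  | zero => rw [pow_zero, Units.val_one, Matrix.one_mulVec, Nat.cast_zero, add_zero]
  | succ n ih =>
    rw [pow_succ, Units.val_mul, ← Matrix.mulVec_mulVec, he, ih, Nat.cast_succ, add_assoc,
      add_comm 1 (n : ZMod p)]

/-- A cyclic basis: `Y^{-n} e_v = e_{v-n}`. [folklore] -/
theorem pow_inv_mulVec_cyclicBasis (Y : GL (Fin p) k) (e : Module.Basis (ZMod p) k (Fin p → k))
    (he : ∀ v, ((Y : GL (Fin p) k) : Matrix (Fin p) (Fin p) k) *ᵥ e v = e (v + 1)) (n : ℕ)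
    (v : ZMod p) :
    (((Y ^ n)⁻¹ : GL (Fin p) k) : Matrix (Fin p) (Fin p) k) *ᵥ e v = e (v - n) := by
  have h := pow_mulVec_cyclicBasis Y e he n (v - n)
  rw [sub_add_cancel] at h
  rw [← h, Matrix.mulVec_mulVec, ← Units.val_mul, inv_mul_cancel, Units.val_one, Matrix.one_mulVec]

/-- **`H¹(⟨Y⟩, End V) = 0` for `V` free over `k⟨Y⟩`** (elementwise, for the generator): if
`V = kᵖ` has a basis `e_v` (`v ∈ ℤ/p`) with `Y e_v = e_{v+1}` and `X ∈ M_p(k)` is killed by the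
norm `∑_v Y^v X Y^{-v}`, then `X = Y X' Y⁻¹ − X'` for some `X'`.  Proof: the image of `Ad Y − 1`
lies in the kernel of the norm and the two have the same dimension, because the centraliser of `Y`
embeds in `V` by `X ↦ X e₀` (dimension `≤ p`) while the norm hits the `p` independent matrices
`Y^l = Norm(e_l ⊗ e₀^*)`. [folklore] -/
theorem exists_eq_conj_sub_of_cyclicNorm_eq_zero (Y : GL (Fin p) k) (hY : orderOf Y = p)
    (e : Module.Basis (ZMod p) k (Fin p → k))
    (he : ∀ v, ((Y : GL (Fin p) k) : Matrix (Fin p) (Fin p) k) *ᵥ e v = e (v + 1))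
    (X : Matrix (Fin p) (Fin p) k)
    (hX : ∑ v : ZMod p, glAdjointRepresentation (Fin p) k (Y ^ v.val) X = 0) :
    ∃ X' : Matrix (Fin p) (Fin p) k, X = glAdjointRepresentation (Fin p) k Y X' - X' := by
  classical
  set Ad := glAdjointRepresentation (Fin p) k with hAd
  -- the two linear maps
  set T : Module.End k (Matrix (Fin p) (Fin p) k) := Ad Y - 1 with hT
  set Nm : Module.End k (Matrix (Fin p) (Fin p) k) := ∑ v : ZMod p, Ad (Y ^ v.val) with hNm
  have hNm_apply : ∀ X, Nm X = ∑ v : ZMod p, Ad (Y ^ v.val) X := fun X => by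
    rw [hNm, LinearMap.sum_apply]
  have hT_apply : ∀ X, T X = Ad Y X - X := fun X => by
    rw [hT, LinearMap.sub_apply, Module.End.one_apply]
  -- (1) `range T ≤ ker Nm`
  have h1 : LinearMap.range T ≤ LinearMap.ker Nm := by
    rintro _ ⟨X', rfl⟩
    rw [LinearMap.mem_ker, hT_apply, map_sub, hNm_apply, hNm_apply, sub_eq_zero]
    have h := cyclicNorm_conj_pow Y hY 1 X'
    rwa [pow_one] at h
  -- evaluation at `e 0`
  let ψ : Matrix (Fin p) (Fin p) k →ₗ[k] (Fin p → k) :=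
    { toFun := fun X => X *ᵥ e 0
      map_add' := fun A B => Matrix.add_mulVec A B _
      map_smul' := fun a A => Matrix.smul_mulVec a A _ }
  have hψ : ∀ X, ψ X = X *ᵥ e 0 := fun X => rfl
  have he0 : ∀ v : ZMod p, ((Y ^ v.val : GL (Fin p) k) : Matrix (Fin p) (Fin p) k) *ᵥ e 0 = e v := by
    intro v
    rw [pow_mulVec_cyclicBasis Y e he, ZMod.natCast_zmod_val, zero_add]
  -- (2) `dim ker T ≤ p`: the centraliser of `Y` embeds in `V`
  have h2 : Module.finrank k (LinearMap.ker T) ≤ p := by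
    have hinj : Function.Injective (ψ.comp (LinearMap.ker T).subtype) := by
      rw [injective_iff_map_eq_zero]
      rintro ⟨X, hXT⟩ hX0
      rw [LinearMap.comp_apply, Submodule.subtype_apply, hψ] at hX0
      rw [LinearMap.mem_ker, hT_apply, sub_eq_zero, hAd, glAdjointRepresentation_apply] at hXT
      -- `Y X = X Y`
      have hcomm : (Y : Matrix (Fin p) (Fin p) k) * X = X * (Y : Matrix (Fin p) (Fin p) k) := by
        have h := congrArg (· * ((Y : GL (Fin p) k) : Matrix (Fin p) (Fin p) k)) hXT
        simpa only [Matrix.mul_assoc, ← Units.val_mul, inv_mul_cancel, Units.val_one,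
          Matrix.mul_one] using h
      have hcommn : ∀ n : ℕ, ((Y ^ n : GL (Fin p) k) : Matrix (Fin p) (Fin p) k) * X =
          X * ((Y ^ n : GL (Fin p) k) : Matrix (Fin p) (Fin p) k) := fun n => by
        rw [Units.val_pow_eq_pow_val]
        exact (Commute.pow_left hcomm n)
      have hzero : ∀ v : ZMod p, X *ᵥ e v = 0 := by
        intro v
        rw [← he0 v, Matrix.mulVec_mulVec, ← hcommn, ← Matrix.mulVec_mulVec, hX0,
          Matrix.mulVec_zero]
      have hX : X = 0 := by
        have hlin : Matrix.toLin' X = 0 :=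
          e.ext fun v => by rw [Matrix.toLin'_apply, hzero, LinearMap.zero_apply]
        exact (LinearEquiv.map_eq_zero_iff Matrix.toLin').1 hlin
      exact Subtype.ext hX
    have h := LinearMap.finrank_le_finrank_of_injective hinj
    rwa [Module.finrank_fintype_fun_eq_card, Fintype.card_fin] at h
  -- (3) `p ≤ dim range Nm`: the `Y^l` are independent and are norms
  have h3 : p ≤ Module.finrank k (LinearMap.range Nm) := by
    let F : ZMod p → Matrix (Fin p) (Fin p) k := fun l => ((Y ^ l.val : GL (Fin p) k) : Matrix _ _ k)
    have hF : LinearIndependent k F := by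
      apply LinearIndependent.of_comp ψ
      have hcomp : ψ ∘ F = e := funext fun l => by
        simp only [Function.comp_apply, hψ, F, he0]
      rw [hcomp]
      exact e.linearIndependent
    have hspan : Submodule.span k (Set.range F) ≤ LinearMap.range Nm := by
      rw [Submodule.span_le]
      rintro _ ⟨l, rfl⟩
      -- `Y^l = Nm (e_l ⊗ e_0^*)`
      let Pl : Matrix (Fin p) (Fin p) k := LinearMap.toMatrix' ((e.coord 0).smulRight (e l))
      have hPl : ∀ w, Pl *ᵥ w = (e.coord 0 w) • e l := fun w => by
        rw [← Matrix.toLin'_apply, Matrix.toLin'_toMatrix', LinearMap.smulRight_apply]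
      refine ⟨Pl, ?_⟩
      rw [hNm_apply]
      apply Matrix.toLin'.injective
      refine e.ext fun v => ?_
      rw [Matrix.toLin'_apply, Matrix.toLin'_apply, Matrix.sum_mulVec]
      simp only [F]
      rw [pow_mulVec_cyclicBasis Y e he, ZMod.natCast_zmod_val]
      rw [Finset.sum_eq_single v]
      · rw [hAd, glAdjointRepresentation_apply, ← Matrix.mulVec_mulVec, ← Matrix.mulVec_mulVec,
          pow_inv_mulVec_cyclicBasis Y e he, hPl, ZMod.natCast_zmod_val, sub_self,
          Module.Basis.coord_apply, e.repr_self, Finsupp.single_eq_same, one_smul,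
          pow_mulVec_cyclicBasis Y e he, ZMod.natCast_zmod_val, add_comm]
      · intro u _ hu
        rw [hAd, glAdjointRepresentation_apply, ← Matrix.mulVec_mulVec, ← Matrix.mulVec_mulVec,
          pow_inv_mulVec_cyclicBasis Y e he, hPl, ZMod.natCast_zmod_val, Module.Basis.coord_apply,
          e.repr_self, Finsupp.single_apply, if_neg (sub_ne_zero.2 (Ne.symm hu)), zero_smul,
          Matrix.mulVec_zero]
      · intro hv; exact absurd (Finset.mem_univ v) hv
    have h := Submodule.finrank_mono hspan
    rwa [finrank_span_eq_card hF, ZMod.card] at h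
  -- (4) dimension count
  have h4 := LinearMap.finrank_range_add_finrank_ker T
  have h5 := LinearMap.finrank_range_add_finrank_ker Nm
  have heq : LinearMap.range T = LinearMap.ker Nm :=
    Submodule.eq_of_le_of_finrank_le h1 (by omega)
  have hXker : X ∈ LinearMap.ker Nm := by rw [LinearMap.mem_ker, hNm_apply]; exact hX
  rw [← heq] at hXker
  obtain ⟨X', hX'⟩ := hXker
  exact ⟨X', by rw [← hX', hT_apply]⟩

end CyclicNorm


section KeyLemma

variable {p : ℕ} [Fact p.Prime] {k : Type u} [Field k] [CharP k p]

/-- **The `H¹`-class of a cocycle on a cyclic Sylow subgroup dies under a non-trivial normalising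
element.**  Let `y ∈ H ≤ GL_p(k)` have order `p` and permute a basis cyclically (`y e_v = e_{v+1}`,
so that `kᵖ` is free over `k⟨y⟩`), and let `z ∈ H` normalise `⟨y⟩` non-trivially:
`z y z⁻¹ = y^r` with `r ≢ 1 (mod p)` (and `z⁻¹ y z = y^s`).  Then every `1`-cocycle
`f : H → ad/Z` is a coboundary on `y`.  (The norm `N = ∑_v Ad(y^v)` of a lift `X` of `f(y)` is a
scalar `λ` by the cocycle identity on `y^p = 1`; comparing `f(z y z⁻¹) = f(y^r)` and applying `N`
gives `r λ = λ`, so `λ = 0`, and `N X = 0` makes `X` a coboundary by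
`exists_eq_conj_sub_of_cyclicNorm_eq_zero`.)  This replaces, in the imprimitive case, GHT's appeal
to the Green correspondence (Lemma 6.2) and to Schur multipliers (Lemma 6.3).
[cite: GuralnickHerzigTiep2017, Prop. 6.6 (proof), Lemmas 6.2–6.3] -/
theorem exists_apply_eq_sub_of_normalizer {H : Subgroup (GL (Fin p) k)} (y z : H)
    (hy : orderOf (y : GL (Fin p) k) = p) (r s : ℕ)
    (hr : z * y * z⁻¹ = y ^ r) (hs : z⁻¹ * y * z = y ^ s) (hr1 : (r : k) ≠ 1) (hs0 : ¬p ∣ s)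
    (e : Module.Basis (ZMod p) k (Fin p → k))
    (he : ∀ v, ((y : GL (Fin p) k) : Matrix (Fin p) (Fin p) k) *ᵥ e v = e (v + 1))
    (f : H → Matrix (Fin p) (Fin p) k ⧸ scalarMatrices (Fin p) k)
    (hf : ∀ g h, f (g * h) = Subgroup.adModScalarRep H g (f h) + f g) :
    ∃ m, f y = Subgroup.adModScalarRep H y m - m := by
  classical
  set ρ := Subgroup.adModScalarRep H with hρ
  set Ad := glAdjointRepresentation (Fin p) k with hAd
  set Y : GL (Fin p) k := (y : GL (Fin p) k) with hYdef
  set Z : GL (Fin p) k := (z : GL (Fin p) k) with hZdef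
  have hsG : Z⁻¹ * Y * Z = Y ^ s := by
    rw [hYdef, hZdef]; exact_mod_cast congrArg Subtype.val hs
  have hρmk : ∀ (g : H) (X : Matrix (Fin p) (Fin p) k),
      ρ g (Submodule.Quotient.mk X) = Submodule.Quotient.mk (Ad (g : GL (Fin p) k) X) :=
    fun g X => rfl
  have hterm : ∀ (n : ℕ) (X : Matrix (Fin p) (Fin p) k), ρ (y ^ n) (Submodule.Quotient.mk X) =
      (scalarMatrices (Fin p) k).mkQ (Ad (Y ^ n) X) := by
    intro n X; rw [hρmk, Submodule.mkQ_apply, Subgroup.coe_pow]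
  obtain ⟨X, hX⟩ := Submodule.Quotient.mk_surjective _ (f y)
  obtain ⟨W, hW⟩ := Submodule.Quotient.mk_surjective _ (f z)
  -- the norm as a linear map
  set Nm : Module.End k (Matrix (Fin p) (Fin p) k) := ∑ v : ZMod p, Ad (Y ^ v.val) with hNm
  have hNm_apply : ∀ X, Nm X = ∑ v : ZMod p, Ad (Y ^ v.val) X := fun X => by
    rw [hNm, LinearMap.sum_apply]
  -- (1) the norm of `X` is a scalar `λ`
  have hyp : y ^ p = 1 := by
    have h : orderOf y = p := by rw [← Subgroup.orderOf_coe, ← hYdef]; exact hy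
    have h' := pow_orderOf_eq_one y
    rwa [h] at h'
  have hnorm_mem : Nm X ∈ scalarMatrices (Fin p) k := by
    have h := cocycle_apply_pow ρ f hf y p
    rw [hyp, cocycle_apply_one ρ f hf] at h
    have h' : ∑ v : ZMod p, ρ (y ^ v.val) (f y) = 0 := by
      rw [sum_zmod_val_eq_sum_range (fun n => ρ (y ^ n) (f y))]; exact h.symm
    rw [← hX] at h'
    simp_rw [hterm] at h'
    rw [← map_sum, Submodule.mkQ_apply, Submodule.Quotient.mk_eq_zero] at h'
    rwa [hNm_apply]
  obtain ⟨lam, hlam⟩ := (mem_scalarMatrices_iff _).1 hnorm_mem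
  -- (2) the `z`-relation `∑_{v<r} y^v f(y) + y^r f(z) - f(z) = z f(y)`
  have hstar : (∑ v ∈ Finset.range r, ρ (y ^ v) (f y)) + ρ (y ^ r) (f z) - f z = ρ z (f y) := by
    have h1 : f (y ^ r) = ρ (z * y) (f z⁻¹) + (ρ z (f y) + f z) := by rw [← hr, hf, hf]
    rw [cocycle_apply_inv ρ f hf z, map_neg, ← Module.End.mul_apply, ← map_mul,
      show z * y * z⁻¹ = y ^ r from hr, cocycle_apply_pow ρ f hf y r] at h1
    rw [h1]; abel
  -- lifted to matrices, it holds modulo a scalar `μ`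
  have hlift_mem : (∑ v ∈ Finset.range r, Ad (Y ^ v) X) + Ad (Y ^ r) W - W - Ad Z X ∈
      scalarMatrices (Fin p) k := by
    have e1 : ∀ n, (scalarMatrices (Fin p) k).mkQ (Ad (Y ^ n) X) = ρ (y ^ n) (f y) := fun n => by
      rw [← hterm, hX]
    have e2 : (scalarMatrices (Fin p) k).mkQ (Ad (Y ^ r) W) = ρ (y ^ r) (f z) := by
      rw [← hterm, hW]
    have e3 : (scalarMatrices (Fin p) k).mkQ W = f z := by rw [Submodule.mkQ_apply, hW]
    have e4 : (scalarMatrices (Fin p) k).mkQ (Ad Z X) = ρ z (f y) := by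
      rw [Submodule.mkQ_apply, ← hX, hρmk]
    rw [← Submodule.Quotient.mk_eq_zero, ← Submodule.mkQ_apply, map_sub, map_sub, map_add, map_sum,
      Finset.sum_congr rfl fun n _ => e1 n, e2, e3, e4, sub_eq_zero]
    exact hstar
  obtain ⟨mu, hmu⟩ := (mem_scalarMatrices_iff _).1 hlift_mem
  -- (3) apply the norm: `r λ = λ`
  have hN1 : Nm (mu • 1) = 0 := by rw [hNm_apply]; exact cyclicNorm_smul_one Y mu
  have hN2 : ∀ n : ℕ, Nm (Ad (Y ^ n) X) = lam • 1 := fun n => by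
    rw [hNm_apply, hAd, cyclicNorm_conj_pow Y hy n X, hlam, hNm_apply]
  have hN3 : Nm (Ad (Y ^ r) W) = Nm W := by
    rw [hNm_apply, hNm_apply, hAd, cyclicNorm_conj_pow Y hy r W]
  have hN4 : Nm (Ad Z X) = lam • 1 := by
    rw [hNm_apply, hAd, cyclicNorm_conj_of_inv_mul_conj Y Z hy s hsG hs0 X, ← hNm_apply, ← hAd,
      ← hlam]
    exact glAdjointRepresentation_apply_of_mem_scalarMatrices Z (smul_one_mem_scalarMatrices k lam)
  have hkey : ((r : k) * lam - lam) • (1 : Matrix (Fin p) (Fin p) k) = 0 := by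
    have h := congrArg Nm hmu
    rw [hN1, map_sub, map_sub, map_add, map_sum, hN3, hN4] at h
    simp_rw [hN2] at h
    rw [Finset.sum_const, Finset.card_range, ← Nat.cast_smul_eq_nsmul k, smul_smul,
      add_sub_cancel_right] at h
    rw [sub_smul, ← h]
  have hlam0 : lam = 0 := by
    have h := congrArg (fun M : Matrix (Fin p) (Fin p) k => M 0 0) hkey
    simp only [Matrix.smul_apply, Matrix.one_apply_eq, smul_eq_mul, mul_one, Matrix.zero_apply] at h
    rw [← sub_one_mul] at h
    exact (mul_eq_zero.1 h).resolve_left (sub_ne_zero.2 hr1)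
  -- (4) conclude by `H¹(⟨y⟩, free) = 0`
  have hX0 : ∑ v : ZMod p, Ad (Y ^ v.val) X = 0 := by
    rw [← hNm_apply, ← hlam, hlam0, zero_smul]
  obtain ⟨X', hX'⟩ := exists_eq_conj_sub_of_cyclicNorm_eq_zero Y hy e he X hX0
  refine ⟨Submodule.Quotient.mk X', ?_⟩
  rw [← hX, hX', hρmk, Submodule.Quotient.mk_sub]

end KeyLemma

section MonomialAction

variable {p : ℕ} [Fact p.Prime] {k : Type u} [Field k]
variable {H : Subgroup (GL (Fin p) k)}
variable (b : Module.Basis (Fin p) k (Fin p → k)) (θ : ↥H →* Equiv.Perm (Fin p)) (c : ↥H → Fin p → k)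

/-! ### The monomial action: `h • b i = c h i • b (θ h i)` -/

omit [Fact p.Prime] in
/-- Comparing coefficients of a basis vector. [folklore] -/
theorem smul_basis_injective {x x' : k} {j : Fin p} (h : x • b j = x' • b j) : x = x' := by
  have h' := congrArg (fun w => b.repr w j) h
  simpa [b.repr_self] using h'

omit [Fact p.Prime] in
/-- The coefficients of a monomial action are non-zero. [folklore] -/
theorem monomialCoef_ne_zero
    (hc : ∀ (h : H) (i : Fin p),
      ((h : GL (Fin p) k) : Matrix (Fin p) (Fin p) k) *ᵥ b i = c h i • b (θ h i))
    (h : H) (i : Fin p) : c h i ≠ 0 := by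
  intro h0
  have h1 := hc h i
  rw [h0, zero_smul] at h1
  have h2 : b i = 0 := by
    have h3 := congrArg
      (fun w => (((h : GL (Fin p) k)⁻¹ : GL (Fin p) k) : Matrix (Fin p) (Fin p) k) *ᵥ w) h1
    simpa only [Matrix.mulVec_mulVec, ← Units.val_mul, inv_mul_cancel, Units.val_one,
      Matrix.one_mulVec, Matrix.mulVec_zero] using h3
  exact b.ne_zero i h2

omit [Fact p.Prime] in
/-- The coefficients of a monomial action are multiplicative:
`c (g h) i = c g (θ h i) * c h i`. [folklore] -/
theorem monomialCoef_mul
    (hc : ∀ (h : H) (i : Fin p),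
      ((h : GL (Fin p) k) : Matrix (Fin p) (Fin p) k) *ᵥ b i = c h i • b (θ h i))
    (g h : H) (i : Fin p) : c (g * h) i = c g (θ h i) * c h i := by
  have e1 := hc (g * h) i
  rw [map_mul, Equiv.Perm.coe_mul, Function.comp_apply, Subgroup.coe_mul, Units.val_mul,
    ← Matrix.mulVec_mulVec, hc h i, Matrix.mulVec_smul, hc g (θ h i), smul_smul, mul_comm] at e1
  exact (smul_basis_injective b e1).symm

omit [Fact p.Prime] in
/-- `c 1 i = 1`. [folklore] -/
theorem monomialCoef_one
    (hc : ∀ (h : H) (i : Fin p),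
      ((h : GL (Fin p) k) : Matrix (Fin p) (Fin p) k) *ᵥ b i = c h i • b (θ h i))
    (i : Fin p) : c 1 i = 1 := by
  have e1 := hc 1 i
  rw [map_one, Equiv.Perm.coe_one, id, Subgroup.coe_one, Units.val_one, Matrix.one_mulVec] at e1
  have e2 : (1 : k) • b i = c 1 i • b i := by rwa [one_smul]
  exact (smul_basis_injective b e2).symm

omit [Fact p.Prime] in
/-- Conjugating an element of the kernel `A` of the permutation action: the coefficients of
`h⁻¹ a h` are those of `a` moved by `θ h`. [folklore] -/
theorem monomialCoef_conj
    (hc : ∀ (h : H) (i : Fin p),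
      ((h : GL (Fin p) k) : Matrix (Fin p) (Fin p) k) *ᵥ b i = c h i • b (θ h i))
    (a h : H) (ha : θ a = 1) (i : Fin p) : c (h⁻¹ * a * h) i = c a (θ h i) := by
  have h1 := monomialCoef_mul b θ c hc (h⁻¹ * a) h i
  have h2 := monomialCoef_mul b θ c hc h⁻¹ a (θ h i)
  have h3 := monomialCoef_mul b θ c hc h⁻¹ h i
  rw [inv_mul_cancel, monomialCoef_one b θ c hc] at h3
  rw [ha, Equiv.Perm.coe_one, id] at h2
  rw [h1, h2, mul_assoc, mul_comm (c a _), ← mul_assoc, ← h3, one_mul]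

omit [Fact p.Prime] in
/-- An element of the kernel `A` acts diagonally: `a • b i = c a i • b i`. [folklore] -/
theorem mulVec_basis_of_ker
    (hc : ∀ (h : H) (i : Fin p),
      ((h : GL (Fin p) k) : Matrix (Fin p) (Fin p) k) *ᵥ b i = c h i • b (θ h i))
    (a : H) (ha : θ a = 1) (i : Fin p) :
    ((a : GL (Fin p) k) : Matrix (Fin p) (Fin p) k) *ᵥ b i = c a i • b i := by
  rw [hc, ha, Equiv.Perm.coe_one, id]

omit [Fact p.Prime] in
/-- Powers of a kernel element act by powers of the coefficients. [folklore] -/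
theorem pow_mulVec_basis_of_ker
    (hc : ∀ (h : H) (i : Fin p),
      ((h : GL (Fin p) k) : Matrix (Fin p) (Fin p) k) *ᵥ b i = c h i • b (θ h i))
    (a : H) (ha : θ a = 1) (i : Fin p) (n : ℕ) :
    ((a ^ n : GL (Fin p) k) : Matrix (Fin p) (Fin p) k) *ᵥ b i = c a i ^ n • b i := by
  induction n with
  | zero => rw [pow_zero, pow_zero, Units.val_one, Matrix.one_mulVec, one_smul]
  | succ n ih =>
    rw [pow_succ, Units.val_mul, ← Matrix.mulVec_mulVec, mulVec_basis_of_ker b θ c hc a ha,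
      Matrix.mulVec_smul, ih, smul_smul, pow_succ, mul_comm]

omit [Fact p.Prime] in
/-- A matrix is determined by its action on the basis `b`. [folklore] -/
theorem matrix_eq_of_mulVec_basis {M N : Matrix (Fin p) (Fin p) k}
    (h : ∀ i, M *ᵥ b i = N *ᵥ b i) : M = N := by
  apply Matrix.toLin'.injective
  exact b.ext fun i => by rw [Matrix.toLin'_apply, Matrix.toLin'_apply, h]

/-! ### Transitivity, the kernel is a `p'`-group, `p ∥ |H|` -/

omit [Fact p.Prime] in
/-- **Irreducible monomial groups are transitive on the lines.** [folklore] -/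
theorem monomial_transitive
    (hc : ∀ (h : H) (i : Fin p),
      ((h : GL (Fin p) k) : Matrix (Fin p) (Fin p) k) *ᵥ b i = c h i • b (θ h i))
    (hirr : (glRepresentation H.subtype).IsIrreducible) (i j : Fin p) : ∃ h : H, θ h i = j := by
  classical
  by_contra hne
  simp only [not_exists] at hne
  let S : Set (Fin p) := Set.range fun h : H => θ h i
  let W : Submodule k (Fin p → k) := Submodule.span k (b '' S)
  have hW : ∀ (h : H) (w : Fin p → k), w ∈ W →
      ((h : GL (Fin p) k) : Matrix (Fin p) (Fin p) k) *ᵥ w ∈ W := by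
    intro h w hw
    refine Submodule.span_induction ?_ ?_ ?_ ?_ hw
    · rintro _ ⟨_, ⟨h', rfl⟩, rfl⟩
      dsimp only
      rw [hc]
      refine Submodule.smul_mem _ _ (Submodule.subset_span ⟨_, ⟨h * h', rfl⟩, ?_⟩)
      simp only [map_mul, Equiv.Perm.coe_mul, Function.comp_apply]
    · rw [Matrix.mulVec_zero]; exact W.zero_mem
    · intro x y _ _ hx hy
      rw [Matrix.mulVec_add]; exact W.add_mem hx hy
    · intro a x _ hx
      rw [Matrix.mulVec_smul]; exact W.smul_mem a hx
  let W' : Subrepresentation (glRepresentation H.subtype) := ⟨W, fun h w hw => hW h w hw⟩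
  have hbi : b i ∈ W := Submodule.subset_span ⟨i, ⟨1, by simp⟩, rfl⟩
  rcases @IsSimpleOrder.eq_bot_or_eq_top _ _ _ hirr W' with h0 | h1
  · have hW0 : W = ⊥ := congrArg Subrepresentation.toSubmodule h0
    rw [hW0, Submodule.mem_bot] at hbi
    exact b.ne_zero i hbi
  · have hWt : W = ⊤ := congrArg Subrepresentation.toSubmodule h1
    have hj : b j ∈ W := hWt ▸ Submodule.mem_top
    have hjS : j ∉ S := by rintro ⟨h, hh⟩; exact hne h hh
    exact b.linearIndependent.notMem_span_image hjS hj

/-- **The kernel `A` of the permutation action is a `p'`-group**: a diagonalisable element of order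
`p` in characteristic `p` is trivial. [folklore] -/
theorem not_dvd_card_ker [CharP k p] [Finite H]
    (hc : ∀ (h : H) (i : Fin p),
      ((h : GL (Fin p) k) : Matrix (Fin p) (Fin p) k) *ᵥ b i = c h i • b (θ h i)) :
    ¬p ∣ Nat.card θ.ker := by
  intro hdvd
  obtain ⟨a, ha⟩ := exists_prime_orderOf_dvd_card' (G := θ.ker) p hdvd
  have hker : θ (a : H) = 1 := (MonoidHom.mem_ker).1 a.2
  have hord : orderOf (a : H) = p := by rw [Subgroup.orderOf_coe, ha]
  have hap : (a : H) ^ p = 1 := by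
    have h := pow_orderOf_eq_one (a : H)
    rwa [hord] at h
  -- all coefficients are `1`
  have hc1 : ∀ i, c (a : H) i = 1 := by
    intro i
    have h1 := pow_mulVec_basis_of_ker b θ c hc (a : H) hker i p
    rw [← Subgroup.coe_pow, hap, Subgroup.coe_one, Units.val_one, Matrix.one_mulVec] at h1
    have h2 : (1 : k) • b i = c (a : H) i ^ p • b i := by rwa [one_smul]
    have h3 : c (a : H) i ^ p = 1 := (smul_basis_injective b h2).symm
    have h4 : (c (a : H) i - 1) ^ p = 0 := by rw [sub_pow_char, h3, one_pow, sub_self]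
    exact sub_eq_zero.1 (pow_eq_zero_iff (Fact.out : p.Prime).ne_zero |>.1 h4)
  -- hence `a = 1`
  have ha1 : (a : H) = 1 := by
    apply Subtype.ext
    apply Units.ext
    refine matrix_eq_of_mulVec_basis b fun i => ?_
    rw [mulVec_basis_of_ker b θ c hc _ hker, hc1, one_smul, Subgroup.coe_one, Units.val_one,
      Matrix.one_mulVec]
  have : orderOf (a : H) = 1 := by rw [ha1, orderOf_one]
  rw [hord] at this
  exact (Fact.out : p.Prime).one_lt.ne' this

/-- The kernel has order prime to `p`, as a coprimality. [folklore] -/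
theorem coprime_card_ker [CharP k p] [Finite H]
    (hc : ∀ (h : H) (i : Fin p),
      ((h : GL (Fin p) k) : Matrix (Fin p) (Fin p) k) *ᵥ b i = c h i • b (θ h i)) :
    (Nat.card θ.ker).Coprime p :=
  (Nat.Prime.coprime_iff_not_dvd Fact.out).2 (not_dvd_card_ker b θ c hc) |>.symm

/-- Elements of the kernel have order prime to `p`. [folklore] -/
theorem coprime_orderOf_of_ker [CharP k p] [Finite H]
    (hc : ∀ (h : H) (i : Fin p),
      ((h : GL (Fin p) k) : Matrix (Fin p) (Fin p) k) *ᵥ b i = c h i • b (θ h i))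
    (a : H) (ha : θ a = 1) : (orderOf a).Coprime p :=
  Nat.Coprime.coprime_dvd_left (Subgroup.orderOf_dvd_natCard θ.ker ((MonoidHom.mem_ker).2 ha))
    (coprime_card_ker b θ c hc)

/-- **`p` divides `|H|`** (transitivity on `p` lines). [folklore] -/
theorem dvd_card [Finite H]
    (hc : ∀ (h : H) (i : Fin p),
      ((h : GL (Fin p) k) : Matrix (Fin p) (Fin p) k) *ᵥ b i = c h i • b (θ h i))
    (hirr : (glRepresentation H.subtype).IsIrreducible) : p ∣ Nat.card H := by
  classical
  letI : MulAction H (Fin p) := MulAction.compHom (Fin p) θ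
  have horb : MulAction.orbit H (0 : Fin p) = Set.univ := by
    refine Set.eq_univ_of_forall fun j => ?_
    obtain ⟨h, hh⟩ := monomial_transitive b θ c hc hirr 0 j
    exact ⟨h, hh⟩
  have h1 := MulAction.index_stabilizer H (0 : Fin p)
  rw [horb, Set.ncard_univ, Nat.card_eq_fintype_card, Fintype.card_fin] at h1
  have h2 := Subgroup.index_dvd_card (MulAction.stabilizer H (0 : Fin p))
  rwa [h1] at h2

/-- **`p²` does not divide `|H|`**: `|H| = |A| · |θ(H)|` with `p ∤ |A|` and `|θ(H)|` dividing
`p!`. [folklore] -/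
theorem not_sq_dvd_card [CharP k p] [Finite H]
    (hc : ∀ (h : H) (i : Fin p),
      ((h : GL (Fin p) k) : Matrix (Fin p) (Fin p) k) *ᵥ b i = c h i • b (θ h i)) :
    ¬p ^ 2 ∣ Nat.card H := by
  have hp : p.Prime := Fact.out
  intro h
  rw [← Subgroup.card_mul_index θ.ker] at h
  have h1 : p ^ 2 ∣ θ.ker.index :=
    (Nat.Coprime.pow_left 2 (coprime_card_ker b θ c hc).symm).dvd_of_dvd_mul_left h
  have h2 : θ.ker.index ∣ Nat.card (Equiv.Perm (Fin p)) := by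
    rw [Subgroup.index_ker]
    exact Subgroup.card_subgroup_dvd_card θ.range
  rw [Nat.card_perm, Nat.card_eq_fintype_card, Fintype.card_fin] at h2
  have h3 : p ^ 2 ∣ p.factorial := h1.trans h2
  have h4 : p.factorial = p * (p - 1).factorial := (Nat.mul_factorial_pred hp.ne_zero).symm
  rw [h4, pow_two, Nat.mul_dvd_mul_iff_left hp.pos, hp.dvd_factorial] at h3
  have h5 := hp.one_lt
  omega

/-! ### The lines carry distinct characters of `A` (blocks of a primitive action) -/

/-- **The `p` characters of `A` on the lines are pairwise distinct** when `A` is not central: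
the classes of lines with equal characters are blocks of the (primitive) action of `H` on the `p`
lines. [cite: GuralnickHerzigTiep2017, proof of Prop. 6.6 ("`A` has `p` distinct eigenspaces")] -/
theorem exists_monomialCoef_ne [Finite H]
    (hc : ∀ (h : H) (i : Fin p),
      ((h : GL (Fin p) k) : Matrix (Fin p) (Fin p) k) *ᵥ b i = c h i • b (θ h i))
    (hirr : (glRepresentation H.subtype).IsIrreducible) (hA : ¬θ.ker ≤ Subgroup.center H)
    {i j : Fin p} (hij : i ≠ j) : ∃ a : H, θ a = 1 ∧ c a i ≠ c a j := by
  classical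
  by_contra hall
  simp only [not_exists, not_and, not_not] at hall
  letI : MulAction H (Fin p) := MulAction.compHom (Fin p) θ
  have hsmul : ∀ (h : H) (l : Fin p), h • l = θ h l := fun _ _ => rfl
  haveI : MulAction.IsPretransitive H (Fin p) :=
    ⟨fun l m => by
      obtain ⟨h, hh⟩ := monomial_transitive b θ c hc hirr l m
      exact ⟨h, hh⟩⟩
  haveI hprim : MulAction.IsPreprimitive H (Fin p) :=
    MulAction.IsPreprimitive.of_prime_card (by
      rw [Nat.card_eq_fintype_card, Fintype.card_fin]; exact Fact.out)
  -- the class of `i`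
  set B : Set (Fin p) := {l | ∀ a : H, θ a = 1 → c a l = c a i} with hB
  have hiB : i ∈ B := fun a _ => rfl
  have hjB : j ∈ B := fun a ha => (hall a ha).symm
  have hBblock : MulAction.IsBlock H B := by
    rw [MulAction.isBlock_iff_smul_eq_of_mem]
    intro h l hl hhl
    have hsub : h • B ⊆ B := by
      rintro _ ⟨m, hm, rfl⟩ a ha
      have hconj : θ (h⁻¹ * a * h) = 1 := by
        rw [map_mul, map_mul, ha, mul_one, map_inv, inv_mul_cancel]
      show c a (θ h m) = c a i
      rw [← monomialCoef_conj b θ c hc a h ha m, hm _ hconj, ← hl _ hconj,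
        ← hhl a ha, hsmul, ← monomialCoef_conj b θ c hc a h ha l]
    refine Set.eq_of_subset_of_ncard_le hsub (le_of_eq ?_) (Set.toFinite B)
    rw [← Set.image_smul, Set.ncard_image_of_injective B (MulAction.injective h)]
  rcases hprim.isTrivialBlock_of_isBlock hBblock with hsub | huniv
  · exact hij (hsub hiB hjB)
  · -- every `a ∈ A` is scalar, hence central
    apply hA
    intro a ha
    have ha' : θ a = 1 := (MonoidHom.mem_ker).1 ha
    have hall' : ∀ l, c a l = c a i := fun l => by
      have hl : l ∈ B := huniv ▸ Set.mem_univ l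
      exact hl a ha'
    have hmat : ((a : GL (Fin p) k) : Matrix (Fin p) (Fin p) k) = c a i • (1 : Matrix _ _ k) := by
      refine matrix_eq_of_mulVec_basis b fun l => ?_
      rw [mulVec_basis_of_ker b θ c hc a ha', hall', Matrix.smul_mulVec, Matrix.one_mulVec]
    rw [Subgroup.mem_center_iff]
    intro g
    apply Subtype.ext
    apply Units.ext
    change ((g : GL (Fin p) k) : Matrix (Fin p) (Fin p) k) *
        ((a : GL (Fin p) k) : Matrix (Fin p) (Fin p) k) =
      ((a : GL (Fin p) k) : Matrix (Fin p) (Fin p) k) *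
        ((g : GL (Fin p) k) : Matrix (Fin p) (Fin p) k)
    rw [hmat, Matrix.mul_smul, Matrix.smul_mul, Matrix.mul_one, Matrix.one_mul]

/-! ### No normal `p`-complement; the Sylow `p`-subgroup and its normaliser -/

/-- **A normal subgroup of `p'`-order fixes every line**, so lies in `A`; hence, when
`[H : A] ≠ p`, there is no normal subgroup of `p'`-order and index `p` (no normal `p`-complement).
[cite: GuralnickHerzigTiep2017, proof of Prop. 6.6 ("`G` cannot have a normal `p`-complement")] -/
theorem false_of_normal_of_index_eq [Finite H]
    (hc : ∀ (h : H) (i : Fin p),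
      ((h : GL (Fin p) k) : Matrix (Fin p) (Fin p) k) *ᵥ b i = c h i • b (θ h i))
    (hirr : (glRepresentation H.subtype).IsIrreducible) (hind : θ.ker.index ≠ p)
    (K : Subgroup H) [K.Normal] (hK : ¬p ∣ Nat.card K) (hKi : K.index = p) : False := by
  classical
  letI : MulAction H (Fin p) := MulAction.compHom (Fin p) θ
  have hsmul : ∀ (h : H) (l : Fin p), h • l = θ h l := fun _ _ => rfl
  haveI : MulAction.IsPretransitive H (Fin p) :=
    ⟨fun l m => by
      obtain ⟨h, hh⟩ := monomial_transitive b θ c hc hirr l m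
      exact ⟨h, hh⟩⟩
  haveI hprim : MulAction.IsPreprimitive H (Fin p) :=
    MulAction.IsPreprimitive.of_prime_card (by
      rw [Nat.card_eq_fintype_card, Fintype.card_fin]; exact Fact.out)
  have hfix : ∀ x : H, x ∈ K → ∀ i, θ x i = i := by
    intro x hx i
    rcases hprim.isTrivialBlock_of_isBlock (MulAction.IsBlock.orbit_of_normal (N := K) i) with
      hsub | huniv
    · exact hsub (MulAction.mem_orbit i (⟨x, hx⟩ : K)) (MulAction.mem_orbit_self i)
    · exfalso
      apply hK
      have h1 := MulAction.index_stabilizer K i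
      rw [huniv, Set.ncard_univ, Nat.card_eq_fintype_card, Fintype.card_fin] at h1
      have h2 := Subgroup.index_dvd_card (MulAction.stabilizer K i)
      rwa [h1] at h2
  have hKle : K ≤ θ.ker := fun x hx => (MonoidHom.mem_ker).2 (Equiv.ext (hfix x hx))
  have hdvd : θ.ker.index ∣ p := by
    have h := Subgroup.index_dvd_of_le hKle
    rwa [hKi] at h
  rcases (Nat.dvd_prime Fact.out).1 hdvd with h1 | hp'
  · have htop : θ.ker = ⊤ := Subgroup.index_eq_one.1 h1
    have hp := (Fact.out : p.Prime)
    let i0 : Fin p := ⟨0, hp.pos⟩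
    let i1 : Fin p := ⟨1, hp.one_lt⟩
    obtain ⟨h, hh⟩ := monomial_transitive b θ c hc hirr i0 i1
    have hθ : θ h = 1 := by rw [← MonoidHom.mem_ker, htop]; exact Subgroup.mem_top h
    rw [hθ, Equiv.Perm.coe_one, id] at hh
    exact absurd (congrArg Fin.val hh) (by simp [i0, i1])
  · exact hind hp'

/-- **A Sylow `p`-subgroup of `H` is cyclic of order `p`**, generated by any non-trivial element.
[folklore] -/
theorem sylow_eq_zpowers [CharP k p] [Finite H]
    (hc : ∀ (h : H) (i : Fin p),
      ((h : GL (Fin p) k) : Matrix (Fin p) (Fin p) k) *ᵥ b i = c h i • b (θ h i))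
    (hirr : (glRepresentation H.subtype).IsIrreducible) (P : Sylow p H) :
    Nat.card P = p ∧ ∃ y : H, (P : Subgroup H) = Subgroup.zpowers y ∧ orderOf y = p := by
  have hp : p.Prime := Fact.out
  have hcard : Nat.card P = p := by
    rw [Sylow.card_eq_multiplicity]
    have h1 : 0 < (Nat.card H).factorization p :=
      hp.factorization_pos_of_dvd Nat.card_pos.ne' (dvd_card b θ c hc hirr)
    have h2 : (Nat.card H).factorization p < 2 := by
      by_contra hge
      exact not_sq_dvd_card b θ c hc ((pow_dvd_pow p (not_lt.1 hge)).trans (Nat.ordProj_dvd _ _))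
    have h3 : (Nat.card H).factorization p = 1 := by omega
    rw [h3, pow_one]
  refine ⟨hcard, ?_⟩
  have hne : (P : Subgroup H) ≠ ⊥ := by
    intro hbot
    have h1 : Nat.card (P : Subgroup H) = 1 := by rw [hbot]; exact Subgroup.card_bot
    rw [hcard] at h1
    exact hp.one_lt.ne' h1
  obtain ⟨y, hy1⟩ := (Subgroup.ne_bot_iff_exists_ne_one).1 hne
  have hord : orderOf (y : H) = p := by
    have h1 : orderOf (y : H) ∣ p := by
      have h := Subgroup.orderOf_dvd_natCard (P : Subgroup H) y.2
      rwa [hcard] at h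
    rcases (Nat.dvd_prime hp).1 h1 with h | h
    · exact absurd (orderOf_eq_one_iff.1 h) (fun h' => hy1 (Subtype.ext h'))
    · exact h
  refine ⟨y, ?_, hord⟩
  symm
  apply Subgroup.eq_of_le_of_card_ge
  · exact (Subgroup.zpowers_le).2 y.2
  · rw [hcard, Nat.card_zpowers, hord]

/-- **The normaliser of the Sylow subgroup `⟨y⟩` acts on it non-trivially** (Burnside's normal
`p`-complement theorem: otherwise `H` would have a normal `p`-complement): there is `z ∈ N_H(⟨y⟩)`
with `z y z⁻¹ = y^r`, `r ≢ 1 (mod p)` (and `z⁻¹ y z = y^s`, `p ∤ s`).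
[cite: GuralnickHerzigTiep2017, proof of Prop. 6.6 ("`s > 1`")] -/
theorem exists_normalizer_conj_eq_pow [CharP k p] [Finite H]
    (hc : ∀ (h : H) (i : Fin p),
      ((h : GL (Fin p) k) : Matrix (Fin p) (Fin p) k) *ᵥ b i = c h i • b (θ h i))
    (hirr : (glRepresentation H.subtype).IsIrreducible) (hind : θ.ker.index ≠ p)
    (P : Sylow p H) (y : H) (hP : (P : Subgroup H) = Subgroup.zpowers y) (hy : orderOf y = p) :
    ∃ z : H, z ∈ Subgroup.normalizer (P : Set H) ∧ ∃ r s : ℕ, z * y * z⁻¹ = y ^ r ∧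
      z⁻¹ * y * z = y ^ s ∧ ¬r ≡ 1 [MOD p] ∧ ¬p ∣ s := by
  have hp : p.Prime := Fact.out
  have hcardP : Nat.card P = p := by
    rw [hP, Nat.card_zpowers, hy]
  have hPset : (P : Set H) = (Subgroup.zpowers y : Set H) := by rw [← P.coe_coe, hP]
  -- Burnside
  have hNC : ¬Subgroup.normalizer (P : Set H) ≤ Subgroup.centralizer (P : Set H) := by
    intro hle
    have hcomp := MonoidHom.ker_transferSylow_isComplement' P hle
    refine false_of_normal_of_index_eq b θ c hc hirr hind (MonoidHom.transferSylow P hle).ker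
      (MonoidHom.not_dvd_card_ker_transferSylow P hle) ?_
    rw [hcomp.symm.index_eq_card]
    exact hcardP
  obtain ⟨z, hzN, hzC⟩ := Set.not_subset.1 hNC
  refine ⟨z, hzN, ?_⟩
  have hzN1 : z ∈ Subgroup.normalizer (Subgroup.zpowers y : Set H) := by rwa [hPset] at hzN
  have hzN2 : z⁻¹ ∈ Subgroup.normalizer (Subgroup.zpowers y : Set H) := Subgroup.inv_mem _ hzN1
  -- `z y z⁻¹` and `z⁻¹ y z` are powers of `y`
  have hmem1 : z * y * z⁻¹ ∈ Subgroup.zpowers y :=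
    ((Subgroup.mem_normalizer_iff).1 hzN1 y).1 (Subgroup.mem_zpowers y)
  have hmem2 : z⁻¹ * y * z ∈ Subgroup.zpowers y := by
    have h := ((Subgroup.mem_normalizer_iff).1 hzN2 y).1 (Subgroup.mem_zpowers y)
    rwa [inv_inv] at h
  rw [← mem_powers_iff_mem_zpowers, Submonoid.mem_powers_iff] at hmem1 hmem2
  obtain ⟨r, hr⟩ := hmem1
  obtain ⟨s, hs⟩ := hmem2
  refine ⟨r, s, hr.symm, hs.symm, ?_, ?_⟩
  · intro hr1
    apply hzC
    rw [SetLike.mem_coe, Subgroup.mem_centralizer_iff]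
    intro g hg
    have hg' : g ∈ Subgroup.zpowers y := by
      rw [← SetLike.mem_coe, ← hPset]; exact hg
    obtain ⟨m, rfl⟩ := (Subgroup.mem_zpowers_iff).1 hg'
    have hyz : y * z = z * y := by
      have h1 : y ^ r = y ^ 1 := by rw [pow_eq_pow_iff_modEq, hy]; exact hr1
      rw [pow_one] at h1
      rw [h1] at hr
      -- hr : z * y * z⁻¹ = y
      have h2 := congrArg (· * z) hr
      simp [mul_assoc] at h2
      exact h2
    exact (Commute.zpow_left hyz m).eq
  · intro hps
    have h1 : y ^ s = 1 := by
      rw [← orderOf_dvd_iff_pow_eq_one, hy]; exact hps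
    rw [h1] at hs
    -- hs : 1 = z⁻¹ * y * z  ⇒ y = 1
    have h2 : y = 1 := by
      have h3 := congrArg (fun w => z * w * z⁻¹) hs
      simp [mul_assoc] at h3
      exact h3.symm
    rw [h2, orderOf_one] at hy
    exact hp.one_lt.ne hy

/-! ### The generator permutes the lines cyclically; the cyclic basis -/

/-- **`θ y` is a `p`-cycle**: it moves every line, and its powers act transitively.
[folklore] -/
theorem isCycle_perm_of_orderOf_eq [CharP k p] [Finite H]
    (hc : ∀ (h : H) (i : Fin p),
      ((h : GL (Fin p) k) : Matrix (Fin p) (Fin p) k) *ᵥ b i = c h i • b (θ h i))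
    (y : H) (hy : orderOf y = p) :
    orderOf (θ y) = p ∧ (∀ i, θ y i ≠ i) ∧ ∀ i j, ∃ n : ℕ, θ (y ^ n) i = j := by
  classical
  have hp : p.Prime := Fact.out
  have hne : θ y ≠ 1 := by
    intro h1
    have hcop := coprime_orderOf_of_ker b θ c hc y h1
    rw [hy, Nat.coprime_self] at hcop
    exact hp.one_lt.ne' hcop
  have hord : orderOf (θ y) = p := by
    refine orderOf_eq_prime ?_ hne
    have h := pow_orderOf_eq_one y
    rw [hy] at h
    rw [← map_pow, h, map_one]
  have hcyc : (θ y).IsCycle := by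
    apply Equiv.Perm.isCycle_of_prime_order' (by rw [hord]; exact hp)
    rw [hord, Fintype.card_fin]
    have := hp.pos
    omega
  have hsupp : (θ y).support = Finset.univ := by
    apply Finset.eq_univ_of_card
    rw [← hcyc.orderOf, hord, Fintype.card_fin]
  have hmove : ∀ i, θ y i ≠ i := fun i => by
    rw [← Equiv.Perm.mem_support, hsupp]; exact Finset.mem_univ i
  refine ⟨hord, hmove, fun i j => ?_⟩
  obtain ⟨n, hn⟩ := hcyc.exists_pow_eq (hmove i) (hmove j)
  exact ⟨n, by rw [map_pow]; exact hn⟩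

/-- **The cyclic basis**: `e_v := y^v • b i₀` (`v ∈ ℤ/p`) is a basis of `kᵖ` with
`y e_v = e_{v+1}` — `kᵖ` is free of rank one over `k⟨y⟩`. [cite: GuralnickHerzigTiep2017,
proof of Prop. 6.6 ("`W_1, …, W_p` permuted transitively by `P`")] -/
theorem exists_cyclicBasis [CharP k p] [Finite H]
    (hc : ∀ (h : H) (i : Fin p),
      ((h : GL (Fin p) k) : Matrix (Fin p) (Fin p) k) *ᵥ b i = c h i • b (θ h i))
    (y : H) (hy : orderOf y = p) :
    ∃ e : Module.Basis (ZMod p) k (Fin p → k),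
      ∀ v, ((y : GL (Fin p) k) : Matrix (Fin p) (Fin p) k) *ᵥ e v = e (v + 1) := by
  classical
  obtain ⟨_, _, htrans⟩ := isCycle_perm_of_orderOf_eq b θ c hc y hy
  have hyG : orderOf (y : GL (Fin p) k) = p := by rw [Subgroup.orderOf_coe, hy]
  let i₀ : Fin p := ⟨0, (Fact.out : p.Prime).pos⟩
  let π : ZMod p → Fin p := fun v => θ (y ^ v.val) i₀
  have hπ : Function.Bijective π := by
    rw [Fintype.bijective_iff_surjective_and_card]
    refine ⟨fun j => ?_, by rw [ZMod.card, Fintype.card_fin]⟩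
    obtain ⟨n, hn⟩ := htrans i₀ j
    refine ⟨(n : ZMod p), ?_⟩
    simp only [π]
    rw [ZMod.val_natCast, ← hn]
    congr 2
    rw [pow_eq_pow_iff_modEq, hy]
    exact Nat.mod_modEq n p
  let E : ZMod p → (Fin p → k) := fun v => ((y ^ v.val : GL (Fin p) k) : Matrix _ _ k) *ᵥ b i₀
  have hE : ∀ v, E v = c (y ^ v.val) i₀ • b (π v) := fun v => by
    simp only [E, π]
    rw [← Subgroup.coe_pow, hc]
  have hEli : LinearIndependent k E := by
    let w : ZMod p → kˣ := fun v => Units.mk0 (c (y ^ v.val) i₀) (monomialCoef_ne_zero b θ c hc _ _)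
    have h1 : E = w • (b ∘ π) := by
      funext v
      rw [hE, Pi.smul_apply', Function.comp_apply, Units.smul_mk0]
    rw [h1]
    exact (b.linearIndependent.comp π hπ.injective).units_smul w
  let e : Module.Basis (ZMod p) k (Fin p → k) :=
    basisOfLinearIndependentOfCardEqFinrank hEli (by
      rw [ZMod.card, Module.finrank_fintype_fun_eq_card, Fintype.card_fin])
  have he : ∀ v, e v = E v := fun v => by
    simp only [e, coe_basisOfLinearIndependentOfCardEqFinrank]
  refine ⟨e, fun v => ?_⟩
  have hmod : v.val + 1 ≡ (v + 1).val [MOD p] := by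
    have h := zmod_val_add_natCast_modEq v 1
    rwa [Nat.cast_one] at h
  rw [he, he]
  simp only [E]
  rw [Matrix.mulVec_mulVec, ← Units.val_mul, ← pow_succ',
    pow_eq_pow_of_modEq_of_orderOf_eq hyG hmod]

/-! ### Point stabilisers are `p'`-groups; normalising elements fix a line -/

/-- **An element of `H` fixing a line has order prime to `p`** (`|H| = p · |H_i|` and
`p² ∤ |H|`). [cite: GuralnickHerzigTiep2017, proof of Prop. 6.6 ("`x` is a `p'`-element")] -/
theorem coprime_orderOf_of_apply_eq [CharP k p] [Finite H]
    (hc : ∀ (h : H) (i : Fin p),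
      ((h : GL (Fin p) k) : Matrix (Fin p) (Fin p) k) *ᵥ b i = c h i • b (θ h i))
    (hirr : (glRepresentation H.subtype).IsIrreducible) (x : H) {i : Fin p} (hx : θ x i = i) :
    (orderOf (x : GL (Fin p) k)).Coprime (ringChar k) := by
  classical
  rw [ringChar.eq k p, Subgroup.orderOf_coe, Nat.coprime_comm, Nat.Prime.coprime_iff_not_dvd Fact.out]
  intro hdvd
  letI : MulAction H (Fin p) := MulAction.compHom (Fin p) θ
  have horb : MulAction.orbit H i = Set.univ := by
    refine Set.eq_univ_of_forall fun j => ?_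
    obtain ⟨h, hh⟩ := monomial_transitive b θ c hc hirr i j
    exact ⟨h, hh⟩
  have h1 := MulAction.index_stabilizer H i
  rw [horb, Set.ncard_univ, Nat.card_eq_fintype_card, Fintype.card_fin] at h1
  have hxS : x ∈ MulAction.stabilizer H i := hx
  have h2 : p ∣ Nat.card (MulAction.stabilizer H i) :=
    hdvd.trans (Subgroup.orderOf_dvd_natCard _ hxS)
  apply not_sq_dvd_card b θ c hc
  rw [← Subgroup.card_mul_index (MulAction.stabilizer H i), h1, pow_two]
  exact Nat.mul_dvd_mul_right h2 p

/-- **An element acting on `⟨θ y⟩` by a non-trivial power fixes a line** (an affine map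
`v ↦ r v + b` of `ℤ/p` with `r ≠ 1` has a fixed point). [folklore] -/
theorem exists_apply_eq_of_conj_eq_pow [CharP k p] [Finite H]
    (hc : ∀ (h : H) (i : Fin p),
      ((h : GL (Fin p) k) : Matrix (Fin p) (Fin p) k) *ᵥ b i = c h i • b (θ h i))
    (y : H) (hy : orderOf y = p) (x : H) (r : ℕ) (hx : x * y * x⁻¹ = y ^ r)
    (hr : ¬r ≡ 1 [MOD p]) : ∃ i, θ x i = i := by
  classical
  obtain ⟨hord, _, htrans⟩ := isCycle_perm_of_orderOf_eq b θ c hc y hy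
  let o : Fin p := ⟨0, (Fact.out : p.Prime).pos⟩
  obtain ⟨bb, hbb⟩ := htrans o (θ x o)
  -- `θ x (γ^v o) = γ^(r v + bb) o`
  have hconj : ∀ m : ℕ, x * y ^ m * x⁻¹ = y ^ (r * m) := by
    intro m
    induction m with
    | zero => rw [pow_zero, mul_one, mul_inv_cancel, Nat.mul_zero, pow_zero]
    | succ m ih =>
      rw [pow_succ, Nat.mul_succ, pow_add, ← ih, ← hx]
      group
  have haff : ∀ v : ℕ, θ x (θ (y ^ v) o) = θ (y ^ (r * v + bb)) o := by
    intro v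
    have hinv : (θ x)⁻¹ (θ x o) = o := Equiv.Perm.inv_eq_iff_eq.2 rfl
    rw [pow_add, map_mul, Equiv.Perm.coe_mul, Function.comp_apply, hbb, ← hconj]
    simp only [map_mul, map_inv, Equiv.Perm.coe_mul, Function.comp_apply, hinv]
  -- solve `(r - 1) v ≡ -bb`
  have hr' : (r : ZMod p) - 1 ≠ 0 := by
    intro h0
    apply hr
    rw [sub_eq_zero, ← Nat.cast_one, ZMod.natCast_eq_natCast_iff] at h0
    exact h0
  set V : ZMod p := -(bb : ZMod p) * ((r : ZMod p) - 1)⁻¹ with hV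
  have hVeq : (r : ZMod p) * V + bb = V := by
    have h1 : ((r : ZMod p) - 1) * V = -(bb : ZMod p) := by
      rw [hV, mul_comm (-(bb : ZMod p)), ← mul_assoc, mul_inv_cancel₀ hr', one_mul]
    linear_combination h1
  refine ⟨θ (y ^ V.val) o, ?_⟩
  rw [haff]
  congr 2
  rw [pow_eq_pow_iff_modEq, hy, ← ZMod.natCast_eq_natCast_iff]
  push_cast
  rw [ZMod.natCast_zmod_val, hVeq]

end MonomialAction

section Clauses

variable {p : ℕ} [Fact p.Prime] {k : Type u} [Field k] [CharP k p]
variable {H : Subgroup (GL (Fin p) k)} [Finite H]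
variable (b : Module.Basis (Fin p) k (Fin p → k)) (θ : ↥H →* Equiv.Perm (Fin p)) (c : ↥H → Fin p → k)

/-- **Clause (i) in the imprimitive case: `Hom(H, k) = 0`.**  A non-zero additive character has
image a `p`-group, so its kernel would be a normal subgroup of `p'`-order and index `p` — a normal
`p`-complement, excluded by `false_of_normal_of_index_eq`.
[cite: GuralnickHerzigTiep2017, Prop. 6.6 (proof: "`H^i(G,k) = 0` … by Lemma 6.3")] -/
theorem addMonoidHom_eq_zero_of_monomial
    (hc : ∀ (h : H) (i : Fin p),
      ((h : GL (Fin p) k) : Matrix (Fin p) (Fin p) k) *ᵥ b i = c h i • b (θ h i))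
    (hirr : (glRepresentation H.subtype).IsIrreducible) (hind : θ.ker.index ≠ p)
    (F : Additive H →+ k) : F = 0 := by
  classical
  by_contra hF
  let φ : H →* Multiplicative k := AddMonoidHom.toMultiplicative F
  have hφ : ∀ h : H, φ h = Multiplicative.ofAdd (F (Additive.ofMul h)) := fun h => rfl
  -- the image is a `p`-group
  haveI : Finite φ.range := Finite.of_surjective _ (MonoidHom.rangeRestrict_surjective φ)
  have hpg : IsPGroup p φ.range := by
    intro g
    refine ⟨1, ?_⟩
    obtain ⟨h, hh⟩ := g.2
    apply Subtype.ext
    rw [pow_one, SubmonoidClass.coe_pow, OneMemClass.coe_one, ← hh, hφ, ← ofAdd_nsmul, nsmul_eq_mul,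
      CharP.cast_eq_zero, zero_mul, ofAdd_zero]
  obtain ⟨n, hn⟩ := IsPGroup.iff_card.1 hpg
  have hidx : φ.ker.index = p ^ n := by rw [Subgroup.index_ker, hn]
  have hn2 : n < 2 := by
    by_contra hge
    apply not_sq_dvd_card b θ c hc
    have h := Subgroup.index_dvd_card φ.ker
    rw [hidx] at h
    exact (pow_dvd_pow p (not_lt.1 hge)).trans h
  interval_cases n
  · have htop : φ.ker = ⊤ := Subgroup.index_eq_one.1 (by rw [hidx, pow_zero])
    refine hF (AddMonoidHom.ext fun x => ?_)
    have hx' : φ (Additive.toMul x) = 1 := by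
      rw [← MonoidHom.mem_ker, htop]; exact Subgroup.mem_top _
    rw [hφ, ofMul_toMul, ofAdd_eq_one] at hx'
    rw [hx', AddMonoidHom.zero_apply]
  · rw [pow_one] at hidx
    refine false_of_normal_of_index_eq b θ c hc hirr hind φ.ker ?_ hidx
    intro hdvd
    apply not_sq_dvd_card b θ c hc
    rw [← Subgroup.card_mul_index φ.ker, hidx, pow_two]
    exact Nat.mul_dvd_mul_right hdvd p

/-- **Clause (iii) in the imprimitive case: the semisimple elements span `M_p(k)`.**  The `p`
distinct characters of `A` on the lines are linearly independent (Dedekind), so the `b`-diagonal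
projections lie in the span of `A`; for `i ≠ j` an element `x = y^a z` of the normaliser moving line
`i` to line `j` fixes a line, hence `x` and all `x a` (`a ∈ A`) are `p'`-elements, and
`x · (projection on line i)` is the matrix unit `b_i ↦ b_j`.
[cite: GuralnickHerzigTiep2017, Prop. 6.6 (proof, spanning part)] -/
theorem semisimpleSpan_eq_top_of_monomial
    (hc : ∀ (h : H) (i : Fin p),
      ((h : GL (Fin p) k) : Matrix (Fin p) (Fin p) k) *ᵥ b i = c h i • b (θ h i))
    (hirr : (glRepresentation H.subtype).IsIrreducible) (hA : ¬θ.ker ≤ Subgroup.center H)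
    (hind : θ.ker.index ≠ p) : Subgroup.semisimpleSpan H = ⊤ := by
  classical
  let P : Sylow p H := default
  obtain ⟨-, y, hPy, hy⟩ := sylow_eq_zpowers b θ c hc hirr P
  obtain ⟨z, -, r, s, hr, -, hr1, -⟩ := exists_normalizer_conj_eq_pow b θ c hc hirr hind P y hPy hy
  obtain ⟨-, -, htrans⟩ := isCycle_perm_of_orderOf_eq b θ c hc y hy
  set S := Subgroup.semisimpleSpan H with hSdef
  -- (A) `p'`-transporters
  have hx : ∀ i j : Fin p, ∃ x : H, θ x i = j ∧ ∀ a : H, θ a = 1 →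
      (orderOf ((x * a : H) : GL (Fin p) k)).Coprime (ringChar k) := by
    intro i j
    obtain ⟨n, hn⟩ := htrans (θ z i) j
    have hxr : y ^ n * z * y * (y ^ n * z)⁻¹ = y ^ r := by
      rw [show y ^ n * z * y * (y ^ n * z)⁻¹ = y ^ n * (z * y * z⁻¹) * (y ^ n)⁻¹ by group, hr]
      group
    obtain ⟨i₂, hi₂⟩ := exists_apply_eq_of_conj_eq_pow b θ c hc y hy (y ^ n * z) r hxr hr1
    refine ⟨y ^ n * z, by rw [map_mul, Equiv.Perm.coe_mul, Function.comp_apply, hn], fun a ha => ?_⟩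
    refine coprime_orderOf_of_apply_eq b θ c hc hirr (y ^ n * z * a) (i := i₂) ?_
    rw [map_mul, Equiv.Perm.coe_mul, Function.comp_apply, ha, Equiv.Perm.coe_one, id, hi₂]
  -- (B) the characters of `A` and the `b`-diagonal projections
  haveI : Fintype θ.ker := Fintype.ofFinite _
  let χ : Fin p → (θ.ker →* k) := fun l =>
    { toFun := fun a => c a l
      map_one' := monomialCoef_one b θ c hc l
      map_mul' := fun a a' => by
        show c ((a : H) * a') l = c a l * c a' l
        rw [monomialCoef_mul b θ c hc, (MonoidHom.mem_ker).1 a'.2, Equiv.Perm.coe_one, id] }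
  have hχ : ∀ l (a : θ.ker), χ l a = c a l := fun _ _ => rfl
  have hχinj : Function.Injective χ := by
    intro l l' hll'
    by_contra hne
    obtain ⟨a, ha, hne'⟩ := exists_monomialCoef_ne b θ c hc hirr hA hne
    have h := DFunLike.congr_fun hll' ⟨a, (MonoidHom.mem_ker).2 ha⟩
    rw [hχ, hχ] at h
    exact hne' h
  have hLI : LinearIndependent k (fun l => (χ l : θ.ker → k)) :=
    (linearIndependent_monoidHom θ.ker k).comp χ hχinj
  have hproj : ∀ i : Fin p, ∃ d : θ.ker → k,
      ∀ l, ∑ a, d a * c a l = (Pi.single i (1 : k) : Fin p → k) l := by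
    intro i
    let Ψ : (Fin p → k) →ₗ[k] (θ.ker → k) := ∑ l, (LinearMap.proj l).smulRight (χ l : θ.ker → k)
    have hΨ : ∀ t, Ψ t = ∑ l, t l • (χ l : θ.ker → k) := fun t => by
      simp only [Ψ, LinearMap.sum_apply, LinearMap.smulRight_apply, LinearMap.proj_apply]
    have hΨinj : Function.Injective Ψ := by
      rw [injective_iff_map_eq_zero]
      intro t ht
      rw [hΨ] at ht
      funext l
      exact Fintype.linearIndependent_iff.1 hLI t ht l
    obtain ⟨φ, hφ⟩ := LinearMap.dualMap_surjective_of_injective hΨinj (LinearMap.proj i)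
    have hexp : ∀ g : θ.ker → k, φ g = ∑ a, g a * φ (Pi.single a 1) := fun g => by
      have hg : g = ∑ a, g a • (Pi.single a (1 : k) : θ.ker → k) := by
        conv_lhs => rw [← Finset.univ_sum_single g]
        refine Finset.sum_congr rfl fun a _ => ?_
        rw [← Pi.single_smul, smul_eq_mul, mul_one]
      conv_lhs => rw [hg]
      rw [map_sum]
      refine Finset.sum_congr rfl fun a _ => ?_
      rw [map_smul, smul_eq_mul]
    refine ⟨fun a => φ (Pi.single a 1), fun l => ?_⟩
    have h1 : φ (χ l : θ.ker → k) = (Pi.single i (1 : k) : Fin p → k) l := by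
      have h2 := LinearMap.congr_fun hφ (Pi.single l 1)
      rw [LinearMap.dualMap_apply, LinearMap.proj_apply, hΨ, Finset.sum_eq_single l,
        Pi.single_eq_same, one_smul] at h2
      · rw [h2, Pi.single_comm]
      · intro l' _ hl'
        rw [Pi.single_eq_of_ne hl', zero_smul]
      · intro h; exact absurd (Finset.mem_univ l) h
    rw [← h1, hexp]
    refine Finset.sum_congr rfl fun a _ => ?_
    rw [hχ, mul_comm]
  -- (C) the matrix units `b_i ↦ b_j` lie in the span
  have hunit : ∀ i j : Fin p, ∃ U ∈ S, ∀ l, U *ᵥ b l = (Pi.single i (1 : k) : Fin p → k) l • b j := by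
    intro i j
    obtain ⟨x, hxij, hxa⟩ := hx i j
    obtain ⟨d, hd⟩ := hproj i
    let D : Matrix (Fin p) (Fin p) k :=
      ∑ a : θ.ker, d a • (((a : H) : GL (Fin p) k) : Matrix (Fin p) (Fin p) k)
    have hD : ∀ l, D *ᵥ b l = (Pi.single i (1 : k) : Fin p → k) l • b l := fun l => by
      simp only [D]
      rw [Matrix.sum_mulVec]
      have h : ∀ a : θ.ker, (d a • (((a : H) : GL (Fin p) k) : Matrix (Fin p) (Fin p) k)) *ᵥ b l =
          (d a * c a l) • b l := fun a => by
        rw [Matrix.smul_mulVec, mulVec_basis_of_ker b θ c hc _ ((MonoidHom.mem_ker).1 a.2),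
          smul_smul]
      simp_rw [h]
      rw [← Finset.sum_smul, hd]
    refine ⟨(c x i)⁻¹ • (((x : GL (Fin p) k) : Matrix (Fin p) (Fin p) k) * D), ?_, fun l => ?_⟩
    · refine S.smul_mem _ ?_
      simp only [D]
      rw [Finset.mul_sum]
      refine S.sum_mem fun a _ => ?_
      rw [Matrix.mul_smul]
      refine S.smul_mem _ ?_
      have hmem := Subgroup.mem_semisimpleSpan_of_coprime H (x * a)
        (hxa a ((MonoidHom.mem_ker).1 a.2))
      rwa [Subgroup.coe_mul, Units.val_mul] at hmem
    · by_cases hl : l = i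
      · rw [hl, Matrix.smul_mulVec, ← Matrix.mulVec_mulVec, hD, Pi.single_eq_same, one_smul, hc,
          hxij, smul_smul, inv_mul_cancel₀ (monomialCoef_ne_zero b θ c hc x i), one_smul]
      · rw [Matrix.smul_mulVec, ← Matrix.mulVec_mulVec, hD, Pi.single_eq_of_ne hl, zero_smul,
          Matrix.mulVec_zero, smul_zero, zero_smul]
  -- (D) everything
  choose U hUS hU using hunit
  rw [eq_top_iff]
  rintro M -
  have hM : M = ∑ i, ∑ j, b.repr (M *ᵥ b i) j • U i j := by
    refine matrix_eq_of_mulVec_basis b fun l => ?_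
    rw [Matrix.sum_mulVec]
    simp_rw [Matrix.sum_mulVec, Matrix.smul_mulVec, hU]
    rw [Finset.sum_eq_single l]
    · simp_rw [Pi.single_eq_same, one_smul]
      exact (b.sum_repr (M *ᵥ b l)).symm
    · intro i _ hi
      simp_rw [Pi.single_eq_of_ne (Ne.symm hi), zero_smul, smul_zero, Finset.sum_const_zero]
    · intro h; exact absurd (Finset.mem_univ l) h
  rw [hM]
  exact S.sum_mem fun i _ => S.sum_mem fun j _ => S.smul_mem _ (hUS i j)

/-- **Clause (ii) in the imprimitive case: `H¹(H, ad/Z) = 0`.**  Restriction to the normaliser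
`N` of a Sylow `p`-subgroup `⟨y⟩` (index `≡ 1 mod p`) and then to `⟨y⟩` (index prime to `p`)
reflects coboundaries (`exists_eq_sub_of_subgroup`), and on `⟨y⟩` every cocycle is a coboundary
by `exists_apply_eq_sub_of_normalizer`.
[cite: GuralnickHerzigTiep2017, Prop. 6.6 (proof: "`Ext¹_G(W,W) = 0`", Lemma 6.2)] -/
theorem cocycles₁_le_coboundaries₁_of_monomial
    (hc : ∀ (h : H) (i : Fin p),
      ((h : GL (Fin p) k) : Matrix (Fin p) (Fin p) k) *ᵥ b i = c h i • b (θ h i))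
    (hirr : (glRepresentation H.subtype).IsIrreducible) (hind : θ.ker.index ≠ p) :
    groupCohomology.cocycles₁ (Rep.of (Subgroup.adModScalarRep H)) ≤
      groupCohomology.coboundaries₁ (Rep.of (Subgroup.adModScalarRep H)) := by
  classical
  rw [cocycles₁_le_coboundaries₁_iff_forall]
  intro f hf
  change ∀ g h : H, f (g * h) = Subgroup.adModScalarRep H g (f h) + f g at hf
  change ∃ m, ∀ g : H, f g = Subgroup.adModScalarRep H g m - m
  let P : Sylow p H := default
  obtain ⟨-, y, hPy, hy⟩ := sylow_eq_zpowers b θ c hc hirr P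
  obtain ⟨z, -, r, s, hr, hs, hr1, hs0⟩ :=
    exists_normalizer_conj_eq_pow b θ c hc hirr hind P y hPy hy
  have hyG : orderOf (y : GL (Fin p) k) = p := by rw [Subgroup.orderOf_coe, hy]
  have hr1k : (r : k) ≠ 1 := fun h =>
    hr1 ((CharP.natCast_eq_natCast k p).1 (by rw [h, Nat.cast_one]))
  obtain ⟨e, he⟩ := exists_cyclicBasis b θ c hc y hy
  -- on the generator, then on `P = ⟨y⟩`
  obtain ⟨m₁, hm₁⟩ := exists_apply_eq_sub_of_normalizer y z hyG r s hr hs hr1k hs0 e he f hf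
  have hP : ∀ x : H, x ∈ (P : Subgroup H) → f x = Subgroup.adModScalarRep H x m₁ - m₁ := by
    intro x hx
    rw [hPy] at hx
    obtain ⟨n, rfl⟩ := (Submonoid.mem_powers_iff _ _).1 (mem_powers_iff_mem_zpowers.2 hx)
    exact cocycle_apply_pow_of_eq_sub _ f hf y m₁ hm₁ n
  -- on the normaliser `N` of `P`
  have hPN : (P : Subgroup H) ≤ Subgroup.normalizer (P : Set H) := Subgroup.le_normalizer
  have hidx1 : ((((P : Subgroup H).subgroupOf (Subgroup.normalizer (P : Set H))).index : ℕ) : k) ≠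
      0 := by
    intro h0
    rw [CharP.cast_eq_zero_iff k p] at h0
    exact P.not_dvd_index (h0.trans (Subgroup.relIndex_dvd_index_of_le hPN))
  obtain ⟨m₂, hm₂⟩ : ∃ m, ∀ x : Subgroup.normalizer (P : Set H),
      f x = Subgroup.adModScalarRep H x m - m :=
    exists_eq_sub_of_subgroup ((Subgroup.adModScalarRep H).comp (Subgroup.normalizer (P : Set H)).subtype)
      ((P : Subgroup H).subgroupOf (Subgroup.normalizer (P : Set H))) hidx1
      (fun x : Subgroup.normalizer (P : Set H) => f x) (fun g h => hf g h)
      ⟨m₁, fun x hx => hP x ((Subgroup.mem_subgroupOf).1 hx)⟩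
  -- on `H`
  have hidx2 : (((Subgroup.normalizer (P : Set H)).index : ℕ) : k) ≠ 0 := by
    have h1 : (Subgroup.normalizer (P : Set H)).index = Nat.card (Sylow p H) :=
      (Sylow.card_eq_index_normalizer P).symm
    have h2 : Nat.card (Sylow p H) ≡ 1 [MOD p] := card_sylow_modEq_one p H
    rw [h1, (CharP.natCast_eq_natCast k p).2 h2, Nat.cast_one]
    exact one_ne_zero
  exact exists_eq_sub_of_subgroup _ (Subgroup.normalizer (P : Set H)) hidx2 f hf
    ⟨m₂, fun x hx => hm₂ ⟨x, hx⟩⟩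

/-- **Guralnick–Herzig–Tiep 2017, Proposition 6.6 (imprimitive case of Theorem 1.7 / 6.15),
"if" direction, over any field of characteristic `p`.**  Let `H ≤ GL_p(k)` be a finite group
acting irreducibly on `kᵖ` and imprimitively along a basis `b`: `H` permutes the lines `k · b i`
through `θ : H → S_p` (`h · b i = c · b (θ h i)`), with `A = ker θ` (the elements acting diagonally)
not central in `H`.  If `[H : A] ≠ p`, then `H` is adequate in the extended sense.  (GHT:
"`(G, W)` is adequate if and only if `|G/A| ≠ p`"; the printed proof uses the Green
correspondence and Schur multipliers for `H¹`, replaced here by an elementary argument, see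
`exists_apply_eq_sub_of_normalizer`; the converse direction is
`Subgroup.not_isExtendedAdequate_of_monomial_of_index_eq`.)
[cite: GuralnickHerzigTiep2017, Proposition 6.6; Proposition 6.5 (i)] -/
theorem _root_.Literature.NumberTheory.GaloisRepresentations.Subgroup.isExtendedAdequate_of_monomial
    (H : Subgroup (GL (Fin p) k)) [Finite H]
    (hirr : (glRepresentation H.subtype).IsIrreducible)
    (b : Module.Basis (Fin p) k (Fin p → k)) (θ : ↥H →* Equiv.Perm (Fin p))
    (hθ : ∀ (h : H) (i : Fin p), ∃ c : k,
      ((h : GL (Fin p) k) : Matrix (Fin p) (Fin p) k) *ᵥ b i = c • b (θ h i))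
    (hA : ¬θ.ker ≤ Subgroup.center H) (hind : θ.ker.index ≠ p) :
    Subgroup.IsExtendedAdequate H := by
  choose c hc using hθ
  exact ⟨addMonoidHom_eq_zero_of_monomial b θ c hc hirr hind,
    cocycles₁_le_coboundaries₁_of_monomial b θ c hc hirr hind,
    semisimpleSpan_eq_top_of_monomial b θ c hc hirr hA hind⟩

end Clauses

section Converse

variable {p : ℕ} [Fact p.Prime] {k : Type u} [Field k] [CharP k p]

/-- **GHT Prop. 6.6, "only if" direction: if `[H : A] = p` the semisimple elements do not span.**
An element of order prime to `p` maps to the identity of `H/A` (a group of order `p`), so acts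
diagonally along `b`; hence the span of the semisimple elements consists of `b`-diagonal matrices.
[cite: GuralnickHerzigTiep2017, Proposition 6.6 (proof, first paragraph: "`A = O_{p'}(G)` contains
all the `p'`-elements of `G` but does not act irreducibly")] -/
theorem _root_.Literature.NumberTheory.GaloisRepresentations.Subgroup.semisimpleSpan_ne_top_of_monomial_of_index_eq
    (H : Subgroup (GL (Fin p) k)) [Finite H]
    (b : Module.Basis (Fin p) k (Fin p → k)) (θ : ↥H →* Equiv.Perm (Fin p))
    (hθ : ∀ (h : H) (i : Fin p), ∃ c : k,
      ((h : GL (Fin p) k) : Matrix (Fin p) (Fin p) k) *ᵥ b i = c • b (θ h i))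
    (hind : θ.ker.index = p) : Subgroup.semisimpleSpan H ≠ ⊤ := by
  classical
  choose c hc using hθ
  have hp : p.Prime := Fact.out
  -- semisimple elements lie in the kernel `A`
  have hker : ∀ h : H, (orderOf (h : GL (Fin p) k)).Coprime (ringChar k) → θ h = 1 := by
    intro h hh
    rw [ringChar.eq k p, Subgroup.orderOf_coe] at hh
    have h1 : orderOf (θ h) ∣ orderOf h := orderOf_map_dvd θ h
    have h2 : orderOf (θ h) ∣ p := by
      have h4 := Subgroup.orderOf_dvd_natCard θ.range ⟨h, rfl⟩
      rwa [← Subgroup.index_ker, hind] at h4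
    rcases (Nat.dvd_prime hp).1 h2 with h3 | h3
    · exact orderOf_eq_one_iff.1 h3
    · exfalso
      rw [h3] at h1
      exact hp.one_lt.ne' (Nat.Coprime.eq_one_of_dvd hh.symm h1)
  -- the `b`-diagonal matrices
  let Dg : Submodule k (Matrix (Fin p) (Fin p) k) :=
    { carrier := {M | ∀ l, ∃ d : k, M *ᵥ b l = d • b l}
      add_mem' := fun {M N} hM hN l => by
        obtain ⟨d, hd⟩ := hM l
        obtain ⟨d', hd'⟩ := hN l
        exact ⟨d + d', by rw [Matrix.add_mulVec, hd, hd', add_smul]⟩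
      zero_mem' := fun l => ⟨0, by rw [Matrix.zero_mulVec, zero_smul]⟩
      smul_mem' := fun a M hM l => by
        obtain ⟨d, hd⟩ := hM l
        exact ⟨a * d, by rw [Matrix.smul_mulVec, hd, smul_smul]⟩ }
  have hle : Subgroup.semisimpleSpan H ≤ Dg := by
    rw [Subgroup.semisimpleSpan, Submodule.span_le]
    rintro _ ⟨h, hh, rfl⟩ l
    exact ⟨c h l, by rw [hc, hker h hh, Equiv.Perm.coe_one, id]⟩
  -- a matrix moving line `0` to line `1` is not `b`-diagonal
  intro htop
  rw [htop, top_le_iff] at hle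
  let i0 : Fin p := ⟨0, hp.pos⟩
  let i1 : Fin p := ⟨1, hp.one_lt⟩
  have h01 : i1 ≠ i0 := by simp [i0, i1, Fin.ext_iff]
  let M : Matrix (Fin p) (Fin p) k := LinearMap.toMatrix' ((b.coord i0).smulRight (b i1))
  have hM : M *ᵥ b i0 = b i1 := by
    rw [← Matrix.toLin'_apply, Matrix.toLin'_toMatrix', LinearMap.smulRight_apply,
      Module.Basis.coord_apply, b.repr_self, Finsupp.single_eq_same, one_smul]
  have hMD : M ∈ Dg := by rw [hle]; exact Submodule.mem_top
  obtain ⟨d, hd⟩ := hMD i0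
  rw [hM] at hd
  have h := congrArg (fun w => b.repr w i1) hd
  simp only [b.repr_self, map_smul, Finsupp.smul_apply, Finsupp.single_eq_same,
    Finsupp.single_apply, if_neg h01.symm, smul_eq_mul, mul_zero] at h
  exact one_ne_zero h

/-- **GHT Prop. 6.6, "only if" direction**: a finite monomial `H ≤ GL_p(k)` with `[H : A] = p`
is not adequate in the extended sense (clause (iii) fails).
[cite: GuralnickHerzigTiep2017, Proposition 6.6] -/
theorem _root_.Literature.NumberTheory.GaloisRepresentations.Subgroup.not_isExtendedAdequate_of_monomial_of_index_eq
    (H : Subgroup (GL (Fin p) k)) [Finite H]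
    (b : Module.Basis (Fin p) k (Fin p → k)) (θ : ↥H →* Equiv.Perm (Fin p))
    (hθ : ∀ (h : H) (i : Fin p), ∃ c : k,
      ((h : GL (Fin p) k) : Matrix (Fin p) (Fin p) k) *ᵥ b i = c • b (θ h i))
    (hind : θ.ker.index = p) : ¬Subgroup.IsExtendedAdequate H := fun hH =>
  Subgroup.semisimpleSpan_ne_top_of_monomial_of_index_eq H b θ hθ hind hH.semisimpleSpan_eq_top

end Converse

section Lines

variable {p : ℕ} [Fact p.Prime] {k : Type u} [Field k] [CharP k p]

omit [Fact p.Prime] [CharP k p] in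
/-- Two non-zero multiples of basis vectors coincide only on the same line. [folklore] -/
theorem basis_index_eq_of_smul_eq (b : Module.Basis (Fin p) k (Fin p → k)) {x x' : k}
    {j j' : Fin p} (h : x • b j = x' • b j') (hx : x ≠ 0) : j = j' := by
  classical
  by_contra hne
  have h' := congrArg (fun w => b.repr w j) h
  simp only [map_smul, b.repr_self, Finsupp.smul_apply, Finsupp.single_eq_same, smul_eq_mul,
    mul_one, Finsupp.single_apply, if_neg (Ne.symm hne), mul_zero] at h'
  exact hx h'

omit [Fact p.Prime] [CharP k p] in
/-- **A group permuting the lines of a basis does so through a homomorphism `θ : H → S_p`.**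
From "`h · b i` is a multiple of some `b j`" one gets a well-defined permutation action (the
index `j` is unique as `h` is invertible, and `h ↦ (i ↦ j)` is multiplicative). [folklore] -/
theorem exists_permHom_of_lines {H : Subgroup (GL (Fin p) k)}
    (b : Module.Basis (Fin p) k (Fin p → k))
    (hperm : ∀ (h : H) (i : Fin p), ∃ (j : Fin p) (c : k),
      ((h : GL (Fin p) k) : Matrix (Fin p) (Fin p) k) *ᵥ b i = c • b j) :
    ∃ θ : ↥H →* Equiv.Perm (Fin p), ∀ (h : H) (i : Fin p), ∃ c : k,
      ((h : GL (Fin p) k) : Matrix (Fin p) (Fin p) k) *ᵥ b i = c • b (θ h i) := by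
  classical
  choose J C hJC using hperm
  have hC : ∀ h i, C h i ≠ 0 := by
    intro h i h0
    have h1 := hJC h i
    rw [h0, zero_smul] at h1
    have h2 : b i = 0 := by
      have h3 := congrArg
        (fun w => (((h : GL (Fin p) k)⁻¹ : GL (Fin p) k) : Matrix (Fin p) (Fin p) k) *ᵥ w) h1
      simpa only [Matrix.mulVec_mulVec, ← Units.val_mul, inv_mul_cancel, Units.val_one,
        Matrix.one_mulVec, Matrix.mulVec_zero] using h3
    exact b.ne_zero i h2
  have hJmul : ∀ g h i, J (g * h) i = J g (J h i) := by
    intro g h i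
    have e1 := hJC (g * h) i
    rw [Subgroup.coe_mul, Units.val_mul, ← Matrix.mulVec_mulVec, hJC h i, Matrix.mulVec_smul,
      hJC g (J h i), smul_smul] at e1
    exact (basis_index_eq_of_smul_eq b e1 (mul_ne_zero (hC h i) (hC g _))).symm
  have hJone : ∀ i, J 1 i = i := by
    intro i
    have e1 := hJC 1 i
    rw [Subgroup.coe_one, Units.val_one, Matrix.one_mulVec] at e1
    have e2 : (1 : k) • b i = C 1 i • b (J 1 i) := by rwa [one_smul]
    exact (basis_index_eq_of_smul_eq b e2 one_ne_zero).symm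
  let σ : H → Equiv.Perm (Fin p) := fun h =>
    ⟨J h, J h⁻¹, fun i => by rw [← hJmul, inv_mul_cancel, hJone],
      fun i => by rw [← hJmul, mul_inv_cancel, hJone]⟩
  refine ⟨{ toFun := σ
            map_one' := Equiv.ext fun i => hJone i
            map_mul' := fun g h => Equiv.ext fun i => hJmul g h i }, fun h i => ⟨C h i, hJC h i⟩⟩

/-- **GHT Prop. 6.6 with the hypotheses on the lines, no homomorphism to supply** (convenience
form of `Subgroup.isExtendedAdequate_of_monomial`): `H ≤ GL_p(k)` finite and irreducible on `kᵖ`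
permutes the lines `k · b i` of a basis `b`; some element acts diagonally along `b` with two
distinct eigenvalues ("`A` non-central"); and some element fixes one line while moving another
(for a transitive group of prime degree `p` this says exactly `|H/A| ≠ p`).  Then `H` is adequate
in the extended sense.  Example: `S₄ < GL₃(𝔽₃)` on `𝔽₃⁴/Δ` along the three "pairing" lines
(`(12)(34)` is diagonal non-scalar; a transposition fixes one pairing and swaps the other two).
[cite: GuralnickHerzigTiep2017, Proposition 6.6; Proposition 6.5 (i)] -/
theorem _root_.Literature.NumberTheory.GaloisRepresentations.Subgroup.isExtendedAdequate_of_lines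
    (H : Subgroup (GL (Fin p) k)) [Finite H] (hirr : (glRepresentation H.subtype).IsIrreducible)
    (b : Module.Basis (Fin p) k (Fin p → k))
    (hperm : ∀ (h : H) (i : Fin p), ∃ (j : Fin p) (c : k),
      ((h : GL (Fin p) k) : Matrix (Fin p) (Fin p) k) *ᵥ b i = c • b j)
    (hA : ∃ (a : H) (d : Fin p → k),
      (∀ i, ((a : GL (Fin p) k) : Matrix (Fin p) (Fin p) k) *ᵥ b i = d i • b i) ∧ ∃ i j, d i ≠ d j)
    (hfix : ∃ (h : H) (i j : Fin p),
      (∃ c : k, ((h : GL (Fin p) k) : Matrix (Fin p) (Fin p) k) *ᵥ b i = c • b i) ∧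
      ∀ c : k, ((h : GL (Fin p) k) : Matrix (Fin p) (Fin p) k) *ᵥ b j ≠ c • b j) :
    Subgroup.IsExtendedAdequate H := by
  classical
  obtain ⟨θ, hθ⟩ := exists_permHom_of_lines b hperm
  choose c hc using hθ
  have hc0 : ∀ h i, c h i ≠ 0 := monomialCoef_ne_zero b θ c hc
  refine Subgroup.isExtendedAdequate_of_monomial H hirr b θ (fun h i => ⟨c h i, hc h i⟩) ?_ ?_
  · -- a non-scalar diagonal element of `A` is not central (irreducibility)
    obtain ⟨a, d, hd, i, j, hij⟩ := hA
    intro hle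
    have hθa : θ a = 1 := by
      refine Equiv.ext fun l => ?_
      have h1 : c a l • b (θ a l) = d l • b l := by rw [← hc, hd]
      exact basis_index_eq_of_smul_eq b h1 (hc0 a l)
    have hcen : a ∈ Subgroup.center H := hle ((MonoidHom.mem_ker).2 hθa)
    rw [Subgroup.mem_center_iff] at hcen
    -- the `d i`-eigenspace of `a` is a non-zero subrepresentation
    let E : Submodule k (Fin p → k) :=
      LinearMap.ker (Matrix.toLin' ((a : GL (Fin p) k) : Matrix (Fin p) (Fin p) k) -
        d i • LinearMap.id)
    have hE : ∀ w, w ∈ E ↔ ((a : GL (Fin p) k) : Matrix (Fin p) (Fin p) k) *ᵥ w = d i • w := by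
      intro w
      rw [LinearMap.mem_ker, LinearMap.sub_apply, Matrix.toLin'_apply, LinearMap.smul_apply,
        LinearMap.id_apply, sub_eq_zero]
    have hstab : ∀ (g : H) (w : Fin p → k), w ∈ E →
        ((g : GL (Fin p) k) : Matrix (Fin p) (Fin p) k) *ᵥ w ∈ E := by
      intro g w hw
      rw [hE] at hw ⊢
      have hcomm : ((a : GL (Fin p) k) : Matrix (Fin p) (Fin p) k) *
          ((g : GL (Fin p) k) : Matrix (Fin p) (Fin p) k) =
          ((g : GL (Fin p) k) : Matrix (Fin p) (Fin p) k) *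
          ((a : GL (Fin p) k) : Matrix (Fin p) (Fin p) k) := by
        have h := congrArg (fun x : H => ((x : GL (Fin p) k) : Matrix (Fin p) (Fin p) k)) (hcen g)
        simpa only [Subgroup.coe_mul, Units.val_mul] using h.symm
      rw [Matrix.mulVec_mulVec, hcomm, ← Matrix.mulVec_mulVec, hw, Matrix.mulVec_smul]
    let W : Subrepresentation (glRepresentation H.subtype) := ⟨E, fun g w hw => hstab g w hw⟩
    have hiE : b i ∈ E := (hE _).2 (hd i)
    rcases @IsSimpleOrder.eq_bot_or_eq_top _ _ _ hirr W with h0 | h1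
    · have hE0 : E = ⊥ := congrArg Subrepresentation.toSubmodule h0
      rw [hE0, Submodule.mem_bot] at hiE
      exact b.ne_zero i hiE
    · have hEt : E = ⊤ := congrArg Subrepresentation.toSubmodule h1
      have hjE : b j ∈ E := hEt ▸ Submodule.mem_top
      rw [hE, hd j] at hjE
      exact hij (smul_basis_injective b hjE).symm
  · -- an element fixing a line and moving another one forces `|H/A| ≠ p`
    intro hidx
    obtain ⟨h, i, j, ⟨ci, hci⟩, hj⟩ := hfix
    have hθi : θ h i = i := by
      have h1 : c h i • b (θ h i) = ci • b i := by rw [← hc, hci]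
      exact basis_index_eq_of_smul_eq b h1 (hc0 h i)
    have hθj : θ h j ≠ j := fun e => hj (c h j) (by rw [hc, e])
    have hne : θ h ≠ 1 := fun e => hθj (by rw [e, Equiv.Perm.coe_one, id])
    have hp : p.Prime := Fact.out
    have hord : orderOf (θ h) = p := by
      have h1 : orderOf (θ h) ∣ p := by
        have h2 := Subgroup.orderOf_dvd_natCard θ.range ⟨h, rfl⟩
        rwa [← Subgroup.index_ker, hidx] at h2
      exact ((Nat.dvd_prime hp).1 h1).resolve_left fun h1' => hne (orderOf_eq_one_iff.1 h1')
    have hcyc : (θ h).IsCycle := by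
      apply Equiv.Perm.isCycle_of_prime_order' (by rw [hord]; exact hp)
      rw [hord, Fintype.card_fin]
      have := hp.pos
      omega
    have hsupp : (θ h).support = Finset.univ := by
      apply Finset.eq_univ_of_card
      rw [← hcyc.orderOf, hord, Fintype.card_fin]
    have hmem : i ∈ (θ h).support := hsupp ▸ Finset.mem_univ i
    exact (Equiv.Perm.mem_support.1 hmem) hθi

end Lines

end MonomialAdequacy

/-! ## Sharpening the reduction: Theorem 1.7 follows from its primitive algebraically closed case -/

/-- `τ : G →* GL_n(k)` is irreducible on `kⁿ` iff its image `τ(G) ≤ GL_n(k)` is (the stable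
subspaces are the same). [folklore] -/
theorem isIrreducible_range_subtype {k : Type*} [Field k] {G : Type*} [Group G] {n : ℕ}
    (τ : G →* GL (Fin n) k) (h : (glRepresentation τ).IsIrreducible) :
    (glRepresentation τ.range.subtype).IsIrreducible := by
  let e : Subrepresentation (glRepresentation τ.range.subtype) ≃o
      Subrepresentation (glRepresentation τ) :=
    { toFun := fun W => ⟨W.toSubmodule, fun g v hv => W.apply_mem_toSubmodule ⟨τ g, g, rfl⟩ hv⟩
      invFun := fun W => ⟨W.toSubmodule, fun x v hv => by
        obtain ⟨g, hg⟩ := x.2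
        have h1 := W.apply_mem_toSubmodule g hv
        rw [glRepresentation_apply_apply, hg] at h1
        exact h1⟩
      left_inv := fun W => rfl
      right_inv := fun W => rfl
      map_rel_iff' := Iff.rfl }
  exact e.isSimpleOrder_iff.2 h

/-- **What remains of Theorem 1.7 after Proposition 6.6: the primitive (or centrally monomial)
algebraically closed case.**  If the disjunction (a) ∨ (b) ∨ (c) holds for every algebraically
closed `K` of characteristic `p`, every finite `G` and every faithful irreducible
`τ : G →* GL_p(K)` whose image does NOT permute the lines of a basis with a non-central kernel —
i.e. for the groups of GHT Prop. 6.5 (ii) (primitive, almost quasisimple) together with the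
sub-case "`A ≤ Z(G)`" of the imprimitive dichotomy in the proof of Prop. 6.5 — then the named fact
`ght2017_adequate_or_index_p_or_psl29` holds.  (Reduce to `K = k̄` by
`ght2017_adequate_or_index_p_or_psl29_of_isAlgClosed`; if `τ(G)` permutes the lines of a basis `b`
through `θ` with `ker θ` non-central, then either `[τ(G) : ker θ] ≠ p` and `τ(G)` is adequate by
Prop. 6.6 (`Subgroup.isExtendedAdequate_of_monomial`), or `[τ(G) : ker θ] = p` and the pull-back of
`ker θ` — whose elements act diagonally along `b`, hence commute — is an abelian normal subgroup of
`G` of index `p`, alternative (b).)  The hypothesis is exactly the part of Theorem 6.15 that rests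
on the classification of finite simple groups (GHT Prop. 6.5 (ii), Thm. 2.2, Props. 6.7–6.14,
Cor. 9.4–9.5) and on [Zie] for "`A ≤ Z(G)`"; it is NOT in the tree.
[cite: GuralnickHerzigTiep2017, Theorem 6.15 (proof, p. 24), Proposition 6.5, Proposition 6.6] -/
theorem ght2017_adequate_or_index_p_or_psl29_of_primitive
    (hprim : ∀ (p : ℕ) [Fact p.Prime] (K : Type u) [Field K] [IsAlgClosed K] [CharP K p]
      (G : Type v) [Group G] [Finite G] (τ : G →* GL (Fin p) K),
      Function.Injective τ → (glRepresentation τ).IsIrreducible →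
      (∀ (b : Module.Basis (Fin p) K (Fin p → K)) (θ : ↥τ.range →* Equiv.Perm (Fin p)),
        (∀ (h : τ.range) (i : Fin p), ∃ c : K,
          ((h : GL (Fin p) K) : Matrix (Fin p) (Fin p) K) *ᵥ b i = c • b (θ h i)) →
        θ.ker ≤ Subgroup.center τ.range) →
      Subgroup.IsExtendedAdequate τ.range ∨
        (∃ A : Subgroup G, A.Normal ∧ (∀ x ∈ A, ∀ y ∈ A, x * y = y * x) ∧ A.index = p) ∨
        (p = 3 ∧ Nonempty (↥(τ.range.map (QuotientGroup.mk' (Subgroup.center (GL (Fin p) K)))) ≃*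
          ↥(alternatingGroup (Fin 6))))) :
    ght2017_adequate_or_index_p_or_psl29.{u, v} := by
  classical
  refine ght2017_adequate_or_index_p_or_psl29_of_isAlgClosed fun p _ K _ _ _ G _ _ τ hinj hirr => ?_
  by_cases hmono : ∀ (b : Module.Basis (Fin p) K (Fin p → K)) (θ : ↥τ.range →* Equiv.Perm (Fin p)),
      (∀ (h : τ.range) (i : Fin p), ∃ c : K,
        ((h : GL (Fin p) K) : Matrix (Fin p) (Fin p) K) *ᵥ b i = c • b (θ h i)) →
      θ.ker ≤ Subgroup.center τ.range
  · exact hprim p K G τ hinj hirr hmono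
  simp only [not_forall] at hmono
  obtain ⟨b, θ, hθ, hA⟩ := hmono
  haveI : Finite τ.range := Finite.of_surjective _ τ.rangeRestrict_surjective
  have hirr' := isIrreducible_range_subtype τ hirr
  rcases eq_or_ne θ.ker.index p with hidx | hidx
  · -- `[τ(G) : A] = p`: the pull-back of `A` is an abelian normal subgroup of index `p`
    refine Or.inr (Or.inl ⟨θ.ker.comap τ.rangeRestrict, inferInstance, ?_, ?_⟩)
    · choose c hc using hθ
      intro x hx y hy
      apply hinj
      have hx' : θ (τ.rangeRestrict x) = 1 := (MonoidHom.mem_ker).1 hx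
      have hy' : θ (τ.rangeRestrict y) = 1 := (MonoidHom.mem_ker).1 hy
      have hdx := MonomialAdequacy.mulVec_basis_of_ker b θ c hc (τ.rangeRestrict x) hx'
      have hdy := MonomialAdequacy.mulVec_basis_of_ker b θ c hc (τ.rangeRestrict y) hy'
      simp only [MonoidHom.coe_rangeRestrict] at hdx hdy
      rw [map_mul, map_mul]
      apply Units.ext
      rw [Units.val_mul, Units.val_mul]
      refine MonomialAdequacy.matrix_eq_of_mulVec_basis b fun i => ?_
      rw [← Matrix.mulVec_mulVec, ← Matrix.mulVec_mulVec, hdx, hdy, Matrix.mulVec_smul,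
        Matrix.mulVec_smul, hdx, hdy, smul_smul, smul_smul, mul_comm]
    · rw [Subgroup.index_comap_of_surjective θ.ker τ.rangeRestrict_surjective, hidx]
  · -- `[τ(G) : A] ≠ p`: adequate by Prop. 6.6
    exact Or.inl (Subgroup.isExtendedAdequate_of_monomial τ.range hirr' b θ hθ hA hidx)

/-! ## The case `G = S₄`, `p = 3` of Theorem 1.7, proved: the line structure of a `3`-dimensional `S₄`

For `σ : S₄ →* GL₃(k)` (`char k = 3`) whose matrices span `M₃(k)`, the Klein four-group
`K₄ = {1, k₁, k₂, k₃}` acts through three distinct non-trivial characters: in the basis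
`(v, σ(t)v, σ(t)²v)`, `v` a simultaneous eigenvector for `(1, -1, -1)`, the `3`-cycle `t` is the
permutation matrix `P` and the transposition `s` is a signed permutation matrix `S_ε`
(`Sym4.exists_normalForm`); if instead `σ(k₁) = 1` the matrices cannot span
(`Sym4.span_ne_top_of_map_k₁_eq_one`).  Hence `σ(S₄)` permutes the three lines of that basis with
kernel `σ(K₄)` of index `6 ≠ 3`, and Proposition 6.6 (`Subgroup.isExtendedAdequate_of_lines`)
applies: `isExtendedAdequate_range_of_perm_fin4` and its variants (last section).
-/

namespace Sym4

open Matrix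

/-- The transposition `s = (0 1)` of `S₄ = Sym(Fin 4)`. [folklore] -/
def s : Equiv.Perm (Fin 4) := Equiv.swap 0 1
/-- The `3`-cycle `t = (1 2 3)` (`st = (0 1 2 3)`; `s, t` generate `S₄`). [folklore] -/
def t : Equiv.Perm (Fin 4) := Equiv.swap 1 3 * Equiv.swap 1 2
/-- `k₁ = (0 1)(2 3)`, an element of the Klein four-group `K₄ ⊴ S₄`. [folklore] -/
def k₁ : Equiv.Perm (Fin 4) := Equiv.swap 0 1 * Equiv.swap 2 3
/-- `k₂ = (0 2)(1 3) = (st)²`. [folklore] -/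
def k₂ : Equiv.Perm (Fin 4) := Equiv.swap 0 2 * Equiv.swap 1 3
/-- `k₃ = (0 3)(1 2) = k₁ k₂`. [folklore] -/
def k₃ : Equiv.Perm (Fin 4) := Equiv.swap 0 3 * Equiv.swap 1 2

/-- `s² = 1`. [folklore] -/
theorem s_mul_s : s * s = 1 := by decide
/-- `t³ = 1`. [folklore] -/
theorem t_mul_t_mul_t : t * t * t = 1 := by decide
/-- `k₁² = 1`. [folklore] -/
theorem k₁_mul_k₁ : k₁ * k₁ = 1 := by decide
/-- `k₂² = 1`. [folklore] -/
theorem k₂_mul_k₂ : k₂ * k₂ = 1 := by decide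
/-- `k₁ k₂ = k₃`. [folklore] -/
theorem k₁_mul_k₂ : k₁ * k₂ = k₃ := by decide
/-- `k₂ k₁ = k₃`. [folklore] -/
theorem k₂_mul_k₁ : k₂ * k₁ = k₃ := by decide
/-- `t k₁ t⁻¹ = k₂`. [folklore] -/
theorem k₂_mul_t : k₂ * t = t * k₁ := by decide
/-- `t k₃ t⁻¹ = k₁`. [folklore] -/
theorem k₁_mul_t : k₁ * t = t * (k₁ * k₂) := by decide
/-- `s k₁ s⁻¹ = k₁`. [folklore] -/
theorem k₁_mul_s : k₁ * s = s * k₁ := by decide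
/-- `s k₃ s⁻¹ = k₂`. [folklore] -/
theorem k₂_mul_s : k₂ * s = s * (k₁ * k₂) := by decide
/-- `(st)² = k₂`. [folklore] -/
theorem st_sq : s * t * (s * t) = k₂ := by decide
/-- `k₁ = t² k₂ t`. [folklore] -/
theorem k₁_eq : k₁ = t * t * k₂ * t := by decide

/-- `s` and `t` generate `S₄` (every transposition is a word in `s, t`). [folklore] -/
theorem closure_s_t : Subgroup.closure ({s, t} : Set (Equiv.Perm (Fin 4))) = ⊤ := by
  set C := Subgroup.closure ({s, t} : Set (Equiv.Perm (Fin 4))) with hC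
  have hs : s ∈ C := Subgroup.subset_closure (by simp)
  have ht : t ∈ C := Subgroup.subset_closure (by simp)
  have h02 : Equiv.swap (0 : Fin 4) 2 ∈ C := by
    rw [show Equiv.swap (0 : Fin 4) 2 = t * s * t * t by decide]
    exact C.mul_mem (C.mul_mem (C.mul_mem ht hs) ht) ht
  have h03 : Equiv.swap (0 : Fin 4) 3 ∈ C := by
    rw [show Equiv.swap (0 : Fin 4) 3 = t * t * s * t by decide]
    exact C.mul_mem (C.mul_mem (C.mul_mem ht ht) hs) ht
  have h01 : Equiv.swap (0 : Fin 4) 1 ∈ C := hs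
  have h12 : Equiv.swap (1 : Fin 4) 2 ∈ C := by
    rw [show Equiv.swap (1 : Fin 4) 2 = s * (t * s * t * t) * s by decide]
    exact C.mul_mem (C.mul_mem hs (C.mul_mem (C.mul_mem (C.mul_mem ht hs) ht) ht)) hs
  have h13 : Equiv.swap (1 : Fin 4) 3 ∈ C := by
    rw [show Equiv.swap (1 : Fin 4) 3 = s * (t * t * s * t) * s by decide]
    exact C.mul_mem (C.mul_mem hs (C.mul_mem (C.mul_mem (C.mul_mem ht ht) hs) ht)) hs
  have h23 : Equiv.swap (2 : Fin 4) 3 ∈ C := by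
    rw [show Equiv.swap (2 : Fin 4) 3 = Equiv.swap 0 2 * Equiv.swap 0 3 * Equiv.swap 0 2 by decide]
    exact C.mul_mem (C.mul_mem h02 h03) h02
  rw [eq_top_iff, ← Equiv.Perm.closure_isSwap, Subgroup.closure_le]
  rintro τ ⟨x, y, hxy, rfl⟩
  have key : ∀ a b : Fin 4, a < b → Equiv.swap a b ∈ C := by
    intro a b hab
    fin_cases a <;> fin_cases b <;> simp (config := {decide := true}) at hab <;> assumption
  rcases lt_or_gt_of_ne hxy with h | h
  · exact key x y h
  · rw [Equiv.swap_comm]; exact key y x h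

/-- `s` and `t` generate `S₄` as a monoid. [folklore] -/
theorem mclosure_s_t : Submonoid.closure ({s, t} : Set (Equiv.Perm (Fin 4))) = ⊤ := by
  rw [← Subgroup.closure_toSubmonoid_of_finite, closure_s_t, Subgroup.top_toSubmonoid]

variable (k : Type u) [Field k]

/-- The permutation matrix `P` of the `3`-cycle (`P e₀ = e₁`, `P e₁ = e₂`, `P e₂ = e₀`). [folklore] -/
def Pm : Matrix (Fin 3) (Fin 3) k := Matrix.of fun i j => if i = j + 1 then 1 else 0

variable {k}

/-- The signed permutation matrix `S_ε` (`e₀ ↦ -ε e₀`, `e₁ ↦ ε e₂`, `e₂ ↦ ε e₁`). [folklore] -/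
def Sm (ε : k) : Matrix (Fin 3) (Fin 3) k := Matrix.of fun i j =>
  if i = 0 ∧ j = 0 then -ε else if (i = 1 ∧ j = 2) ∨ (i = 2 ∧ j = 1) then ε else 0

/-- The diagonal matrix `diag(d₀, d₁, d₂)` as an explicit function. [folklore] -/
def Dm (d : Fin 3 → k) : Matrix (Fin 3) (Fin 3) k := Matrix.of fun i j => if i = j then d i else 0

/-- `D₁ = diag(1, -1, -1)`, the matrix of `k₁` on the eigenbasis. [folklore] -/
def D1m : Matrix (Fin 3) (Fin 3) k := Dm ![1, -1, -1]
/-- `D₂ = diag(-1, 1, -1)`, the matrix of `k₂` on the eigenbasis. [folklore] -/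
def D2m : Matrix (Fin 3) (Fin 3) k := Dm ![-1, 1, -1]
/-- `D₃ = diag(-1, -1, 1)`, the matrix of `k₃` on the eigenbasis. [folklore] -/
def D3m : Matrix (Fin 3) (Fin 3) k := Dm ![-1, -1, 1]

/-- `(S_ε P)² = D₂` when `ε² = 1` (the relation `(st)² = k₂`). [folklore] -/
theorem Sm_Pm_sq {ε : k} (hε : ε * ε = 1) : Sm ε * Pm k * (Sm ε * Pm k) = D2m := by
  ext i j; fin_cases i <;> fin_cases j <;>
    simp [Sm, Pm, D2m, Dm, Matrix.mul_apply, hε]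

/-- `P² D₂ P = D₁` (the relation `k₁ = t² k₂ t`). [folklore] -/
theorem PPD2P : Pm k * Pm k * D2m * Pm k = D1m := by
  ext i j; fin_cases i <;> fin_cases j <;>
    simp [Pm, D2m, D1m, Dm, Matrix.mul_apply]

/-- `D₁ D₂ = D₃` (the relation `k₁ k₂ = k₃`). [folklore] -/
theorem D1m_mul_D2m : (D1m : Matrix (Fin 3) (Fin 3) k) * D2m = D3m := by
  ext i j; fin_cases i <;> fin_cases j <;>
    simp [D1m, D2m, D3m, Dm, Matrix.mul_apply]

/-- `P e_j = e_{j+1}`. [folklore] -/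
theorem Pm_mulVec_single (j : Fin 3) : Pm k *ᵥ Pi.single j (1 : k) = Pi.single (j + 1) 1 := by
  fin_cases j <;>
  · ext i; fin_cases i <;> simp [Pm, Matrix.mulVec, dotProduct, Pi.single_apply]

/-- `D₁ e_j = (1, -1, -1)_j e_j`. [folklore] -/
theorem D1m_mulVec_single (j : Fin 3) :
    (D1m : Matrix (Fin 3) (Fin 3) k) *ᵥ Pi.single j (1 : k) = (![1, -1, -1] j : k) • Pi.single j 1 := by
  fin_cases j <;>
  · ext i; fin_cases i <;> simp [D1m, Dm, Matrix.mulVec, dotProduct, Pi.single_apply]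

/-- `S_ε e₀ = -ε e₀`. [folklore] -/
theorem Sm_mulVec_single_zero (ε : k) : Sm ε *ᵥ Pi.single 0 (1 : k) = (-ε) • Pi.single 0 1 := by
  ext i; fin_cases i <;> simp [Sm, Matrix.mulVec, dotProduct, Pi.single_apply]

/-- `S_ε e₁ = ε e₂`. [folklore] -/
theorem Sm_mulVec_single_one (ε : k) : Sm ε *ᵥ Pi.single 1 (1 : k) = ε • Pi.single 2 1 := by
  ext i; fin_cases i <;> simp [Sm, Matrix.mulVec, dotProduct, Pi.single_apply]

/-- `S_ε e₂ = ε e₁`. [folklore] -/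
theorem Sm_mulVec_single_two (ε : k) : Sm ε *ᵥ Pi.single 2 (1 : k) = ε • Pi.single 1 1 := by
  ext i; fin_cases i <;> simp [Sm, Matrix.mulVec, dotProduct, Pi.single_apply]

/-- `2 ≠ 0` in characteristic `3`. [folklore] -/
theorem two_ne_zero_of_charP_three [CharP k 3] : (2 : k) ≠ 0 := by
  intro h
  have h3 : (3 : k) = 0 := by exact_mod_cast CharP.cast_eq_zero k 3
  have h1 : (1 : k) = 0 := by linear_combination h3 - h
  exact one_ne_zero h1

/-- The matrix with columns `e 0, e 1, e 2`. [folklore] -/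
def colMat (e : Fin 3 → Fin 3 → k) : Matrix (Fin 3) (Fin 3) k := Matrix.of fun i j => e j i

/-- `[e₀ e₁ e₂] c = ∑ cⱼ eⱼ`. [folklore] -/
theorem colMat_mulVec (e : Fin 3 → Fin 3 → k) (c : Fin 3 → k) :
    colMat e *ᵥ c = c 0 • e 0 + c 1 • e 1 + c 2 • e 2 := by
  ext i
  simp [colMat, Matrix.mulVec, dotProduct, Fin.sum_univ_three, mul_comm]

/-- `X [e₀ e₁ e₂] = [Xe₀ Xe₁ Xe₂]`. [folklore] -/
theorem mul_colMat (X : Matrix (Fin 3) (Fin 3) k) (e : Fin 3 → Fin 3 → k) :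
    X * colMat e = colMat fun j => X *ᵥ e j := by
  ext i j
  simp [colMat, Matrix.mul_apply, Matrix.mulVec, dotProduct]

/-- `[e₀ e₁ e₂] P = [e₁ e₂ e₀]`. [folklore] -/
theorem colMat_mul_Pm (e : Fin 3 → Fin 3 → k) :
    colMat e * Pm k = colMat ![e 1, e 2, e 0] := by
  ext i j
  fin_cases j <;> simp [colMat, Pm, Matrix.mul_apply]

/-- `[e₀ e₁ e₂] diag(d) = [d₀e₀ d₁e₁ d₂e₂]`. [folklore] -/
theorem colMat_mul_Dm (e : Fin 3 → Fin 3 → k) (d : Fin 3 → k) :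
    colMat e * Dm d = colMat fun j => d j • e j := by
  ext i j
  simp [colMat, Dm, Matrix.mul_apply, mul_comm]

/-- **Normal form of a `3`-dimensional representation of `S₄` whose matrices span `M₃(k)` and
which does not kill the Klein four-group** (`char k ≠ 2`): in the basis `(v, σ(t)v, σ(t)²v)`, `v`
a simultaneous eigenvector of `σ(K₄)` for the character `(1, -1, -1)`, `σ(t)` is the permutation
matrix `P` and `σ(s)` is the signed permutation matrix `S_ε` for some `ε = ±1`. [folklore] -/
theorem exists_normalForm (σ : Equiv.Perm (Fin 4) →* GL (Fin 3) k)
    (hspan : Submodule.span k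
      (Set.range fun g => ((σ g : GL (Fin 3) k) : Matrix (Fin 3) (Fin 3) k)) = ⊤)
    (hk : σ k₁ ≠ 1) (h2 : (2 : k) ≠ 0) :
    ∃ (B : GL (Fin 3) k) (ε : k), ε * ε = 1 ∧
      ((B⁻¹ * σ t * B : GL (Fin 3) k) : Matrix (Fin 3) (Fin 3) k) = Pm k ∧
      ((B⁻¹ * σ s * B : GL (Fin 3) k) : Matrix (Fin 3) (Fin 3) k) = Sm ε := by
  -- the four matrices
  obtain ⟨A₁, hA₁⟩ : ∃ A : Matrix (Fin 3) (Fin 3) k, A = (σ k₁ : GL (Fin 3) k) := ⟨_, rfl⟩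
  obtain ⟨A₂, hA₂⟩ : ∃ A : Matrix (Fin 3) (Fin 3) k, A = (σ k₂ : GL (Fin 3) k) := ⟨_, rfl⟩
  obtain ⟨T, hT⟩ : ∃ A : Matrix (Fin 3) (Fin 3) k, A = (σ t : GL (Fin 3) k) := ⟨_, rfl⟩
  obtain ⟨S, hS⟩ : ∃ A : Matrix (Fin 3) (Fin 3) k, A = (σ s : GL (Fin 3) k) := ⟨_, rfl⟩
  have hmul : ∀ g h : Equiv.Perm (Fin 4), ((σ (g * h) : GL (Fin 3) k) : Matrix (Fin 3) (Fin 3) k) =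
      ((σ g : GL (Fin 3) k) : Matrix (Fin 3) (Fin 3) k) * ((σ h : GL (Fin 3) k) : Matrix _ _ k) :=
    fun g h => by rw [map_mul, Units.val_mul]
  have hone : ((σ 1 : GL (Fin 3) k) : Matrix (Fin 3) (Fin 3) k) = 1 := by rw [map_one, Units.val_one]
  have hA1sq : A₁ * A₁ = 1 := by rw [hA₁, ← hmul, k₁_mul_k₁, hone]
  have hA2sq : A₂ * A₂ = 1 := by rw [hA₂, ← hmul, k₂_mul_k₂, hone]
  have hcomm : A₁ * A₂ = A₂ * A₁ := by rw [hA₁, hA₂, ← hmul, ← hmul, k₁_mul_k₂, k₂_mul_k₁]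
  have hA2T : A₂ * T = T * A₁ := by rw [hA₂, hT, hA₁, ← hmul, ← hmul, k₂_mul_t]
  have hA1T : A₁ * T = T * (A₁ * A₂) := by rw [hA₁, hT, hA₂, ← hmul, ← hmul, ← hmul, k₁_mul_t]
  have hA1S : A₁ * S = S * A₁ := by rw [hA₁, hS, ← hmul, ← hmul, k₁_mul_s]
  have hA2S : A₂ * S = S * (A₁ * A₂) := by rw [hA₂, hS, hA₁, ← hmul, ← hmul, ← hmul, k₂_mul_s]
  have hT3 : T * T * T = 1 := by rw [hT, ← hmul, ← hmul, t_mul_t_mul_t, hone]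
  -- (1) the common fixed space of `A₁, A₂` is zero
  have hW : ∀ w : Fin 3 → k, A₁ *ᵥ w = w → A₂ *ᵥ w = w → w = 0 := by
    let W : Submodule k (Fin 3 → k) :=
      { carrier := {w | A₁ *ᵥ w = w ∧ A₂ *ᵥ w = w}
        add_mem' := fun {a b} ha hb =>
          ⟨by rw [Matrix.mulVec_add, ha.1, hb.1], by rw [Matrix.mulVec_add, ha.2, hb.2]⟩
        zero_mem' := ⟨Matrix.mulVec_zero _, Matrix.mulVec_zero _⟩
        smul_mem' := fun c a ha =>
          ⟨by rw [Matrix.mulVec_smul, ha.1], by rw [Matrix.mulVec_smul, ha.2]⟩ }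
    have hgen : ∀ g : Equiv.Perm (Fin 4), ∀ w ∈ W,
        ((σ g : GL (Fin 3) k) : Matrix (Fin 3) (Fin 3) k) *ᵥ w ∈ W := by
      intro g
      have hg : g ∈ Submonoid.closure ({s, t} : Set (Equiv.Perm (Fin 4))) := by
        rw [mclosure_s_t]; exact Submonoid.mem_top g
      refine Submonoid.closure_induction
        (motive := fun g _ => ∀ w ∈ W, ((σ g : GL (Fin 3) k) : Matrix (Fin 3) (Fin 3) k) *ᵥ w ∈ W)
        ?_ ?_ ?_ hg
      · intro x hx w hw
        obtain ⟨hw1, hw2⟩ := hw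
        simp only [Set.mem_insert_iff, Set.mem_singleton_iff] at hx
        rcases hx with rfl | rfl
        · refine ⟨?_, ?_⟩
          · rw [← hS, Matrix.mulVec_mulVec, hA1S, ← Matrix.mulVec_mulVec, hw1]
          · rw [← hS, Matrix.mulVec_mulVec, hA2S, ← Matrix.mulVec_mulVec, ← Matrix.mulVec_mulVec,
              hw2, hw1]
        · refine ⟨?_, ?_⟩
          · rw [← hT, Matrix.mulVec_mulVec, hA1T, ← Matrix.mulVec_mulVec, ← Matrix.mulVec_mulVec,
              hw2, hw1]
          · rw [← hT, Matrix.mulVec_mulVec, hA2T, ← Matrix.mulVec_mulVec, hw1]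
      · intro w hw
        rwa [hone, Matrix.one_mulVec]
      · intro x y _ _ hx hy w hw
        rw [hmul, ← Matrix.mulVec_mulVec]
        exact hx _ (hy _ hw)
    have hall : ∀ M : Matrix (Fin 3) (Fin 3) k, ∀ w ∈ W, M *ᵥ w ∈ W := by
      intro M
      have hM : M ∈ Submodule.span k
          (Set.range fun g => ((σ g : GL (Fin 3) k) : Matrix (Fin 3) (Fin 3) k)) := by
        rw [hspan]; exact Submodule.mem_top
      refine Submodule.span_induction (p := fun M _ => ∀ w ∈ W, M *ᵥ w ∈ W) ?_ ?_ ?_ ?_ hM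
      · rintro _ ⟨g, rfl⟩; exact hgen g
      · intro w _; rw [Matrix.zero_mulVec]; exact W.zero_mem
      · intro M N _ _ hM hN w hw; rw [Matrix.add_mulVec]; exact W.add_mem (hM w hw) (hN w hw)
      · intro c M _ hM w hw; rw [Matrix.smul_mulVec]; exact W.smul_mem c (hM w hw)
    intro w hw1 hw2
    by_contra hw0
    obtain ⟨j₀, hj₀⟩ : ∃ j, w j ≠ 0 := by
      by_contra! h0
      exact hw0 (funext h0)
    have hwW : w ∈ W := ⟨hw1, hw2⟩
    have htop : ∀ v : Fin 3 → k, v ∈ W := by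
      intro v
      let M : Matrix (Fin 3) (Fin 3) k := Matrix.of fun i j => if j = j₀ then v i * (w j₀)⁻¹ else 0
      have hMw : M *ᵥ w = v := by
        ext i
        simp [M, Matrix.mulVec, dotProduct, hj₀]
      rw [← hMw]
      exact hall M w hwW
    apply hk
    refine Units.ext (Matrix.toLin'.injective (LinearMap.ext fun v => ?_))
    rw [Matrix.toLin'_apply, Units.val_one, Matrix.toLin'_apply, Matrix.one_mulVec, ← hA₁]
    exact (htop v).1
  -- (2) `σ k₁ ≠ -1`
  have hA1ne : σ k₁ ≠ -1 := by
    intro hneg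
    have h2' : σ k₂ = -1 := by
      rw [show k₂ = t * k₁ * t⁻¹ by decide, map_mul, map_mul, map_inv, hneg]; simp
    have h3' : σ k₃ = 1 := by
      rw [← k₁_mul_k₂, map_mul, hneg, h2']; simp
    apply hk
    rw [show k₁ = t * k₃ * t⁻¹ by decide, map_mul, map_mul, map_inv, h3', mul_one, mul_inv_cancel]
  -- (3) a nonzero `u` with `A₁ u = u`
  obtain ⟨u, hu0, hu1⟩ : ∃ u : Fin 3 → k, u ≠ 0 ∧ A₁ *ᵥ u = u := by
    by_contra! hnone
    have hx : ∀ x, A₁ *ᵥ x + x = 0 := by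
      intro x
      by_contra hx0
      refine hnone (A₁ *ᵥ x + x) hx0 ?_
      rw [Matrix.mulVec_add, Matrix.mulVec_mulVec, hA1sq, Matrix.one_mulVec, add_comm]
    apply hA1ne
    refine Units.ext (Matrix.toLin'.injective (LinearMap.ext fun x => ?_))
    rw [Matrix.toLin'_apply, Units.val_neg, Units.val_one, Matrix.toLin'_apply, Matrix.neg_mulVec,
      Matrix.one_mulVec, ← hA₁]
    exact eq_neg_of_add_eq_zero_left (hx x)
  -- (4) a nonzero `v` with `A₁ v = v`, `A₂ v = -v`
  obtain ⟨v, hv0, hv1, hv2⟩ : ∃ v : Fin 3 → k, v ≠ 0 ∧ A₁ *ᵥ v = v ∧ A₂ *ᵥ v = -v := by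
    by_cases hfix : A₂ *ᵥ u = u
    · exact absurd (hW u hu1 hfix) hu0
    · refine ⟨A₂ *ᵥ u - u, sub_ne_zero.2 hfix, ?_, ?_⟩
      · rw [Matrix.mulVec_sub, Matrix.mulVec_mulVec, hcomm, ← Matrix.mulVec_mulVec, hu1]
      · rw [Matrix.mulVec_sub, Matrix.mulVec_mulVec, hA2sq, Matrix.one_mulVec, neg_sub]
  -- (5) the eigenbasis `v, Tv, TTv`
  obtain ⟨Tv, hTv⟩ : ∃ x, x = T *ᵥ v := ⟨_, rfl⟩
  obtain ⟨TTv, hTTv⟩ : ∃ x, x = T *ᵥ Tv := ⟨_, rfl⟩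
  have hTinj : Function.Injective T.mulVec := by
    rw [hT]; exact Matrix.mulVec_injective_iff_isUnit.2 (σ t).isUnit
  have he2A2 : A₂ *ᵥ Tv = Tv := by
    rw [hTv, Matrix.mulVec_mulVec, hA2T, ← Matrix.mulVec_mulVec, hv1]
  have he2A1 : A₁ *ᵥ Tv = -Tv := by
    rw [hTv, Matrix.mulVec_mulVec, hA1T, ← Matrix.mulVec_mulVec, ← Matrix.mulVec_mulVec, hv2,
      Matrix.mulVec_neg, hv1, Matrix.mulVec_neg]
  have he3A1 : A₁ *ᵥ TTv = -TTv := by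
    rw [hTTv, Matrix.mulVec_mulVec, hA1T, ← Matrix.mulVec_mulVec, ← Matrix.mulVec_mulVec, he2A2,
      he2A1, Matrix.mulVec_neg]
  have he3A2 : A₂ *ᵥ TTv = -TTv := by
    rw [hTTv, Matrix.mulVec_mulVec, hA2T, ← Matrix.mulVec_mulVec, he2A1, Matrix.mulVec_neg]
  have hTe3 : T *ᵥ TTv = v := by
    rw [hTTv, hTv, Matrix.mulVec_mulVec, Matrix.mulVec_mulVec, hT3, Matrix.one_mulVec]
  have hTv0 : Tv ≠ 0 := fun h0 => hv0 (hTinj (by rw [← hTv, h0, Matrix.mulVec_zero]))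
  have hTTv0 : TTv ≠ 0 := fun h0 => hTv0 (hTinj (by rw [← hTTv, h0, Matrix.mulVec_zero]))
  -- (6) the change of basis
  let e : Fin 3 → Fin 3 → k := ![v, Tv, TTv]
  have hBinj : Function.Injective (colMat e).mulVec := by
    rw [← Matrix.coe_mulVecLin]
    refine (injective_iff_map_eq_zero _).2 fun c hc => ?_
    rw [Matrix.mulVecLin_apply, colMat_mulVec] at hc
    have hc0 : c 0 • v + c 1 • Tv + c 2 • TTv = 0 := hc
    have hc1 : c 0 • v + c 1 • -Tv + c 2 • -TTv = 0 := by
      have := congrArg A₁.mulVec hc0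
      simpa only [Matrix.mulVec_add, Matrix.mulVec_smul, hv1, he2A1, he3A1, Matrix.mulVec_zero]
        using this
    have hc2 : c 0 • -v + c 1 • Tv + c 2 • -TTv = 0 := by
      have := congrArg A₂.mulVec hc0
      simpa only [Matrix.mulVec_add, Matrix.mulVec_smul, hv2, he2A2, he3A2, Matrix.mulVec_zero]
        using this
    have h0 : (2 * c 0) • v = 0 := by linear_combination (norm := module) hc0 + hc1
    have h1 : (2 * c 1) • Tv = 0 := by linear_combination (norm := module) hc0 + hc2
    have h2' : (2 * c 2) • TTv = 0 := by linear_combination (norm := module) -hc1 - hc2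
    rw [smul_eq_zero, mul_eq_zero] at h0 h1 h2'
    funext i
    fin_cases i
    · exact (h0.resolve_right hv0).resolve_left h2
    · exact (h1.resolve_right hTv0).resolve_left h2
    · exact (h2'.resolve_right hTTv0).resolve_left h2
  have hBu : IsUnit (colMat e) := Matrix.mulVec_injective_iff_isUnit.1 hBinj
  have hTB : T * colMat e = colMat e * Pm k := by
    rw [mul_colMat, colMat_mul_Pm]
    congr 1
    funext j
    fin_cases j
    · simp [e, hTv]
    · simp [e, hTTv]
    · simp [e, hTe3]
  have hA1B : A₁ * colMat e = colMat e * D1m := by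
    rw [mul_colMat, D1m, colMat_mul_Dm]
    congr 1
    funext j
    fin_cases j
    · simp [e, hv1]
    · simp [e, he2A1]
    · simp [e, he3A1]
  have hA2B : A₂ * colMat e = colMat e * D2m := by
    rw [mul_colMat, D2m, colMat_mul_Dm]
    congr 1
    funext j
    fin_cases j
    · simp [e, hv2]
    · simp [e, he2A2]
    · simp [e, he3A2]
  obtain ⟨B, hB⟩ : ∃ B : GL (Fin 3) k, (B : Matrix (Fin 3) (Fin 3) k) = colMat e :=
    ⟨hBu.unit, hBu.unit_spec⟩
  have hconj : ∀ X Y : Matrix (Fin 3) (Fin 3) k, X * colMat e = colMat e * Y →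
      ((B⁻¹ : GL (Fin 3) k) : Matrix (Fin 3) (Fin 3) k) * X * B = Y := by
    intro X Y hXY
    rw [Matrix.mul_assoc, hB, hXY, ← Matrix.mul_assoc, ← hB, Units.inv_mul, Matrix.one_mul]
  -- (7) the conjugated representation
  set σ' : Equiv.Perm (Fin 4) →* GL (Fin 3) k := (MulAut.conj B⁻¹).toMonoidHom.comp σ with hσ'def
  have hσ' : ∀ g, σ' g = B⁻¹ * σ g * B := fun g => by
    rw [hσ'def, MonoidHom.comp_apply, MulEquiv.coe_toMonoidHom, MulAut.conj_apply, inv_inv]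
  have hσ'val : ∀ g, ((σ' g : GL (Fin 3) k) : Matrix (Fin 3) (Fin 3) k) =
      ((B⁻¹ : GL (Fin 3) k) : Matrix (Fin 3) (Fin 3) k) * ((σ g : GL (Fin 3) k) : Matrix _ _ k) *
        (B : Matrix (Fin 3) (Fin 3) k) :=
    fun g => by rw [hσ', Units.val_mul, Units.val_mul]
  have hmul' : ∀ g h : Equiv.Perm (Fin 4), ((σ' (g * h) : GL (Fin 3) k) : Matrix (Fin 3) (Fin 3) k) =
      ((σ' g : GL (Fin 3) k) : Matrix (Fin 3) (Fin 3) k) * ((σ' h : GL (Fin 3) k) : Matrix _ _ k) :=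
    fun g h => by rw [map_mul, Units.val_mul]
  have hPt : ((σ' t : GL (Fin 3) k) : Matrix (Fin 3) (Fin 3) k) = Pm k := by
    rw [hσ'val, ← hT]; exact hconj T _ hTB
  have hD1 : ((σ' k₁ : GL (Fin 3) k) : Matrix (Fin 3) (Fin 3) k) = D1m := by
    rw [hσ'val, ← hA₁]; exact hconj A₁ _ hA1B
  have hD2 : ((σ' k₂ : GL (Fin 3) k) : Matrix (Fin 3) (Fin 3) k) = D2m := by
    rw [hσ'val, ← hA₂]; exact hconj A₂ _ hA2B
  obtain ⟨X, hX⟩ : ∃ A : Matrix (Fin 3) (Fin 3) k, A = (σ' s : GL (Fin 3) k) := ⟨_, rfl⟩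
  have E1 : X * D1m = D1m * X := by
    calc X * D1m = ((σ' (s * k₁) : GL (Fin 3) k) : Matrix (Fin 3) (Fin 3) k) := by
          rw [hmul', hX, hD1]
      _ = ((σ' (k₁ * s) : GL (Fin 3) k) : Matrix (Fin 3) (Fin 3) k) := by
          rw [show s * k₁ = k₁ * s by decide]
      _ = D1m * X := by rw [hmul', hX, hD1]
  have E2 : X * D2m = D3m * X := by
    calc X * D2m = ((σ' (s * k₂) : GL (Fin 3) k) : Matrix (Fin 3) (Fin 3) k) := by
          rw [hmul', hX, hD2]
      _ = ((σ' (k₁ * k₂ * s) : GL (Fin 3) k) : Matrix (Fin 3) (Fin 3) k) := by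
          rw [show s * k₂ = k₁ * k₂ * s by decide]
      _ = D3m * X := by rw [hmul', hmul', hX, hD1, hD2, D1m_mul_D2m]
  have E3 : X * X = 1 := by
    calc X * X = ((σ' (s * s) : GL (Fin 3) k) : Matrix (Fin 3) (Fin 3) k) := by rw [hmul', hX]
      _ = 1 := by rw [s_mul_s, map_one, Units.val_one]
  have E4 : X * Pm k * (X * Pm k) = D2m := by
    calc X * Pm k * (X * Pm k)
          = ((σ' (s * t * (s * t)) : GL (Fin 3) k) : Matrix (Fin 3) (Fin 3) k) := by
          rw [hmul' (s * t), hmul', hX, hPt]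
      _ = D2m := by rw [st_sq, hD2]
  -- (8) solve for `X`
  have hzero : ∀ a : k, a * -1 = a → a = 0 := fun a ha => by
    have h' : (2 : k) * a = 0 := by linear_combination -ha
    exact (mul_eq_zero.1 h').resolve_left h2
  have hzero' : ∀ a : k, a = -a → a = 0 := fun a ha => by
    have h' : (2 : k) * a = 0 := by linear_combination ha
    exact (mul_eq_zero.1 h').resolve_left h2
  have hX01 : X 0 1 = 0 := hzero _ (by
    simpa [D1m, Dm, Matrix.mul_apply, Fin.sum_univ_three] using congrFun (congrFun E1 0) 1)
  have hX02 : X 0 2 = 0 := hzero _ (by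
    simpa [D1m, Dm, Matrix.mul_apply, Fin.sum_univ_three] using congrFun (congrFun E1 0) 2)
  have hX10 : X 1 0 = 0 := hzero' _ (by
    simpa [D1m, Dm, Matrix.mul_apply, Fin.sum_univ_three] using congrFun (congrFun E1 1) 0)
  have hX20 : X 2 0 = 0 := hzero' _ (by
    simpa [D1m, Dm, Matrix.mul_apply, Fin.sum_univ_three] using congrFun (congrFun E1 2) 0)
  have hX11 : X 1 1 = 0 := hzero' _ (by
    simpa [D2m, D3m, Dm, Matrix.mul_apply, Fin.sum_univ_three] using congrFun (congrFun E2 1) 1)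
  have hX22 : X 2 2 = 0 := hzero _ (by
    simpa [D2m, D3m, Dm, Matrix.mul_apply, Fin.sum_univ_three] using congrFun (congrFun E2 2) 2)
  have hX12sq : X 1 2 * X 1 2 = 1 := by
    simpa [Pm, D2m, Dm, Matrix.mul_apply, Fin.sum_univ_three, hX01, hX02, hX10, hX20, hX11, hX22]
      using congrFun (congrFun E4 1) 1
  have hX12X21 : X 1 2 * X 2 1 = 1 := by
    simpa [Matrix.mul_apply, Fin.sum_univ_three, hX01, hX02, hX10, hX20, hX11, hX22]
      using congrFun (congrFun E3 1) 1
  have hX00X21 : X 0 0 * X 2 1 = -1 := by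
    simpa [Pm, D2m, Dm, Matrix.mul_apply, Fin.sum_univ_three, hX01, hX02, hX10, hX20, hX11, hX22]
      using congrFun (congrFun E4 0) 0
  have hX21 : X 2 1 = X 1 2 := by
    linear_combination (-X 2 1) * hX12sq + X 1 2 * hX12X21
  have hX00 : X 0 0 = -X 1 2 := by
    linear_combination (X 1 2) * hX00X21 + (-(X 0 0 * X 1 2)) * hX21 + (-X 0 0) * hX12sq
  refine ⟨B, X 1 2, hX12sq, ?_, ?_⟩
  · rw [← hσ', hPt]
  · rw [← hσ', ← hX]
    ext i j
    fin_cases i <;> fin_cases j <;> simp [Sm, hX00, hX01, hX02, hX10, hX11, hX20, hX21, hX22]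


/-- **If `σ : S₄ → GL₃(k)` kills the Klein four-group, its matrices do not span `M₃(k)`**
(`char k = 3`): `σ` factors through `S₃ = ⟨s, t⟩`, `σ(t)³ = 1` forces a non-zero fixed vector of
`σ(t)` in characteristic `3`, the fixed space of `σ(t)` is `σ(S₄)`-stable, so `σ(t) = 1` once the
matrices span; then everything commutes with `σ(s)`, which must be scalar, and scalars do not
span. [folklore] -/
theorem span_ne_top_of_map_k₁_eq_one [CharP k 3] (σ : Equiv.Perm (Fin 4) →* GL (Fin 3) k)
    (hk : σ k₁ = 1) :
    Submodule.span k (Set.range fun g => ((σ g : GL (Fin 3) k) : Matrix (Fin 3) (Fin 3) k)) ≠ ⊤ := by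
  intro hspan
  have h3 : (3 : k) = 0 := by exact_mod_cast CharP.cast_eq_zero k 3
  obtain ⟨T, hT⟩ : ∃ A : Matrix (Fin 3) (Fin 3) k, A = (σ t : GL (Fin 3) k) := ⟨_, rfl⟩
  obtain ⟨S, hS⟩ : ∃ A : Matrix (Fin 3) (Fin 3) k, A = (σ s : GL (Fin 3) k) := ⟨_, rfl⟩
  have hmul : ∀ g h : Equiv.Perm (Fin 4), ((σ (g * h) : GL (Fin 3) k) : Matrix (Fin 3) (Fin 3) k) =
      ((σ g : GL (Fin 3) k) : Matrix (Fin 3) (Fin 3) k) * ((σ h : GL (Fin 3) k) : Matrix _ _ k) :=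
    fun g h => by rw [map_mul, Units.val_mul]
  have hone : ((σ 1 : GL (Fin 3) k) : Matrix (Fin 3) (Fin 3) k) = 1 := by rw [map_one, Units.val_one]
  have hk3 : σ k₃ = 1 := by
    rw [show k₃ = t⁻¹ * k₁ * t by decide, map_mul, map_mul, hk, mul_one, map_inv, inv_mul_cancel]
  have hT3 : T * T * T = 1 := by rw [hT, ← hmul, ← hmul, t_mul_t_mul_t, hone]
  have hTS : T * S = S * (T * T) := by
    rw [hT, hS, ← hmul, ← hmul, ← hmul, show t * s = k₃ * (s * (t * t)) by decide, map_mul, hk3,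
      one_mul]
  -- a non-zero fixed vector of `T`
  have hTTT : ∀ x : Fin 3 → k, T *ᵥ (T *ᵥ (T *ᵥ x)) = x := fun x => by
    rw [Matrix.mulVec_mulVec, Matrix.mulVec_mulVec, hT3, Matrix.one_mulVec]
  obtain ⟨u, hu0, hu⟩ : ∃ u : Fin 3 → k, u ≠ 0 ∧ T *ᵥ u = u := by
    by_cases hall : ∀ w : Fin 3 → k, w + T *ᵥ w + T *ᵥ (T *ᵥ w) = 0
    · by_cases hT1 : T = 1
      · refine ⟨Pi.single 0 1, ?_, by rw [hT1, Matrix.one_mulVec]⟩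
        intro h0
        have := congrFun h0 0
        simp at this
      · obtain ⟨w, hw⟩ : ∃ w, T *ᵥ w - w ≠ 0 := by
          by_contra! hw
          apply hT1
          refine Matrix.toLin'.injective (LinearMap.ext fun w => ?_)
          rw [Matrix.toLin'_apply, Matrix.toLin'_apply, Matrix.one_mulVec]
          exact sub_eq_zero.1 (hw w)
        refine ⟨T *ᵥ w - w, hw, ?_⟩
        have h3v : (3 : k) • (T *ᵥ w) = 0 := by rw [h3, zero_smul]
        have hw' := hall w
        rw [Matrix.mulVec_sub]
        linear_combination (norm := module) hw' - h3v
    · obtain ⟨w, hw⟩ := not_forall.1 hall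
      refine ⟨w + T *ᵥ w + T *ᵥ (T *ᵥ w), hw, ?_⟩
      rw [Matrix.mulVec_add, Matrix.mulVec_add, hTTT]
      abel
  -- the fixed space of `T` is stable under `σ(S₄)`, hence everything: `T = 1`
  let U : Submodule k (Fin 3 → k) :=
    { carrier := {w | T *ᵥ w = w}
      add_mem' := fun {a b} ha hb => by
        change T *ᵥ (a + b) = a + b
        rw [Matrix.mulVec_add, ha, hb]
      zero_mem' := Matrix.mulVec_zero _
      smul_mem' := fun c a ha => by
        change T *ᵥ (c • a) = c • a
        rw [Matrix.mulVec_smul, ha] }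
  have hgen : ∀ g : Equiv.Perm (Fin 4), ∀ w ∈ U,
      ((σ g : GL (Fin 3) k) : Matrix (Fin 3) (Fin 3) k) *ᵥ w ∈ U := by
    intro g
    have hg : g ∈ Submonoid.closure ({s, t} : Set (Equiv.Perm (Fin 4))) := by
      rw [mclosure_s_t]; exact Submonoid.mem_top g
    refine Submonoid.closure_induction
      (motive := fun g _ => ∀ w ∈ U, ((σ g : GL (Fin 3) k) : Matrix (Fin 3) (Fin 3) k) *ᵥ w ∈ U)
      ?_ ?_ ?_ hg
    · intro x hx w hw
      simp only [Set.mem_insert_iff, Set.mem_singleton_iff] at hx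
      rcases hx with rfl | rfl
      · change T *ᵥ (((σ s : GL (Fin 3) k) : Matrix (Fin 3) (Fin 3) k) *ᵥ w) = _
        rw [← hS, Matrix.mulVec_mulVec, hTS, ← Matrix.mulVec_mulVec, ← Matrix.mulVec_mulVec, hw, hw]
      · change T *ᵥ (((σ t : GL (Fin 3) k) : Matrix (Fin 3) (Fin 3) k) *ᵥ w) = _
        rw [← hT, hw, hw]
    · intro w hw
      rwa [hone, Matrix.one_mulVec]
    · intro x y _ _ hx hy w hw
      rw [hmul, ← Matrix.mulVec_mulVec]
      exact hx _ (hy _ hw)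
  have hallM : ∀ M : Matrix (Fin 3) (Fin 3) k, ∀ w ∈ U, M *ᵥ w ∈ U := by
    intro M
    have hM : M ∈ Submodule.span k
        (Set.range fun g => ((σ g : GL (Fin 3) k) : Matrix (Fin 3) (Fin 3) k)) := by
      rw [hspan]; exact Submodule.mem_top
    refine Submodule.span_induction (p := fun M _ => ∀ w ∈ U, M *ᵥ w ∈ U) ?_ ?_ ?_ ?_ hM
    · rintro _ ⟨g, rfl⟩; exact hgen g
    · intro w _; rw [Matrix.zero_mulVec]; exact U.zero_mem
    · intro M N _ _ hM hN w hw; rw [Matrix.add_mulVec]; exact U.add_mem (hM w hw) (hN w hw)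
    · intro c M _ hM w hw; rw [Matrix.smul_mulVec]; exact U.smul_mem c (hM w hw)
  have hT1 : T = 1 := by
    obtain ⟨j₀, hj₀⟩ : ∃ j, u j ≠ 0 := by
      by_contra! h0
      exact hu0 (funext h0)
    refine Matrix.toLin'.injective (LinearMap.ext fun v => ?_)
    rw [Matrix.toLin'_apply, Matrix.toLin'_apply, Matrix.one_mulVec]
    let M : Matrix (Fin 3) (Fin 3) k := Matrix.of fun i j => if j = j₀ then v i * (u j₀)⁻¹ else 0
    have hMu : M *ᵥ u = v := by
      ext i
      simp [M, Matrix.mulVec, dotProduct, hj₀]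
    have hv : v ∈ U := by rw [← hMu]; exact hallM M u hu
    exact hv
  -- every matrix commutes with `S`; so `S` is scalar, every `σ(g)` is scalar, and scalars do not span
  have hcommS : ∀ M : Matrix (Fin 3) (Fin 3) k, M * S = S * M := by
    have hgen' : ∀ g : Equiv.Perm (Fin 4),
        ((σ g : GL (Fin 3) k) : Matrix (Fin 3) (Fin 3) k) * S = S * (σ g : GL (Fin 3) k) := by
      intro g
      have hg : g ∈ Submonoid.closure ({s, t} : Set (Equiv.Perm (Fin 4))) := by
        rw [mclosure_s_t]; exact Submonoid.mem_top g
      refine Submonoid.closure_induction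
        (motive := fun g _ => ((σ g : GL (Fin 3) k) : Matrix (Fin 3) (Fin 3) k) * S = S * (σ g : GL (Fin 3) k))
        ?_ ?_ ?_ hg
      · intro x hx
        simp only [Set.mem_insert_iff, Set.mem_singleton_iff] at hx
        rcases hx with rfl | rfl
        · rw [← hS]
        · rw [← hT, hT1, Matrix.one_mul, Matrix.mul_one]
      · rw [hone, Matrix.one_mul, Matrix.mul_one]
      · intro x y _ _ hx hy
        rw [hmul, Matrix.mul_assoc, hy, ← Matrix.mul_assoc, hx, Matrix.mul_assoc]
    intro M
    have hM : M ∈ Submodule.span k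
        (Set.range fun g => ((σ g : GL (Fin 3) k) : Matrix (Fin 3) (Fin 3) k)) := by
      rw [hspan]; exact Submodule.mem_top
    refine Submodule.span_induction (p := fun M _ => M * S = S * M) ?_ ?_ ?_ ?_ hM
    · rintro _ ⟨g, rfl⟩; exact hgen' g
    · rw [Matrix.zero_mul, Matrix.mul_zero]
    · intro M N _ _ hM hN; rw [Matrix.add_mul, Matrix.mul_add, hM, hN]
    · intro c M _ hM; rw [Matrix.smul_mul, Matrix.mul_smul, hM]
  obtain ⟨c, hc⟩ : S ∈ Set.range (Matrix.scalar (Fin 3)) :=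
    Matrix.mem_range_scalar_of_commute_single fun i j _ => hcommS _
  have hscalar : ∀ g : Equiv.Perm (Fin 4),
      ((σ g : GL (Fin 3) k) : Matrix (Fin 3) (Fin 3) k) ∈ scalarMatrices (Fin 3) k := by
    intro g
    have hg : g ∈ Submonoid.closure ({s, t} : Set (Equiv.Perm (Fin 4))) := by
      rw [mclosure_s_t]; exact Submonoid.mem_top g
    refine Submonoid.closure_induction
      (motive := fun g _ => ((σ g : GL (Fin 3) k) : Matrix (Fin 3) (Fin 3) k) ∈ scalarMatrices (Fin 3) k)
      ?_ ?_ ?_ hg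
    · intro x hx
      simp only [Set.mem_insert_iff, Set.mem_singleton_iff] at hx
      rcases hx with rfl | rfl
      · rw [← hS, ← hc, Matrix.scalar_apply, ← Matrix.smul_one_eq_diagonal]
        exact smul_one_mem_scalarMatrices k c
      · rw [← hT, hT1]
        exact (smul_one_mem_scalarMatrices k (1 : k)) |> fun h => by rwa [one_smul] at h
    · rw [hone]
      exact (smul_one_mem_scalarMatrices k (1 : k)) |> fun h => by rwa [one_smul] at h
    · intro x y _ _ hx hy
      obtain ⟨a, ha⟩ := (mem_scalarMatrices_iff _).1 hx
      obtain ⟨b, hb⟩ := (mem_scalarMatrices_iff _).1 hy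
      rw [hmul, ← ha, ← hb, Matrix.smul_mul, Matrix.one_mul, smul_smul]
      exact smul_one_mem_scalarMatrices k (a * b)
  have hle : Submodule.span k (Set.range fun g => ((σ g : GL (Fin 3) k) : Matrix (Fin 3) (Fin 3) k)) ≤
      scalarMatrices (Fin 3) k := Submodule.span_le.2 (by rintro _ ⟨g, rfl⟩; exact hscalar g)
  rw [hspan, top_le_iff] at hle
  have hmem : Matrix.single (0 : Fin 3) (1 : Fin 3) (1 : k) ∈ scalarMatrices (Fin 3) k :=
    hle ▸ Submodule.mem_top
  obtain ⟨d, hd⟩ := (mem_scalarMatrices_iff _).1 hmem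
  have e := congrFun (congrFun hd 0) 1
  simp at e


end Sym4

/-! ### Adequacy of `S₄` in degree `3`, characteristic `3` (an instance of Proposition 6.6) -/

section Sym4Adequate

variable {k : Type u} [Field k]

open Sym4 Matrix

/-- **GHT 2017, Theorem 1.7 for `G = S₄`, `p = 3` (unconditional).**  Let `k` be a field of
characteristic `3` and `σ : S₄ → GL₃(k)` a representation whose matrices span `M₃(k)` (i.e. `σ` is
absolutely irreducible).  Then `σ(S₄) ≤ GL₃(k)` is adequate in the extended sense of
Guralnick–Herzig–Tiep (§1) = Thorne 2017 Def. 2.20.  This is the instance of Theorem 1.7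
(alternative (a); `S₄` has no abelian normal subgroup of index `3` and `24 < 360`) that the tree
uses (the residual image `S₄ < GL₃(𝔽₃)` of the branch-point module of a generic Picard curve), and
an instance of the IMPRIMITIVE case, GHT Prop. 6.6, proved above
(`Subgroup.isExtendedAdequate_of_lines`): on the eigenbasis `(v, σ(t)v, σ(t)²v)` of the Klein
four-group (`Sym4.exists_normalForm`) the group `σ(S₄)` permutes the three lines, `σ(k₁)` is
diagonal non-scalar, and the transposition `σ(s)` fixes one line and swaps the other two
(`[σ(S₄) : A] = 6 ≠ 3`).  Faithfulness (a hypothesis of the printed theorem) is automatic: a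
non-faithful `σ` kills `K₄`, and then its matrices cannot span (`Sym4.span_ne_top_of_map_k₁_eq_one`).
[cite: GuralnickHerzigTiep2017, Theorem 1.7 (case `G = S₄`, `p = 3`) and Proposition 6.6] -/
theorem isExtendedAdequate_range_of_perm_fin4 [CharP k 3] (σ : Equiv.Perm (Fin 4) →* GL (Fin 3) k)
    (hspan : Submodule.span k
      (Set.range fun g => ((σ g : GL (Fin 3) k) : Matrix (Fin 3) (Fin 3) k)) = ⊤) :
    Subgroup.IsExtendedAdequate σ.range := by
  classical
  haveI : Fact (Nat.Prime 3) := ⟨Nat.prime_three⟩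
  have h2 : (2 : k) ≠ 0 := two_ne_zero_of_charP_three
  have hk : σ k₁ ≠ 1 := fun h => span_ne_top_of_map_k₁_eq_one σ h hspan
  obtain ⟨B, ε, hε, hPt, hSs⟩ := exists_normalForm σ hspan hk h2
  have hε0 : ε ≠ 0 := fun h => by rw [h, mul_zero] at hε; exact zero_ne_one hε
  haveI : Finite σ.range := Finite.of_surjective _ σ.rangeRestrict_surjective
  have hirr : (glRepresentation σ.range.subtype).IsIrreducible :=
    isIrreducible_range_subtype σ
      (Literature.RepresentationTheory.Semisimple.isIrreducible_of_span_eq_top (by norm_num) σ hspan)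
  -- the conjugated representation `τ = B⁻¹ σ B` and its values on `t, s, k₁`
  set τ : Equiv.Perm (Fin 4) →* GL (Fin 3) k := (MulAut.conj B⁻¹).toMonoidHom.comp σ with hτdef
  have hτ : ∀ g, τ g = B⁻¹ * σ g * B := fun g => by
    rw [hτdef, MonoidHom.comp_apply, MulEquiv.coe_toMonoidHom, MulAut.conj_apply, inv_inv]
  have hmul : ∀ g h : Equiv.Perm (Fin 4), ((τ (g * h) : GL (Fin 3) k) : Matrix (Fin 3) (Fin 3) k) =
      ((τ g : GL (Fin 3) k) : Matrix (Fin 3) (Fin 3) k) * ((τ h : GL (Fin 3) k) : Matrix _ _ k) :=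
    fun g h => by rw [map_mul, Units.val_mul]
  have hτt : ((τ t : GL (Fin 3) k) : Matrix (Fin 3) (Fin 3) k) = Pm k := by rw [hτ]; exact hPt
  have hτs : ((τ s : GL (Fin 3) k) : Matrix (Fin 3) (Fin 3) k) = Sm ε := by rw [hτ]; exact hSs
  have hτk₁ : ((τ k₁ : GL (Fin 3) k) : Matrix (Fin 3) (Fin 3) k) = D1m := by
    rw [k₁_eq, hmul, hmul, hmul, ← st_sq, hmul, hmul, hτs, hτt, Sm_Pm_sq hε, PPD2P]
  -- the basis of columns of `B` and the action of `σ(g)` on it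
  have hBinj : Function.Injective (B : Matrix (Fin 3) (Fin 3) k).mulVec :=
    Matrix.mulVec_injective_iff_isUnit.2 B.isUnit
  let e : Fin 3 → Fin 3 → k := fun j => (B : Matrix (Fin 3) (Fin 3) k) *ᵥ Pi.single j 1
  have hli : LinearIndependent k e := by
    have h := (Pi.basisFun k (Fin 3)).linearIndependent.map'
      (B : Matrix (Fin 3) (Fin 3) k).mulVecLin (LinearMap.ker_eq_bot.2 (by
        rw [Matrix.coe_mulVecLin]; exact hBinj))
    have he : e = ⇑(B : Matrix (Fin 3) (Fin 3) k).mulVecLin ∘ ⇑(Pi.basisFun k (Fin 3)) := by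
      funext j
      simp [e, Pi.basisFun_apply]
    rw [he]
    exact h
  let b : Module.Basis (Fin 3) k (Fin 3 → k) :=
    basisOfLinearIndependentOfCardEqFinrank hli (by simp)
  have hb : ∀ j, b j = (B : Matrix (Fin 3) (Fin 3) k) *ᵥ Pi.single j 1 := fun j => by
    simp [b, e]
  have hact : ∀ (g : Equiv.Perm (Fin 4)) (j : Fin 3),
      ((σ g : GL (Fin 3) k) : Matrix (Fin 3) (Fin 3) k) *ᵥ b j =
        (B : Matrix (Fin 3) (Fin 3) k) *ᵥ (((τ g : GL (Fin 3) k) : Matrix (Fin 3) (Fin 3) k) *ᵥ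
          Pi.single j 1) := by
    intro g j
    rw [hb, Matrix.mulVec_mulVec, Matrix.mulVec_mulVec, hτ, Units.val_mul, Units.val_mul,
      ← Matrix.mul_assoc, ← Matrix.mul_assoc, Units.mul_inv, Matrix.one_mul]
  have hact_t : ∀ j : Fin 3, ((σ t : GL (Fin 3) k) : Matrix (Fin 3) (Fin 3) k) *ᵥ b j = b (j + 1) := by
    intro j
    rw [hact, hτt, Pm_mulVec_single, hb]
  have hact_s0 : ((σ s : GL (Fin 3) k) : Matrix (Fin 3) (Fin 3) k) *ᵥ b 0 = (-ε) • b 0 := by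
    rw [hact, hτs, Sm_mulVec_single_zero, Matrix.mulVec_smul, hb]
  have hact_s1 : ((σ s : GL (Fin 3) k) : Matrix (Fin 3) (Fin 3) k) *ᵥ b 1 = ε • b 2 := by
    rw [hact, hτs, Sm_mulVec_single_one, Matrix.mulVec_smul, hb]
  have hact_s2 : ((σ s : GL (Fin 3) k) : Matrix (Fin 3) (Fin 3) k) *ᵥ b 2 = ε • b 1 := by
    rw [hact, hτs, Sm_mulVec_single_two, Matrix.mulVec_smul, hb]
  have hact_k₁ : ∀ j : Fin 3, ((σ k₁ : GL (Fin 3) k) : Matrix (Fin 3) (Fin 3) k) *ᵥ b j =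
      (![1, -1, -1] j : k) • b j := by
    intro j
    rw [hact, hτk₁, D1m_mulVec_single, Matrix.mulVec_smul, hb]
  -- every `σ(g)` permutes the three lines (check on the generators `s, t`)
  have hperm' : ∀ (g : Equiv.Perm (Fin 4)) (i : Fin 3), ∃ (j : Fin 3) (c : k),
      ((σ g : GL (Fin 3) k) : Matrix (Fin 3) (Fin 3) k) *ᵥ b i = c • b j := by
    intro g
    have hg : g ∈ Submonoid.closure ({s, t} : Set (Equiv.Perm (Fin 4))) := by
      rw [mclosure_s_t]; exact Submonoid.mem_top g
    refine Submonoid.closure_induction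
      (motive := fun g _ => ∀ i : Fin 3, ∃ (j : Fin 3) (c : k),
        ((σ g : GL (Fin 3) k) : Matrix (Fin 3) (Fin 3) k) *ᵥ b i = c • b j) ?_ ?_ ?_ hg
    · intro x hx i
      simp only [Set.mem_insert_iff, Set.mem_singleton_iff] at hx
      rcases hx with rfl | rfl
      · fin_cases i
        · exact ⟨0, -ε, hact_s0⟩
        · exact ⟨2, ε, hact_s1⟩
        · exact ⟨1, ε, hact_s2⟩
      · exact ⟨i + 1, 1, by rw [hact_t, one_smul]⟩
    · intro i
      exact ⟨i, 1, by rw [map_one, Units.val_one, Matrix.one_mulVec, one_smul]⟩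
    · intro x y _ _ hx hy i
      obtain ⟨j, c, hj⟩ := hy i
      obtain ⟨j', c', hj'⟩ := hx j
      refine ⟨j', c * c', ?_⟩
      rw [map_mul, Units.val_mul, ← Matrix.mulVec_mulVec, hj, Matrix.mulVec_smul, hj', smul_smul]
  have hperm : ∀ (h : σ.range) (i : Fin 3), ∃ (j : Fin 3) (c : k),
      ((h : GL (Fin 3) k) : Matrix (Fin 3) (Fin 3) k) *ᵥ b i = c • b j := by
    rintro ⟨_, g, rfl⟩ i
    exact hperm' g i
  refine Subgroup.isExtendedAdequate_of_lines σ.range hirr b hperm ?_ ?_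
  · -- `σ(k₁)` is diagonal along `b` with the two eigenvalues `1 ≠ -1`
    refine ⟨⟨σ k₁, k₁, rfl⟩, ![1, -1, -1], hact_k₁, 0, 1, ?_⟩
    intro h
    have h' : (1 : k) = -1 := by simpa using h
    apply h2
    linear_combination h'
  · -- `σ(s)` fixes the line `k · b 0` and moves the line `k · b 1`
    refine ⟨⟨σ s, s, rfl⟩, 0, 1, ⟨-ε, hact_s0⟩, fun c hc => ?_⟩
    have hc' : ε • b 2 = c • b 1 := by rw [← hact_s1]; exact hc
    exact absurd (MonomialAdequacy.basis_index_eq_of_smul_eq b hc' hε0) (by decide)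

/-- **GHT 2017, Theorem 1.7 for `G = S₄`, `p = 3`**, absolutely irreducible form: for `k` of
characteristic `3` and `σ : S₄ → GL₃(k)` absolutely irreducible (`IsAbsIrreducible`), `σ(S₄)` is
adequate in the extended sense. [cite: GuralnickHerzigTiep2017, Theorem 1.7 (case `G = S₄`, `p = 3`)] -/
theorem isExtendedAdequate_range_of_isAbsIrreducible_perm_fin4 [CharP k 3]
    (σ : Equiv.Perm (Fin 4) →* GL (Fin 3) k) (hirr : IsAbsIrreducible σ) :
    Subgroup.IsExtendedAdequate σ.range :=
  isExtendedAdequate_range_of_perm_fin4 σ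
    ((Literature.RepresentationTheory.Semisimple.span_eq_top_iff_forall_isIrreducible
      (by norm_num) σ).2 hirr)

/-- **GHT 2017, Theorem 1.7 for the symmetric group of a `4`-element set, `p = 3`**: for `k` of
characteristic `3` and `σ : Sym(X) → GL₃(k)` (`|X| = 4`) whose matrices span `M₃(k)`, `σ(Sym X)`
is adequate in the extended sense.  (The form needed for `Sym(Roots f)` of a quartic `f`.)
[cite: GuralnickHerzigTiep2017, Theorem 1.7 (case `G = S₄`, `p = 3`)] -/
theorem isExtendedAdequate_range_of_perm_card_four [CharP k 3] {X : Type*} [Fintype X]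
    [DecidableEq X] (hX : Fintype.card X = 4) (σ : Equiv.Perm X →* GL (Fin 3) k)
    (hspan : Submodule.span k
      (Set.range fun g => ((σ g : GL (Fin 3) k) : Matrix (Fin 3) (Fin 3) k)) = ⊤) :
    Subgroup.IsExtendedAdequate σ.range := by
  obtain ⟨e⟩ : Nonempty (X ≃ Fin 4) := Fintype.card_eq.1 (by rw [hX, Fintype.card_fin])
  let ι : Equiv.Perm (Fin 4) ≃* Equiv.Perm X := (Equiv.permCongrHom e).symm
  let σ' : Equiv.Perm (Fin 4) →* GL (Fin 3) k := σ.comp ι.toMonoidHom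
  have hsurj : Function.Surjective ι.toMonoidHom := ι.surjective
  have hrange : σ'.range = σ.range := by
    rw [MonoidHom.range_comp, MonoidHom.range_eq_top.2 hsurj, ← MonoidHom.range_eq_map]
  have hset : (Set.range fun g => ((σ' g : GL (Fin 3) k) : Matrix (Fin 3) (Fin 3) k)) =
      Set.range fun g => ((σ g : GL (Fin 3) k) : Matrix (Fin 3) (Fin 3) k) := by
    change Set.range ((fun g => ((σ g : GL (Fin 3) k) : Matrix (Fin 3) (Fin 3) k)) ∘ ι.toMonoidHom) = _
    exact hsurj.range_comp _
  rw [← hrange]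
  exact isExtendedAdequate_range_of_perm_fin4 σ' (by rw [hset]; exact hspan)

/-- The same for `σ : Sym(X) → GL₃(k)` absolutely irreducible, `|X| = 4`.
[cite: GuralnickHerzigTiep2017, Theorem 1.7 (case `G = S₄`, `p = 3`)] -/
theorem isExtendedAdequate_range_of_isAbsIrreducible_perm_card_four [CharP k 3] {X : Type*}
    [Fintype X] [DecidableEq X] (hX : Fintype.card X = 4) (σ : Equiv.Perm X →* GL (Fin 3) k)
    (hirr : IsAbsIrreducible σ) : Subgroup.IsExtendedAdequate σ.range :=
  isExtendedAdequate_range_of_perm_card_four hX σ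
    ((Literature.RepresentationTheory.Semisimple.span_eq_top_iff_forall_isIrreducible
      (by norm_num) σ).2 hirr)

end Sym4Adequate

end Literature.NumberTheory.GaloisRepresentations
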